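import Mathlib
import Summits.ValiantsHypothesis.ValiantsHypothesis.Theses.DivisionGap
import Summits.ValiantsHypothesis.ValiantsHypothesis.Theorems.ZeroOneTransfer.Negative.TopComponentFree
import Summits.ValiantsHypothesis.ValiantsHypothesis.Theorems.PerDivisionHard.Negative.PerSupportBound
import Summits.ValiantsHypothesis.ValiantsHypothesis.Theorems.PerDivisionHard.Negative.PlainBridge
import Summits.ValiantsHypothesis.ValiantsHypothesis.Theorems.PerDivisionHard.Negative.VarsCounting
import Summits.ValiantsHypothesis.ValiantsHypothesis.Theorems.DivisionGapPerMultiplesHardStubTorus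
import Summits.ValiantsHypothesis.ValiantsHypothesis.Theorems.DivisionGapPerMultiplesHardStubFaceDescent
import Summits.ValiantsHypothesis.ValiantsHypothesis.Theorems.DivisionGapPerDivisionHardStubJssContraction
import Summits.ValiantsHypothesis.ValiantsHypothesis.Theorems.DivisionGapPerMultiplesHardStubRichFaces
import Summits.ValiantsHypothesis.ValiantsHypothesis.Theorems.DivisionGapPerMultiplesHardStubTypedDecomposition
import Summits.ValiantsHypothesis.ValiantsHypothesis.Theorems.DivisionGapPerMultiplesHardStubAlignedRigidity
import Summits.ValiantsHypothesis.ValiantsHypothesis.Theorems.DivisionGapPerMultiplesHardThinPatterns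
import Summits.ValiantsHypothesis.ValiantsHypothesis.Theorems.DivisionGapPerMultiplesHardStubRowConcentration
-- (olean not yet built on the farm; re-import when available) import Summits.ValiantsHypothesis.ValiantsHypothesis.Theorems.DivisionGapPerMultiplesHardStubColConcentration
import Summits.ValiantsHypothesis.ValiantsHypothesis.Theorems.DivisionGapPerMultiplesHardStubTypedDecompositionFifth
import Summits.ValiantsHypothesis.ValiantsHypothesis.Theorems.DivisionGapPerMultiplesHardStubSpreadRigidity
import Summits.ValiantsHypothesis.ValiantsHypothesis.Theorems.DivisionGapPerMultiplesHardStubSpreadRigidityGen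
import Summits.ValiantsHypothesis.ValiantsHypothesis.Theorems.DivisionGapPerMultiplesHardStubBlockProjection
import Summits.ValiantsHypothesis.ValiantsHypothesis.Theorems.DivisionGapPerMultiplesHardStubZRigidity
import Summits.ValiantsHypothesis.ValiantsHypothesis.Theorems.DivisionGapPerMultiplesHardStubTypedDecompositionL
import Summits.ValiantsHypothesis.ValiantsHypothesis.Theorems.DivisionGapPerMultiplesHardStubBoardCompression
import Summits.ValiantsHypothesis.ValiantsHypothesis.Theorems.DivisionGapPerMultiplesHardStubSharpChoose
import Summits.ValiantsHypothesis.ValiantsHypothesis.Theorems.DivisionGapPerMultiplesHardSpreadPatterns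
import Summits.ValiantsHypothesis.ValiantsHypothesis.Theorems.DivisionGapPerMultiplesHardZSpreadPatterns
import Summits.ValiantsHypothesis.ValiantsHypothesis.Theorems.DivisionGapPerMultiplesHardStubLinkCircuit
import Summits.ValiantsHypothesis.ValiantsHypothesis.Theorems.DivisionGapPerMultiplesHardRichFacesDeep
import Summits.ValiantsHypothesis.ValiantsHypothesis.Theorems.DivisionGapPerMultiplesHardStubTypedDecompositionLL
import Summits.ValiantsHypothesis.ValiantsHypothesis.Theorems.DivisionGapPerMultiplesHardStubSharpSubSupportCount
import Summits.ValiantsHypothesis.ValiantsHypothesis.Theorems.DivisionGapPerMultiplesHardDeepCount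
import Summits.ValiantsHypothesis.ValiantsHypothesis.Theorems.DivisionGapPerMultiplesHardStubRectangleBound
import Summits.ValiantsHypothesis.ValiantsHypothesis.Theorems.DivisionGapPerMultiplesHardStubHostDescent
import Summits.ValiantsHypothesis.ValiantsHypothesis.Theorems.DivisionGapPerMultiplesHardStubHostTorus
import Summits.ValiantsHypothesis.ValiantsHypothesis.Theorems.DivisionGapPerMultiplesHardStubBoardCompressionGen
import Summits.ValiantsHypothesis.ValiantsHypothesis.Theorems.DivisionGapPerMultiplesHardStubPureLevelProduct
import Summits.ValiantsHypothesis.ValiantsHypothesis.Theorems.DivisionGapPerMultiplesHardStubLevelEntropy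
import Summits.ValiantsHypothesis.ValiantsHypothesis.Theorems.DivisionGapPerMultiplesHardStubLevelSlice
import Summits.ValiantsHypothesis.ValiantsHypothesis.Theorems.DivisionGapPerMultiplesHardStubHostBlockProjection
import Summits.ValiantsHypothesis.ValiantsHypothesis.Theorems.DivisionGapPerMultiplesHardDeepPureCount
import Summits.ValiantsHypothesis.ValiantsHypothesis.Theorems.DivisionGapPerMultiplesHardDeepPureCountLevel
import Summits.ValiantsHypothesis.ValiantsHypothesis.Theorems.DivisionGapPerMultiplesHardStubHostDescentIn
import Summits.ValiantsHypothesis.ValiantsHypothesis.Theorems.DivisionGapPerMultiplesHardStubHostBlockParts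
import Summits.ValiantsHypothesis.ValiantsHypothesis.Theorems.DivisionGapPerMultiplesHardStubTwoBandTable
import Summits.ValiantsHypothesis.ValiantsHypothesis.Theorems.DivisionGapPerMultiplesHardStubCompleteClassRung
import Summits.ValiantsHypothesis.ValiantsHypothesis.Theorems.DivisionGapPerMultiplesHardPushOff
import Summits.ValiantsHypothesis.ValiantsHypothesis.Theorems.DivisionGapPerMultiplesHardSpreadPatternsRel
import Summits.ValiantsHypothesis.ValiantsHypothesis.Theorems.DivisionGapPerMultiplesHardZSpreadPatternsRel
import Summits.ValiantsHypothesis.ValiantsHypothesis.Theorems.DivisionGapPerMultiplesHardStubSubSupportCountRel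
import Summits.ValiantsHypothesis.ValiantsHypothesis.Theorems.DivisionGapPerMultiplesHardStubSpreadCaptureRel
import Summits.ValiantsHypothesis.ValiantsHypothesis.Theorems.DivisionGapPerMultiplesHardStubBregmanFibre
import Summits.ValiantsHypothesis.ValiantsHypothesis.Theorems.DivisionGapPerMultiplesHardRichFacesDeep2
import Summits.ValiantsHypothesis.ValiantsHypothesis.Theorems.DivisionGapPerMultiplesHardDeepCount
import Summits.ValiantsHypothesis.ValiantsHypothesis.Theorems.DivisionGapPerMultiplesHardDensePerHardReg
import Summits.ValiantsHypothesis.ValiantsHypothesis.Theorems.DivisionGapPerMultiplesHardStubZCaptureRel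
import Summits.ValiantsHypothesis.ValiantsHypothesis.Theorems.DivisionGapPerMultiplesHardStubLogFactorialJensen
import Summits.ValiantsHypothesis.ValiantsHypothesis.Theorems.DivisionGapPerMultiplesHardStubStirlingGamma
import Summits.ValiantsHypothesis.ValiantsHypothesis.Theorems.DivisionGapPerMultiplesHardRelDenseHostAux
import Summits.ValiantsHypothesis.ValiantsHypothesis.Theorems.DivisionGapPerMultiplesHardRelDenseHost
import Summits.ValiantsHypothesis.ValiantsHypothesis.Theorems.DivisionGapPerMultiplesHardRelDenseCompleteClass
import Summits.ValiantsHypothesis.ValiantsHypothesis.Theorems.DivisionGapPerMultiplesHardStubSparseAvoidingMatchings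
import Summits.ValiantsHypothesis.ValiantsHypothesis.Theorems.DivisionGapPerMultiplesHardStubRegularFactor
import Summits.ValiantsHypothesis.ValiantsHypothesis.Theorems.DivisionGapPerMultiplesHardStubRealRootedRestriction
import Literature.Combinatorics.StablePolynomials.GurvitsCapacityUnivariate
import Literature.Combinatorics.StablePolynomials.RealRootedRestriction
import Literature.Combinatorics.StablePolynomials.ProductLinearForms
import Literature.Combinatorics.Enumerative.PermanentProductForm
import Literature.Combinatorics.StablePolynomials.GurvitsCapacity
import Literature.Combinatorics.Enumerative.VanDerWaerdenPermanentProofs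
import Summits.ValiantsHypothesis.ValiantsHypothesis.Theorems.DivisionGapPerMultiplesHardStubRichHostConstantMarginsRaw
import Summits.ValiantsHypothesis.ValiantsHypothesis.Theorems.DivisionGapPerMultiplesHardStubRichHostConstantMargins
import Summits.ValiantsHypothesis.ValiantsHypothesis.Theorems.DivisionGapPerMultiplesHardStubRegularPairFactor
import Summits.ValiantsHypothesis.ValiantsHypothesis.Theorems.DivisionGapPerMultiplesHardRelDenseCompleteClassTwoHost
import Summits.ValiantsHypothesis.ValiantsHypothesis.Theorems.DivisionGapPerMultiplesHardStubTypedDecompositionLocal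
import Summits.ValiantsHypothesis.ValiantsHypothesis.Theorems.DivisionGapPerMultiplesHardStubTwoBandTableOn
import Summits.ValiantsHypothesis.ValiantsHypothesis.Theorems.DivisionGapPerMultiplesHardStubHybridRigidity
import Summits.ValiantsHypothesis.ValiantsHypothesis.Theorems.DivisionGapPerMultiplesHardStubHybridCaptureRel
import Summits.ValiantsHypothesis.ValiantsHypothesis.Theorems.DivisionGapPerMultiplesHardStubHybridSpreadRel
import Summits.ValiantsHypothesis.ValiantsHypothesis.Theorems.DivisionGapPerMultiplesHardStubBlockBregman
import Summits.ValiantsHypothesis.ValiantsHypothesis.Theorems.DivisionGapPerMultiplesHardStubFibLeRelaxed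
import Summits.ValiantsHypothesis.ValiantsHypothesis.Theorems.DivisionGapPerMultiplesHardStubHybridDenseHost
import Summits.ValiantsHypothesis.ValiantsHypothesis.Theorems.DivisionGapPerMultiplesHardStubHybridProbeAssembly
import Summits.ValiantsHypothesis.ValiantsHypothesis.Theorems.DivisionGapPerMultiplesHardStubBlockCountOfFactor
import Literature.Combinatorics.Optimization.BipartiteRegularFactor
import Literature.Combinatorics.Enumerative.VanDerWaerdenPermanent
import Literature.Combinatorics.StablePolynomials.Basic
import Literature.Combinatorics.StablePolynomials.Limits
import Literature.Combinatorics.Optimization.HoffmanCirculationProofs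
import Literature.Computability.AlgebraicComplexity.RealTauConjectureDepthFour
import Literature.Computability.AlgebraicComplexity.ArithCircuitProofs
import Literature.Computability.AlgebraicComplexity.PermanentIrreducible
import Literature.Computability.AlgebraicComplexity.StandardFamiliesProofs
import Summits.ValiantsHypothesis.ValiantsHypothesis.Theorems.DivisionGapPerMultiplesHardStubTransportation
import Summits.ValiantsHypothesis.ValiantsHypothesis.Theorems.DivisionGapPerMultiplesHardStubHeavyTable
import Summits.ValiantsHypothesis.ValiantsHypothesis.Theorems.DivisionGapPerMultiplesHardStubBlockSliceParts
import Summits.ValiantsHypothesis.ValiantsHypothesis.Theorems.DivisionGapPerMultiplesHardStubMarginSlice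
import Summits.ValiantsHypothesis.ValiantsHypothesis.Theorems.DivisionGapPerMultiplesHardStubTwoBandTableW
import Summits.ValiantsHypothesis.ValiantsHypothesis.Theorems.DivisionGapPerMultiplesHardSpreadPatternsRelD
import Summits.ValiantsHypothesis.ValiantsHypothesis.Theorems.DivisionGapPerMultiplesHardStubRelRegularCount
import Summits.ValiantsHypothesis.ValiantsHypothesis.Theorems.DivisionGapPerMultiplesHardStubFaceOntoHost
import Summits.ValiantsHypothesis.ValiantsHypothesis.Theorems.DivisionGapPerMultiplesHardStubBlockCompletion
import Summits.ValiantsHypothesis.ValiantsHypothesis.Theorems.DivisionGapPerMultiplesHardStubBlockMargins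
import Summits.ValiantsHypothesis.ValiantsHypothesis.Theorems.DivisionGapPerMultiplesHardStubSmallWindowArith
import Summits.ValiantsHypothesis.ValiantsHypothesis.Theorems.DivisionGapPerMultiplesHardStubEventuallyExp
import Summits.ValiantsHypothesis.ValiantsHypothesis.Theorems.DivisionGapPerMultiplesHardRichHostOfSquareBlock
import Summits.ValiantsHypothesis.ValiantsHypothesis.Theorems.DivisionGapPerMultiplesHardStubCodegreeMixing
import Summits.ValiantsHypothesis.ValiantsHypothesis.Theorems.DivisionGapPerMultiplesHardStubFewRunsCount
import Summits.ValiantsHypothesis.ValiantsHypothesis.Theorems.DivisionGapPerMultiplesHardStubPermCounts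
import Summits.ValiantsHypothesis.ValiantsHypothesis.Theorems.DivisionGapPerMultiplesHardStubSwapRepair
import Summits.ValiantsHypothesis.ValiantsHypothesis.Theorems.DivisionGapPerMultiplesHardStubColumnRunsArith
import Summits.ValiantsHypothesis.ValiantsHypothesis.Theorems.DivisionGapPerMultiplesHardOrderedFactor
import Summits.ValiantsHypothesis.ValiantsHypothesis.Theorems.DivisionGapPerMultiplesHardOrderedFactorRichHost
import Summits.ValiantsHypothesis.ValiantsHypothesis.Theorems.DivisionGapPerMultiplesHardStubDenseRegularPair
import Summits.ValiantsHypothesis.ValiantsHypothesis.Theorems.DivisionGapPerMultiplesHardStubRegularPairClean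
import Summits.ValiantsHypothesis.ValiantsHypothesis.Theorems.DivisionGapPerMultiplesHardStubCodegreeDeviation
import Summits.ValiantsHypothesis.ValiantsHypothesis.Theorems.DivisionGapPerMultiplesHardStubMatchingGlue
import Summits.ValiantsHypothesis.ValiantsHypothesis.Theorems.DivisionGapPerMultiplesHardStubMatchingCount
import Summits.ValiantsHypothesis.ValiantsHypothesis.Theorems.DivisionGapPerMultiplesHardRichPiece
import Summits.ValiantsHypothesis.ValiantsHypothesis.Theorems.DivisionGapPerMultiplesHardExtraction
import Summits.ValiantsHypothesis.ValiantsHypothesis.Theorems.DivisionGapPerMultiplesHardStubMassRectangleBound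

/-!
# Line `uncharged-face-walk` — checked skeleton for crux `PerMultiplesHard`
(item `stmt-ValiantsHypothesis-5068`, route `DivisionGap`; crux-plan round 1; LEAD -0 integration 2026-08-16T09:00Z;
LEAD c1 RESHAPE 2026-08-16T11:30Z; LEAD c2 cycle 2 2026-08-16T14:40Z)

## STATUS (line lead prover-line-stmt-ValiantsHypothesis-5068-c10-0, CYCLE 10, 2026-08-17T13:4xZ): RESHAPE — one new provable-now stub `stub_massRectangleBound`
## (the MASS JAW: Jerrum–Snir window located by TOTAL DEGREE, degree-free, typed; Literature template `exists_decomposition`) and the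
## matching MASS-FAT hypothesis of `stub_residual`, discharged in `PerMultiplesHard_of` (`hmrect`); the stub LANDED p163982 (wave 1, 1/1).  sorries =
## `stub_residual` ONLY.  Cycle-10 analysis (support barrier / exponent hiding / why degree is not the obstruction): crux NOTES §L.
## EARLIER STATUS (line lead prover-line-stmt-ValiantsHypothesis-5068-c9-0, CYCLE 9, 2026-08-17): the extraction target `stub_quasiRandomSquareBlock` is PROVED and
## LANDED (p144798; Hall-surplus/extendability + richness-potential splits + Szemerédi; crux NOTES §K) from five worker stubs (wave 1, 5/5: p142053
## `stub_denseRegularPair`, p142231 `stub_regularPairClean`, p142486 `stub_codegreeDeviation`, p141377 `stub_matchingGlue`, p141817 `stub_matchingCount`) and the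
## lead's p143491 `RichPieceArith`, p143745 `extremal_piece`, p144228 `stub_richPiece`, p144798 `Extraction`; `richHostCompleteClassHard` is now SORRY-FREE here.
## sorries (end of c9) = `stub_residual` ONLY (the crux on the stall class).
## EARLIER STATUS PARAGRAPHS (leads c0–c8, cycles 1–8): see the evidence copies of this skeleton on the item (20260816T08…Z – 20260817T03…Z) and crux
## NOTES.md §C–§J; every stub they name is LANDED and imported above by name (p85465 … p139326).

Crux (FIXED, concluded BY NAME below; the multiplier `h` is NOT charged):
`PerMultiplesHard := ∀ c, ∃ n₀, ∀ n ≥ n₀, ∀ h : ℝ≥0[x_ij] (n × n), h ≠ 0 →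
  2 ^ ((Nat.log 2 n + c) ^ c) < L(per_n · h)`, `L = complexity` over the semiring `ℝ≥0`.

## The line (idea card `Ideas/uncharged-face-walk.md`; TRIAGE-r1-{1,2,3}: pass ×3)

Walk the pair `(per_G · h, h)` down the faces `G` of the Birkhoff polytope, never paying for `h`:
initial forms and positive substitutions are free over `ℝ≥0`, `top_w(per_n · h) = per_G · top_w(h)`
whenever `w` cuts out the face `G` (tree: `complexity_topComponent_le`, `topComponent_mul`).  The walk started at
`(K_{n,n}, h)` can be steered to a face `G` on which the cofactor's top fibre has a single `G`-part (`HasSingleGPart`,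
then the `G`-part is a monomial, stripped by Jukna–Seiwert–Sergeev, `stub_jssContraction`) UNLESS `h` is ALIGNED with
every rich face; richness is measured by COUNT (`stub_richFaces`, Jerrum–Snir by sub-support); the second jaw is the typed
vertex count `thinPatterns` (pure monomials cost `C(n,⌈n/3⌉)/n!` each); the normal form `stub_torus` is torus-homogeneous
and content-free; NEW third jaw (c1): line projection (`stub_rowConcentration`/`stub_colConcentration`); the OPEN stub
`stub_residual` is the crux on the stall class.

## Composition (`PerMultiplesHard_of`, sorry-free: logic + `qp_absorb`): see the theorem's docstring below and crux NOTES §C–§G for the branch list.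

## Disproof.lean obligations honoured (cdisprove v6): unchanged from lead -0's list (see the evidence copies of this skeleton ≤ 19:05Z): `h ≠ 0`
## consumed by `stub_torus`/`stub_faceDescent`/concentration stubs and a hypothesis of `stub_residual`; all stubs support-level over `ℝ≥0`
## (false in char 2); `n₀(c)` supplied by `PerMultiplesHard_of`; `-- Targets`: none.
-/

noncomputable section

set_option linter.dupNamespace false
set_option linter.unusedVariables false

namespace Summit.ValiantsHypothesis.ValiantsHypothesis.Cruxes.PerMultiplesHard.UnchargedFaceWalk

open MvPolynomial Literature.Computability.AlgebraicComplexity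
open Summit.ValiantsHypothesis.ValiantsHypothesis.Theorems.ZeroOneTransfer.Negative (topComponent)
open scoped NNReal BigOperators

/-! ### Local vocabulary (transparent definitions over Mathlib / tree notions; `facePer`, `CutsOut`,
`HasSingleGPart` are VERBATIM those of `Cruxes/PerDivisionHard/Lines/pair-descent-jss-endpoint.lean`,
so `stub_faceDescent` / `stub_jssContraction` are shared stubs: one proof serves both lines) -/

/-- The face permanent `per_G`: the sum of the permutation monomials `x^{μ_σ}`
(`μ_σ = Σ_i e_{(σ i, i)}`, the tree's `permMonomial`) over the permutations inside `G ⊆ [n]²`. -/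
def facePer {n : ℕ} (G : Finset (Fin n × Fin n)) : MvPolynomial (Fin n × Fin n) ℝ≥0 :=
  ∑ σ ∈ (Finset.univ : Finset (Equiv.Perm (Fin n))).filter (fun σ => ∀ i, (σ i, i) ∈ G),
    monomial (permMonomial σ) (1 : ℝ≥0)

/-- `#PM(G)`: the number of perfect matchings (permutations) inside `G` = `|supp (facePer G)|`. -/
def pmCount {n : ℕ} (G : Finset (Fin n × Fin n)) : ℕ :=
  ((Finset.univ : Finset (Equiv.Perm (Fin n))).filter (fun σ => ∀ i, (σ i, i) ∈ G)).card

/-- `w` CUTS OUT the face `G`: a permutation lies inside `G` iff its `w`-weight is maximal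
(then `top_w(per_n) = facePer G`; it forces a perfect matching inside `G`). -/
def CutsOut {n : ℕ} (w : Fin n × Fin n → ℕ) (G : Finset (Fin n × Fin n)) : Prop :=
  ∀ σ : Equiv.Perm (Fin n),
    (∀ i, (σ i, i) ∈ G) ↔ ∀ τ : Equiv.Perm (Fin n), (∑ i, w (τ i, i)) ≤ ∑ i, w (σ i, i)

/-- The top-`w` fibre of `h` has the SINGLE `G`-part `u` (monomials may differ OFF `G`).  The walk's
success state: `u = 0` is the card's stall-free endpoint "the cofactor's variables avoid `G`". -/
def HasSingleGPart {n : ℕ} (G : Finset (Fin n × Fin n)) (w : Fin n × Fin n → ℕ)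
    (h : MvPolynomial (Fin n × Fin n) ℝ≥0) (u : (Fin n × Fin n) →₀ ℕ) : Prop :=
  u.support ⊆ G ∧ ∀ m ∈ (topComponent w h).support, ∀ e ∈ G, m e = u e

/-- **Block-diagonal monomials with a single block part (NEW lever, lead c1).**  For row set `A` and column set `B` (of equal
size), a monomial is BLOCK-DIAGONAL if each of its cells lies in `A × B` or in `Aᶜ × Bᶜ`; `HasSingleBlockPart A B h u` says that `h`
has a block-diagonal monomial and that ALL block-diagonal monomials of `h` agree with `u` on the block `A × B` (they may differ on
`Aᶜ × Bᶜ` — this is what distinguishes the lever from `HasSingleGPart` on the block-diagonal face, which demands agreement on the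
whole face).  Then the face `A×B ∪ Aᶜ×Bᶜ` followed by the projection of the `Aᶜ × Bᶜ` variables to `1` leaves `c · x^u · per_{A×B}`. -/
def HasSingleBlockPart {n : ℕ} (A B : Finset (Fin n)) (h : MvPolynomial (Fin n × Fin n) ℝ≥0)
    (u : (Fin n × Fin n) →₀ ℕ) : Prop :=
  (∃ m ∈ h.support, ∀ e ∈ m.support, (e.1 ∈ A ↔ e.2 ∈ B)) ∧
    ∀ m ∈ h.support, (∀ e ∈ m.support, (e.1 ∈ A ↔ e.2 ∈ B)) → ∀ e : Fin n × Fin n, e.1 ∈ A → e.2 ∈ B → m e = u e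

/-- Number of PURE monomials of `g`: those supported inside the graph `{(π j, j)}` of some
permutation (for `g = per_n · h`: the pairs `(π, A)`, `A ∈ supp h` supported inside `π` — the card's
"thin patterns"). -/
def pureCount {n : ℕ} (g : MvPolynomial (Fin n × Fin n) ℝ≥0) : ℕ :=
  (g.support.filter fun m => ∃ σ : Equiv.Perm (Fin n), ∀ e ∈ m.support, e.1 = σ e.2).card

/-- Number of monomials of `g` supported inside the graph of the fixed permutation `π`. -/
def pureCountAt {n : ℕ} (g : MvPolynomial (Fin n × Fin n) ℝ≥0) (π : Equiv.Perm (Fin n)) : ℕ :=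
  (g.support.filter fun m => ∀ e ∈ m.support, e.1 = π e.2).card

/-- The type constant `K_n = ⌊2n/3⌋! · (n - ⌊2n/3⌋)!` (≤ `n!/C(n,⌈n/3⌉)` up to rounding): the
number of permutations one balanced typed gate can serve. -/
def typeK (n : ℕ) : ℕ := (2 * n / 3).factorial * (n - 2 * n / 3).factorial

/-- **Spread probes (NEW, lead c1).**  Fix a ROW SHIFT `ζ : Equiv.Perm (Fin n)` (the basic instance is the rotation
`finRotate n`, `i ↦ i + 1`).  The exponent `M` is a `ζ`-SPREAD PROBE for `π`: every cell of `M` lies on the permutation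
pattern of `π` (cells `(π j, j)`) or on its `ζ`-shift (cells `(ζ⁻¹ (π j), j)`), i.e. in each row `i` only the two columns
`π⁻¹ i`, `π⁻¹ (ζ i)` may be occupied.  Pure monomials are the case where the shift is unused. -/
def IsSpreadProbe {n : ℕ} (ζ π : Equiv.Perm (Fin n)) (M : (Fin n × Fin n) →₀ ℕ) : Prop :=
  ∀ e ∈ M.support, π e.2 = e.1 ∨ π e.2 = ζ e.1

/-- `IsSpreadProbe` is decidable (a finite conjunction of equalities in `Fin n`). -/
instance {n : ℕ} (ζ π : Equiv.Perm (Fin n)) (M : (Fin n × Fin n) →₀ ℕ) : Decidable (IsSpreadProbe ζ π M) := by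
  unfold IsSpreadProbe; infer_instance

/-- Number of permutations `π` for which `g` has a `ζ`-spread probe in its support (the quantity the spread
engine bounds by `L(g) · (4/5)^{n/10} · n!`, for every fixed `ζ`). -/
def spreadCount {n : ℕ} (ζ : Equiv.Perm (Fin n)) (g : MvPolynomial (Fin n × Fin n) ℝ≥0) : ℕ :=
  ((Finset.univ : Finset (Equiv.Perm (Fin n))).filter fun π => ∃ M ∈ g.support, IsSpreadProbe ζ π M).card

/-- The set of permutations COMPATIBLE (for the shift `ζ`) with a typed rectangle of row support `S` and column
support `T`: every row of `S` sees `T` through one of its two probe columns, and every column of `T` is a probe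
column of some row of `S`. -/
def spreadCompatible {n : ℕ} (ζ : Equiv.Perm (Fin n)) (S T : Finset (Fin n)) : Finset (Equiv.Perm (Fin n)) :=
  (Finset.univ : Finset (Equiv.Perm (Fin n))).filter fun π =>
    (∀ i ∈ S, π.symm i ∈ T ∨ π.symm (ζ i) ∈ T) ∧
    (∀ j ∈ T, π j ∈ S ∨ ∃ i ∈ S, ζ i = π j)

/-- Column probes: `M` is a `ζ`-COLUMN-probe for `π` if every cell `(a, b)` of `M` has `π a = b ∨ π a = ζ b` — the transpose of a
row probe: in each column `j` only the two rows `π⁻¹ j`, `π⁻¹ (ζ j)` may be occupied. -/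
def IsColSpreadProbe {n : ℕ} (ζ π : Equiv.Perm (Fin n)) (M : (Fin n × Fin n) →₀ ℕ) : Prop :=
  ∀ e ∈ M.support, π e.1 = e.2 ∨ π e.1 = ζ e.2

/-- `IsColSpreadProbe` is decidable. -/
instance {n : ℕ} (ζ π : Equiv.Perm (Fin n)) (M : (Fin n × Fin n) →₀ ℕ) : Decidable (IsColSpreadProbe ζ π M) := by
  unfold IsColSpreadProbe; infer_instance

/-- Number of permutations with a `ζ`-column-probe in `supp g`. -/
def colSpreadCount {n : ℕ} (ζ : Equiv.Perm (Fin n)) (g : MvPolynomial (Fin n × Fin n) ℝ≥0) : ℕ :=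
  ((Finset.univ : Finset (Equiv.Perm (Fin n))).filter fun π => ∃ M ∈ g.support, IsColSpreadProbe ζ π M).card

/-- **`Z`-probes (the k-cell spread engine, lead c1 wave 3).**  For a finite set `Z` of row shifts (normally containing `1`), the
exponent `M` is a `Z`-probe for `π` if every cell `(a, b)` of `M` has `π b = ζ a` for some `ζ ∈ Z`: row `a` uses only the `#Z` columns
`π⁻¹ (ζ a)`.  `Z = {1, ζ}` is the spread probe. -/
def IsZProbe {n : ℕ} (Z : Finset (Equiv.Perm (Fin n))) (π : Equiv.Perm (Fin n)) (M : (Fin n × Fin n) →₀ ℕ) : Prop :=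
  ∀ e ∈ M.support, ∃ ζ ∈ Z, π e.2 = ζ e.1

/-- Decidability of `IsZProbe`. -/
instance {n : ℕ} (Z : Finset (Equiv.Perm (Fin n))) (π : Equiv.Perm (Fin n)) (M : (Fin n × Fin n) →₀ ℕ) :
    Decidable (IsZProbe Z π M) := by
  unfold IsZProbe; infer_instance

/-- Number of permutations with a `Z`-probe in `supp g`. -/
def zCount {n : ℕ} (Z : Finset (Equiv.Perm (Fin n))) (g : MvPolynomial (Fin n × Fin n) ℝ≥0) : ℕ :=
  ((Finset.univ : Finset (Equiv.Perm (Fin n))).filter fun π => ∃ M ∈ g.support, IsZProbe Z π M).card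

/-- Column `Z`-probes (transpose): every cell `(a, b)` has `π a = ζ b` for some `ζ ∈ Z`. -/
def IsColZProbe {n : ℕ} (Z : Finset (Equiv.Perm (Fin n))) (π : Equiv.Perm (Fin n)) (M : (Fin n × Fin n) →₀ ℕ) : Prop :=
  ∀ e ∈ M.support, ∃ ζ ∈ Z, π e.1 = ζ e.2

/-- Decidability of `IsColZProbe`. -/
instance {n : ℕ} (Z : Finset (Equiv.Perm (Fin n))) (π : Equiv.Perm (Fin n)) (M : (Fin n × Fin n) →₀ ℕ) :
    Decidable (IsColZProbe Z π M) := by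
  unfold IsColZProbe; infer_instance

/-- Number of permutations with a column `Z`-probe in `supp g`. -/
def colZCount {n : ℕ} (Z : Finset (Equiv.Perm (Fin n))) (g : MvPolynomial (Fin n × Fin n) ℝ≥0) : ℕ :=
  ((Finset.univ : Finset (Equiv.Perm (Fin n))).filter fun π => ∃ M ∈ g.support, IsColZProbe Z π M).card

/-- Permutations compatible with a typed rectangle `(S, T)` for the shift set `Z`. -/
def zCompatible {n : ℕ} (Z : Finset (Equiv.Perm (Fin n))) (S T : Finset (Fin n)) : Finset (Equiv.Perm (Fin n)) :=
  (Finset.univ : Finset (Equiv.Perm (Fin n))).filter fun π =>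
    (∀ i ∈ S, ∃ ζ ∈ Z, π.symm (ζ i) ∈ T) ∧ (∀ j ∈ T, ∃ ζ ∈ Z, ∃ i ∈ S, ζ i = π j)

/-! ### Registered stubs -/

/-- **stub_torus — the free normal form: torus-homogeneous and content-free, up to a monomial factor …
(LANDED; the full docstring — statement in words, proof route, sources — is carried by the tree file referenced in the proof term below; shortened here by lead c6 to keep the workfile under the 200 kB limit.) [folklore] -/
theorem stub_torus (n : ℕ) (h : MvPolynomial (Fin n × Fin n) ℝ≥0) (hh : h ≠ 0) :
    ∃ (g : (Fin n × Fin n) →₀ ℕ) (h' : MvPolynomial (Fin n × Fin n) ℝ≥0), h' ≠ 0 ∧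
      (∃ r cc : Fin n → ℕ, ∀ m ∈ h'.support,
        (∀ i, ∑ j, m (i, j) = r i) ∧ (∀ j, ∑ i, m (i, j) = cc j)) ∧
      (∀ e : Fin n × Fin n, ∃ m ∈ h'.support, m e = 0) ∧
      complexity (perPoly (Fin n) ℝ≥0 * (monomial g (1 : ℝ≥0) * h')) ≤
        complexity (perPoly (Fin n) ℝ≥0 * h) :=
  Summit.ValiantsHypothesis.ValiantsHypothesis.Theorems.DivisionGap.PerMultiplesHard.Torus.stub_torus n h hh

/-- **stub_faceDescent — the lever (one-shot form of the card's walk; provable now, size M; VERBATIM …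
(LANDED; the full docstring — statement in words, proof route, sources — is carried by the tree file referenced in the proof term below; shortened here by lead c6 to keep the workfile under the 200 kB limit.) [folklore] -/
theorem stub_faceDescent :
    ∀ (n : ℕ) (G : Finset (Fin n × Fin n)) (w : Fin n × Fin n → ℕ)
      (h : MvPolynomial (Fin n × Fin n) ℝ≥0) (u : (Fin n × Fin n) →₀ ℕ),
      (∀ σ : Equiv.Perm (Fin n),
        (∀ i, (σ i, i) ∈ G) ↔ ∀ τ : Equiv.Perm (Fin n), (∑ i, w (τ i, i)) ≤ ∑ i, w (σ i, i)) →
      h ≠ 0 →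
      (u.support ⊆ G ∧ ∀ m ∈ (topComponent w h).support, ∀ e ∈ G, m e = u e) →
      complexity (monomial u (1 : ℝ≥0) *
          ∑ σ ∈ (Finset.univ : Finset (Equiv.Perm (Fin n))).filter (fun σ => ∀ i, (σ i, i) ∈ G),
            monomial (permMonomial σ) (1 : ℝ≥0)) ≤
        complexity (perPoly (Fin n) ℝ≥0 * h) + 1 :=
  Summit.ValiantsHypothesis.ValiantsHypothesis.Theorems.DivisionGap.PerMultiplesHard.FaceDescent.stub_faceDescent

/-- **stub_jssContraction — monomial factors are cheap to strip (literature vendoring, size L; VERBATIM …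
(LANDED; the full docstring — statement in words, proof route, sources — is carried by the tree file referenced in the proof term below; shortened here by lead c6 to keep the workfile under the 200 kB limit.) [folklore] -/
theorem stub_jssContraction :
    ∃ κ : ℕ, ∀ (n : ℕ) (f : MvPolynomial (Fin n × Fin n) ℝ≥0) (u : (Fin n × Fin n) →₀ ℕ),
      complexity f ≤ ((n + 2) * (complexity (monomial u (1 : ℝ≥0) * f) + 2)) ^ κ :=
  Summit.ValiantsHypothesis.ValiantsHypothesis.Theorems.DivisionGapPerDivisionHard.stub_jssContraction

/-- **stub_richFaces — Jerrum–Snir by SUB-support: every face is as hard as its matching count …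
(LANDED; the full docstring — statement in words, proof route, sources — is carried by the tree file referenced in the proof term below; shortened here by lead c6 to keep the workfile under the 200 kB limit.) [folklore] -/
theorem stub_richFaces :
    ∀ n ≥ 6, ∀ G : Finset (Fin n × Fin n),
      2 ^ (n / 3) * ((Finset.univ : Finset (Equiv.Perm (Fin n))).filter (fun σ => ∀ i, (σ i, i) ∈ G)).card ≤
        complexity (∑ σ ∈ (Finset.univ : Finset (Equiv.Perm (Fin n))).filter (fun σ => ∀ i, (σ i, i) ∈ G),
            monomial (permMonomial σ) (1 : ℝ≥0)) * n.factorial :=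
  Summit.ValiantsHypothesis.ValiantsHypothesis.Theorems.DivisionGap.PerMultiplesHard.RichFaces.stub_richFaces

/-- **stub_typedDecomposition — the typed, row-support-balanced decomposition (provable now, size M–L; …
(LANDED; the full docstring — statement in words, proof route, sources — is carried by the tree file referenced in the proof term below; shortened here by lead c6 to keep the workfile under the 200 kB limit.) [folklore] -/
theorem stub_typedDecomposition (n : ℕ) (hn : 3 ≤ n) (g : MvPolynomial (Fin n × Fin n) ℝ≥0)
    (R C : Fin n → ℕ)
    (hg : ∀ m ∈ g.support, (∀ i, ∑ j, m (i, j) = R i) ∧ (∀ j, ∑ i, m (i, j) = C j))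
    (hR : ∀ i, R i ≠ 0) :
    ∃ s : ℕ, s ≤ complexity g ∧
      ∃ a b : Fin s → MvPolynomial (Fin n × Fin n) ℝ≥0,
        g = ∑ t, a t * b t ∧
        ∀ t, ∃ ρ γ : Fin n → ℕ,
          (∀ m ∈ (a t).support, (∀ i, ∑ j, m (i, j) = ρ i) ∧ (∀ j, ∑ i, m (i, j) = γ j)) ∧
          n < 3 * (Finset.univ.filter fun i => ρ i ≠ 0).card ∧
          3 * (Finset.univ.filter fun i => ρ i ≠ 0).card ≤ 2 * n :=
  Summit.ValiantsHypothesis.ValiantsHypothesis.Theorems.DivisionGap.PerMultiplesHard.TypedDecomposition.stub_typedDecomposition n hn g R C hg hR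

/-- **stub_alignedRigidity — type rigidity of aligned (pure) monomials (provable now, size M; VERBATIM the …
(LANDED; the full docstring — statement in words, proof route, sources — is carried by the tree file referenced in the proof term below; shortened here by lead c6 to keep the workfile under the 200 kB limit.) [folklore] -/
theorem stub_alignedRigidity (n : ℕ) (a : MvPolynomial (Fin n × Fin n) ℝ≥0) (ρ γ : Fin n → ℕ)
    (ha : ∀ m ∈ a.support, (∀ i, ∑ j, m (i, j) = ρ i) ∧ (∀ j, ∑ i, m (i, j) = γ j))
    (hlo : n < 3 * (Finset.univ.filter fun i => ρ i ≠ 0).card)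
    (hhi : 3 * (Finset.univ.filter fun i => ρ i ≠ 0).card ≤ 2 * n) :
    (Finset.univ.filter fun π : Equiv.Perm (Fin n) =>
        ∃ B ∈ a.support, ∀ e ∈ B.support, e.1 = π e.2).card ≤
      (2 * n / 3).factorial * (n - 2 * n / 3).factorial :=
  Summit.ValiantsHypothesis.ValiantsHypothesis.Theorems.DivisionGap.PerMultiplesHard.AlignedRigidity.stub_alignedRigidity n a ρ γ ha hlo hhi

/-- **stub_rowConcentration — the LINE-PROJECTION rung, row form (NEW, lead c1; provable now, size M).**
(LANDED; the full docstring — statement in words, proof route, sources — is carried by the tree file referenced in the proof term below; shortened here by lead c6 to keep the workfile under the 200 kB limit.) [folklore] -/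
theorem stub_rowConcentration :
    ∀ (n : ℕ) (h : MvPolynomial (Fin n × Fin n) ℝ≥0), h ≠ 0 →
      ∀ (D : ℕ), (∀ d ∈ h.support, d.degree = D) →
      ∀ (i : Fin n) (A : Finset (Fin n)) (m : ℕ),
        (∃ d₀ ∈ h.support, ∀ e ∈ d₀.support, e.2 ∈ A → e.1 = i) →
        A.card = m + 1 → 1 ≤ m →
        m * (2 ^ (m - 1) - 1) ≤ 2 * complexity (perPoly (Fin n) ℝ≥0 * h) + 2 :=
  Summit.ValiantsHypothesis.ValiantsHypothesis.Theorems.DivisionGap.PerMultiplesHard.RowConcentration.stub_rowConcentration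


/-! ### `stub_colConcentration`, re-derived inline (the tree module `…StubColConcentration` p104651 is ACCEPTED but its olean
has been unbuilt on the farm since 13:12Z; the 40-line transpose argument is repeated here so the skeleton is sorry-free except
for `stub_residual`). -/
namespace ColConcLocal

/-- `per(Xᵀ) = per(X)`: renaming along `Prod.swap` fixes `per_n`. [folklore] -/
theorem rename_swap_perPoly {n : ℕ} :
    rename (Prod.swap : Fin n × Fin n → Fin n × Fin n) (perPoly (Fin n) ℝ≥0) = perPoly (Fin n) ℝ≥0 := by
  -- adapted from Theorems/DivisionGapPerMultiplesHardStubColConcentration.lean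
  have h : rename (Prod.swap : Fin n × Fin n → Fin n × Fin n) (perPoly (Fin n) ℝ≥0) =
      ((Matrix.mvPolynomialX (Fin n) (Fin n) ℝ≥0).transpose).permanent := by
    simp [perPoly, Matrix.permanent, map_sum, map_prod, Matrix.mvPolynomialX, rename_X]
  rw [h, Matrix.permanent_transpose]
  rfl

/-- `L⁺(per_n · hᵀ) = L⁺(per_n · h)`. [folklore] -/
theorem complexity_perPoly_mul_rename_swap {n : ℕ} (h : MvPolynomial (Fin n × Fin n) ℝ≥0) :
    complexity (perPoly (Fin n) ℝ≥0 * rename Prod.swap h) = complexity (perPoly (Fin n) ℝ≥0 * h) := by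
  have hmul : perPoly (Fin n) ℝ≥0 * rename Prod.swap h = rename Prod.swap (perPoly (Fin n) ℝ≥0 * h) := by
    rw [map_mul, rename_swap_perPoly]
  rw [hmul]
  exact complexity_rename_of_injective_holds Prod.swap_injective _

end ColConcLocal

/-- **stub_colConcentration — the LINE-PROJECTION rung, column form (NEW, lead c1; provable now, size M).**
(LANDED p104651; the full docstring — statement in words, proof route, sources — is carried by the tree file referenced in the proof term below; shortened here by lead c6 to keep the workfile under the 200 kB limit.) [folklore] -/
theorem stub_colConcentration :
    ∀ (n : ℕ) (h : MvPolynomial (Fin n × Fin n) ℝ≥0), h ≠ 0 →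
      ∀ (D : ℕ), (∀ d ∈ h.support, d.degree = D) →
      ∀ (j : Fin n) (A : Finset (Fin n)) (m : ℕ),
        (∃ d₀ ∈ h.support, ∀ e ∈ d₀.support, e.1 ∈ A → e.2 = j) →
        A.card = m + 1 → 1 ≤ m →
        m * (2 ^ (m - 1) - 1) ≤ 2 * complexity (perPoly (Fin n) ℝ≥0 * h) + 2 := by
  -- LANDED p104651 (`…ColConcentration.stub_colConcentration`); farm olean unbuilt since 13:12Z — proof repeated inline
  intro n h hh D hdeg j A m hconc hA hm
  classical
  obtain ⟨d₀, hd₀, hd₀c⟩ := hconc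
  have hT : Function.Injective (Prod.swap : Fin n × Fin n → Fin n × Fin n) := Prod.swap_injective
  have hg0 : rename Prod.swap h ≠ 0 := fun h0 =>
    hh (rename_injective _ hT (by rw [h0, map_zero]))
  have hgdeg : ∀ d ∈ (rename Prod.swap h).support, d.degree = D := by
    intro d hd
    rw [support_rename_of_injective hT, Finset.mem_image] at hd
    obtain ⟨d', hd', rfl⟩ := hd
    rw [Finsupp.degree_mapDomain]
    exact hdeg d' hd'
  have hgconc : ∃ d₁ ∈ (rename Prod.swap h).support, ∀ e ∈ d₁.support, e.2 ∈ A → e.1 = j := by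
    refine ⟨Finsupp.mapDomain Prod.swap d₀, ?_, fun e he heA => ?_⟩
    · rw [support_rename_of_injective hT]
      exact Finset.mem_image_of_mem _ hd₀
    · rw [Finsupp.mapDomain_support_of_injective hT, Finset.mem_image] at he
      obtain ⟨e', he', rfl⟩ := he
      exact hd₀c e' he' heA
  have key := stub_rowConcentration n (rename Prod.swap h) hg0 D hgdeg j A m hgconc hA hm
  rwa [ColConcLocal.complexity_perPoly_mul_rename_swap] at key

/-- **stub_typedDecompositionFifth — the typed decomposition with the (n/5, 2n/5] window (NEW, lead c1; …
(LANDED; the full docstring — statement in words, proof route, sources — is carried by the tree file referenced in the proof term below; shortened here by lead c6 to keep the workfile under the 200 kB limit.) [folklore] -/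
theorem stub_typedDecompositionFifth (n : ℕ) (hn : 5 ≤ n) (g : MvPolynomial (Fin n × Fin n) ℝ≥0)
    (R C : Fin n → ℕ)
    (hg : ∀ m ∈ g.support, (∀ i, ∑ j, m (i, j) = R i) ∧ (∀ j, ∑ i, m (i, j) = C j))
    (hR : ∀ i, R i ≠ 0) :
    ∃ s : ℕ, s ≤ complexity g ∧
      ∃ a b : Fin s → MvPolynomial (Fin n × Fin n) ℝ≥0,
        g = ∑ t, a t * b t ∧
        ∀ t, ∃ ρ γ : Fin n → ℕ,
          (∀ m ∈ (a t).support, (∀ i, ∑ j, m (i, j) = ρ i) ∧ (∀ j, ∑ i, m (i, j) = γ j)) ∧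
          n < 5 * (Finset.univ.filter fun i => ρ i ≠ 0).card ∧
          5 * (Finset.univ.filter fun i => ρ i ≠ 0).card ≤ 2 * n :=
  Summit.ValiantsHypothesis.ValiantsHypothesis.Theorems.DivisionGap.PerMultiplesHard.TypedDecompositionFifth.stub_typedDecompositionFifth n hn g R C hg hR

/-- **stub_spreadRigidity — type rigidity of spread probes (NEW, lead c1; provable now, size M; pure combinatorics).**
(LANDED; the full docstring — statement in words, proof route, sources — is carried by the tree file referenced in the proof term below; shortened here by lead c6 to keep the workfile under the 200 kB limit.) [folklore] -/
theorem stub_spreadRigidity :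
    ∀ (n k : ℕ) (S T : Finset (Fin n)), S.card = k → n < 5 * k → 5 * k ≤ 2 * n →
      ((Finset.univ : Finset (Equiv.Perm (Fin n))).filter fun π =>
          (∀ i ∈ S, π.symm i ∈ T ∨ π.symm (finRotate n i) ∈ T) ∧
          (∀ j ∈ T, π j ∈ S ∨ ∃ i ∈ S, finRotate n i = π j)).card * 5 ^ (n / 10) ≤
        4 ^ (n / 10) * n.factorial :=
  Summit.ValiantsHypothesis.ValiantsHypothesis.Theorems.DivisionGap.PerMultiplesHard.SpreadRigidity.stub_spreadRigidity

/-- **stub_spreadRigidityGen — the same rigidity for an ARBITRARY fixed row shift `ζ` (NEW, lead c1; provable now, size S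
given `stub_spreadRigidity`'s proof: replace `finRotate n` by `ζ` throughout — pairs `{i, ζ i}`, `W = S ∪ ζ(S)`, each `x ∈ U`
serves only `i = x` or `i = ζ⁻¹ x`; for an `n`-cycle `ζ` it also follows from the rotation case by conjugation).**  Needed because a
cofactor can hide its two-cells-per-row monomials along any fixed shift (e.g. `Σ_π x^{P_π + P_{ξ∘π}}` for a derangement `ξ`), and
the engine with shift `ζ = ξ⁻¹` is the one that sees them. [folklore] -/
theorem stub_spreadRigidityGen :
    ∀ (n k : ℕ) (ζ : Equiv.Perm (Fin n)) (S T : Finset (Fin n)), S.card = k → n < 5 * k → 5 * k ≤ 2 * n →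
      ((Finset.univ : Finset (Equiv.Perm (Fin n))).filter fun π =>
          (∀ i ∈ S, π.symm i ∈ T ∨ π.symm (ζ i) ∈ T) ∧
          (∀ j ∈ T, π j ∈ S ∨ ∃ i ∈ S, ζ i = π j)).card * 5 ^ (n / 10) ≤
        4 ^ (n / 10) * n.factorial :=
  Summit.ValiantsHypothesis.ValiantsHypothesis.Theorems.DivisionGap.PerMultiplesHard.SpreadRigidityGen.stub_spreadRigidityGen

/-- **stub_blockProjection — the BLOCK-PROJECTION lever (NEW, lead c1; provable now, size M).**  If `h ≠ 0` is homogeneous in …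
(LANDED p107067; the full docstring — statement in words, proof route, sources — is carried by the tree file referenced in the proof term below; shortened here by lead c6 to keep the workfile under the 200 kB limit.) [folklore] -/
theorem stub_blockProjection :
    ∀ (n : ℕ) (h : MvPolynomial (Fin n × Fin n) ℝ≥0), h ≠ 0 →
      ∀ (D : ℕ), (∀ d ∈ h.support, d.degree = D) →
      ∀ (A B : Finset (Fin n)) (u : (Fin n × Fin n) →₀ ℕ) (a : ℕ), A.card = a → B.card = a →
        ((∃ m ∈ h.support, ∀ e ∈ m.support, (e.1 ∈ A ↔ e.2 ∈ B)) ∧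
          ∀ m ∈ h.support, (∀ e ∈ m.support, (e.1 ∈ A ↔ e.2 ∈ B)) →
            ∀ e : Fin n × Fin n, e.1 ∈ A → e.2 ∈ B → m e = u e) →
        ∃ u' : (Fin a × Fin a) →₀ ℕ,
          complexity (monomial u' (1 : ℝ≥0) * perPoly (Fin a) ℝ≥0) ≤ complexity (perPoly (Fin n) ℝ≥0 * h) + 1 :=
  -- LANDED p107067
  Summit.ValiantsHypothesis.ValiantsHypothesis.Theorems.DivisionGap.PerMultiplesHard.BlockProjection.stub_blockProjection

/-- **stub_typedDecompositionWindow — the typed decomposition with a PARAMETRIC window (NEW, lead c1 wave 3; provable now,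
size S given the landed D = 3 / D = 5 proofs).**  For `3 ≤ D ≤ n`: `g = Σ_{t<s} a_t b_t`, `s ≤ L(g)`, every `a_t` typed with row
support `k` in the window `n < D·k ≤ 2n`.  Same walk/peel proof (`D·n > 2n`; halving; the stopping operand has `D·k > n`, hence
`k ≥ 2` and it is a gate). [Jukna2023 L.3.1; JerrumSnir1982 §3] -/
theorem stub_typedDecompositionWindow :
    ∀ (n D : ℕ), 3 ≤ D → D ≤ n → ∀ (g : MvPolynomial (Fin n × Fin n) ℝ≥0) (R C : Fin n → ℕ),
      (∀ m ∈ g.support, (∀ i, ∑ j, m (i, j) = R i) ∧ (∀ j, ∑ i, m (i, j) = C j)) → (∀ i, R i ≠ 0) →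
      ∃ s : ℕ, s ≤ complexity g ∧ ∃ a b : Fin s → MvPolynomial (Fin n × Fin n) ℝ≥0, g = ∑ t, a t * b t ∧
        ∀ t, ∃ ρ γ : Fin n → ℕ, (∀ m ∈ (a t).support, (∀ i, ∑ j, m (i, j) = ρ i) ∧ (∀ j, ∑ i, m (i, j) = γ j)) ∧
          n < D * (Finset.univ.filter fun i => ρ i ≠ 0).card ∧ D * (Finset.univ.filter fun i => ρ i ≠ 0).card ≤ 2 * n :=
  fun n D hD hDn g R C hg hR => Summit.ValiantsHypothesis.ValiantsHypothesis.Theorems.DivisionGap.PerMultiplesHard.TypedDecompositionFifth.typedDecompositionWindow n D hD hDn g R C hg hR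

/-- **stub_zRigidity — type rigidity of `Z`-probes (NEW, lead c1 wave 3; provable now, size M; pure combinatorics, the `#Z`-shift
form of `stub_spreadRigidity`).**  With `k = #Z`, `s = #S` in the window `n < 3k·s ≤ 2n`: `#compat · 3^{⌊n/(3k²)⌋} ≤ 2^{⌊n/(3k²)⌋} · n!`.
Why: compatibility depends only on `U = π(T)`: `U ⊆ W := ⋃_{i∈S} {ζ i : ζ ∈ Z}` (`#W ≤ k s ≤ 2n/3`) and every `i ∈ S` has some
`ζ i ∈ U`; each `x ∈ U` serves at most `k` rows, so `s ≤ k u`, `u > n/(3k²)`; `#compat ≤ C(ks, u)·u!(n−u)! = n!·Π_{l<u}(ks−l)/(n−l)`,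
termwise `(ks − l)·3 ≤ (n − l)·2`.  Rigidity fraction `(2/3)^{n/(3k²)}`: super-quasi-polynomial for `k ≤ √n / polylog`. [folklore] -/
theorem stub_zRigidity :
    ∀ (n k s : ℕ) (Z : Finset (Equiv.Perm (Fin n))) (S T : Finset (Fin n)), Z.card = k → S.card = s →
      n < 3 * k * s → 3 * k * s ≤ 2 * n →
      ((Finset.univ : Finset (Equiv.Perm (Fin n))).filter fun π =>
          (∀ i ∈ S, ∃ ζ ∈ Z, π.symm (ζ i) ∈ T) ∧ (∀ j ∈ T, ∃ ζ ∈ Z, ∃ i ∈ S, ζ i = π j)).card * 3 ^ (n / (3 * k ^ 2)) ≤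
        2 ^ (n / (3 * k ^ 2)) * n.factorial :=
  Summit.ValiantsHypothesis.ValiantsHypothesis.Theorems.DivisionGap.PerMultiplesHard.ZRigidity.stub_zRigidity

/-! ### Cycle-2 stubs (lead c2): the DEEP-RICHNESS engine (one-sided depth-2 Jerrum–Snir) and the link-circuit lemma -/

/-- **stub_typedDecompositionL — the typed decomposition WITH THE GATE-FACTOR COMPLEXITY BOUND (NEW, lead c2; provable now, …
(LANDED p108548; the full docstring — statement in words, proof route, sources — is carried by the tree file referenced in the proof term below; shortened here by lead c6 to keep the workfile under the 200 kB limit.) [folklore] -/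
theorem stub_typedDecompositionL :
    ∀ (n D : ℕ), 3 ≤ D → D ≤ n → ∀ (g : MvPolynomial (Fin n × Fin n) ℝ≥0) (R C : Fin n → ℕ),
      (∀ m ∈ g.support, (∀ i, ∑ j, m (i, j) = R i) ∧ (∀ j, ∑ i, m (i, j) = C j)) → (∀ i, R i ≠ 0) →
      ∃ s : ℕ, s ≤ complexity g ∧ ∃ a b : Fin s → MvPolynomial (Fin n × Fin n) ℝ≥0, g = ∑ t, a t * b t ∧
        ∀ t, complexity (a t) ≤ complexity g ∧ ∃ ρ γ : Fin n → ℕ,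
          (∀ m ∈ (a t).support, (∀ i, ∑ j, m (i, j) = ρ i) ∧ (∀ j, ∑ i, m (i, j) = γ j)) ∧
          n < D * (Finset.univ.filter fun i => ρ i ≠ 0).card ∧ D * (Finset.univ.filter fun i => ρ i ≠ 0).card ≤ 2 * n :=
  -- LANDED p108548
  Summit.ValiantsHypothesis.ValiantsHypothesis.Theorems.DivisionGap.PerMultiplesHard.TypedDecompositionL.stub_typedDecompositionL

/-- **stub_boardCompression — a typed partial-permutation polynomial lives on the small board (NEW, lead c2; provable now, size M).**
(LANDED p108556; the full docstring — statement in words, proof route, sources — is carried by the tree file referenced in the proof term below; shortened here by lead c6 to keep the workfile under the 200 kB limit.) [folklore] -/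
theorem stub_boardCompression :
    ∀ (n k : ℕ) (S T : Finset (Fin n)) (a : MvPolynomial (Fin n × Fin n) ℝ≥0), S.card = k → T.card = k →
      (∀ m ∈ a.support, (∀ i, ∑ j, m (i, j) = if i ∈ S then 1 else 0) ∧ (∀ j, ∑ i, m (i, j) = if j ∈ T then 1 else 0)) →
      ∃ a' : MvPolynomial (Fin k × Fin k) ℝ≥0, a'.support ⊆ (perPoly (Fin k) ℝ≥0).support ∧
        a'.support.card = a.support.card ∧ complexity a' ≤ complexity a :=
  -- LANDED p108556
  Summit.ValiantsHypothesis.ValiantsHypothesis.Theorems.DivisionGap.PerMultiplesHard.BoardCompression.stub_boardCompression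

/-- **stub_sharpSubSupportCount — Jerrum–Snir by sub-support with the EXACT binomial (NEW, lead c2; provable now, size S–M).**  For …
(LANDED p108396; the full docstring — statement in words, proof route, sources — is carried by the tree file referenced in the proof term below; shortened here by lead c6 to keep the workfile under the 200 kB limit.) [folklore] -/
theorem stub_sharpSubSupportCount :
    ∀ (m : ℕ), 3 ≤ m → ∀ (p : MvPolynomial (Fin m × Fin m) ℝ≥0), p.support ⊆ (perPoly (Fin m) ℝ≥0).support →
      ∃ d : ℕ, m < 3 * d ∧ 3 * d ≤ 2 * m ∧ p.support.card * m.choose d ≤ complexity p * m.factorial :=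
  -- LANDED p108396
  Summit.ValiantsHypothesis.ValiantsHypothesis.Theorems.DivisionGap.PerMultiplesHard.SharpSubSupportCount.stub_sharpSubSupportCount

/-- **stub_sharpChoose — the entropy-sharp binomial on the Jerrum–Snir window (NEW, lead c2 after c1's `sharpChoose`; provable now, …
(LANDED p108493; the full docstring — statement in words, proof route, sources — is carried by the tree file referenced in the proof term below; shortened here by lead c6 to keep the workfile under the 200 kB limit.) [folklore] -/
theorem stub_sharpChoose :
    ∀ n k : ℕ, n < 3 * k → 3 * k ≤ 2 * n → 3 ^ n ≤ (n + 1) * n.choose k * 2 ^ (n - n / 3) :=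
  -- LANDED p108493
  Summit.ValiantsHypothesis.ValiantsHypothesis.Theorems.DivisionGap.PerMultiplesHard.SharpChoose.stub_sharpChoose

/-- **stub_linkCircuit — the complement factor of a peel is CHEAP (NEW, lead c2; provable now, size M–L; pure circuit combinatorics, …
(LANDED p109548; the full docstring — statement in words, proof route, sources — is carried by the tree file referenced in the proof term below; shortened here by lead c6 to keep the workfile under the 200 kB limit.) [folklore] -/
theorem stub_linkCircuit :
    ∀ (σ : Type) (P : ArithCircuit ℝ≥0 σ) (v : ℕ), P.IsFanInTwo →
      ∃ Q : ArithCircuit ℝ≥0 σ, Q.IsFanInTwo ∧ Q.size ≤ 8 * P.size + 8 ∧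
        P.eval = (P.zeroAt v).eval + (ArithCircuit.gateValues P.gates).getD v 0 * Q.eval :=
  -- LANDED p109548
  Summit.ValiantsHypothesis.ValiantsHypothesis.Theorems.DivisionGap.PerMultiplesHard.LinkCircuit.stub_linkCircuit

/-! ### The deep-richness engine, composed (lead c2 cycle 2; LANDED) -/

/-- **stub_typedDecompositionLL — the typed decomposition with BOTH factors cheap (NEW, lead c2; LANDED p109948).**  As
`stub_typedDecompositionL`, plus `L(b_t) ≤ 8·L(g) + 8` for every complement factor: the peel's complement is the output of the
link circuit of `stub_linkCircuit` (size `≤ 8·size + 8`).  This is the hinge of the TWO-SIDED recursion (`0.918` bits per level,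
unbounded depth: `deepCount` / `richFacesDeepD`). [JerrumSnir1982 §3.1; folklore] -/
theorem stub_typedDecompositionLL :
    ∀ (n D : ℕ), 3 ≤ D → D ≤ n → ∀ (g : MvPolynomial (Fin n × Fin n) ℝ≥0) (R C : Fin n → ℕ),
      (∀ m ∈ g.support, (∀ i, ∑ j, m (i, j) = R i) ∧ (∀ j, ∑ i, m (i, j) = C j)) → (∀ i, R i ≠ 0) →
      ∃ s : ℕ, s ≤ complexity g ∧ ∃ a b : Fin s → MvPolynomial (Fin n × Fin n) ℝ≥0, g = ∑ t, a t * b t ∧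
        ∀ t, complexity (a t) ≤ complexity g ∧ complexity (b t) ≤ 8 * complexity g + 8 ∧ ∃ ρ γ : Fin n → ℕ,
          (∀ m ∈ (a t).support, (∀ i, ∑ j, m (i, j) = ρ i) ∧ (∀ j, ∑ i, m (i, j) = γ j)) ∧
          n < D * (Finset.univ.filter fun i => ρ i ≠ 0).card ∧ D * (Finset.univ.filter fun i => ρ i ≠ 0).card ≤ 2 * n :=
  Summit.ValiantsHypothesis.ValiantsHypothesis.Theorems.DivisionGap.PerMultiplesHard.TypedDecompositionLL.stub_typedDecompositionLL

/-- **richFacesDeep — the DEEP-RICHNESS engine, one-sided depth 2 (NEW, lead c2; LANDED p110925).**  For `n ≥ 9` and every …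
(LANDED; the full docstring — statement in words, proof route, sources — is carried by the tree file referenced in the proof term below; shortened here by lead c6 to keep the workfile under the 200 kB limit.) [folklore] -/
theorem richFacesDeep :
    ∀ n ≥ 9, ∀ G : Finset (Fin n × Fin n),
      pmCount G * (3 ^ n * 3 ^ (n / 3 + 1)) ≤
        complexity (facePer G) ^ 2 *
          (n.factorial * ((n + 1) * (n / 3 + 2) * (2 ^ (n - n / 3) * 2 ^ ((n / 3 + 1) - (n / 3 + 1) / 3)))) :=
  Summit.ValiantsHypothesis.ValiantsHypothesis.Theorems.DivisionGap.PerMultiplesHard.RichFacesDeep.richFacesDeep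

/-- **stub_richFacesDeepD — the DEPTH-PARAMETRIC deep-richness engine (NEW, lead c2; LANDED p112943 as `DeepCount.richFacesDeepD`, …
(LANDED p112943; the full docstring — statement in words, proof route, sources — is carried by the tree file referenced in the proof term below; shortened here by lead c6 to keep the workfile under the 200 kB limit.) [folklore] -/
theorem stub_richFacesDeepD :
    ∀ (D : ℕ), 1 ≤ D → ∀ (n : ℕ), 3 ^ (D + 1) ≤ n → ∀ G : Finset (Fin n × Fin n),
      pmCount G * 3 ^ (D * n) ≤
        (complexity (facePer G) + 1) ^ (2 ^ D - 1) *
          (n.factorial * ((n + 1) ^ (2 ^ D - 1) * 2 ^ (D * (n - n / 3) + 4 * D * 2 ^ D))) :=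
  -- LANDED p112943
  Summit.ValiantsHypothesis.ValiantsHypothesis.Theorems.DivisionGap.PerMultiplesHard.DeepCount.richFacesDeepD

/-- **stub_rectangleBound — the GENERIC RECTANGLE ENGINE (NEW, lead c2 wave 4; LANDED p114625 as `RectangleBound.stub_rectangleBound`; …
(LANDED p114625; the full docstring — statement in words, proof route, sources — is carried by the tree file referenced in the proof term below; shortened here by lead c6 to keep the workfile under the 200 kB limit.) [folklore] -/
theorem stub_rectangleBound :
    ∀ (n : ℕ), 3 ≤ n → ∀ (g : MvPolynomial (Fin n × Fin n) ℝ≥0) (R C : Fin n → ℕ),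
      (∀ m ∈ g.support, (∀ i, ∑ j, m (i, j) = R i) ∧ (∀ j, ∑ i, m (i, j) = C j)) → (∀ i, R i ≠ 0) → g ≠ 0 →
      ∃ a b : MvPolynomial (Fin n × Fin n) ℝ≥0, a ≠ 0 ∧ b ≠ 0 ∧ complexity a ≤ complexity g ∧
        complexity b ≤ 8 * complexity g + 8 ∧ (a * b).support ⊆ g.support ∧
        g.support.card ≤ complexity g * (a.support.card * b.support.card) ∧
        ∃ ρ γ : Fin n → ℕ, (∀ m ∈ a.support, (∀ i, ∑ j, m (i, j) = ρ i) ∧ (∀ j, ∑ i, m (i, j) = γ j)) ∧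
          n < 3 * (Finset.univ.filter fun i => ρ i ≠ 0).card ∧ 3 * (Finset.univ.filter fun i => ρ i ≠ 0).card ≤ 2 * n :=
  -- LANDED p114625
  Summit.ValiantsHypothesis.ValiantsHypothesis.Theorems.DivisionGap.PerMultiplesHard.RectangleBound.stub_rectangleBound

/-! ### Cycle-3 stubs (lead c3): the HOST-DESCENT lever, the torus normal form at a host, and the DEEP PURE COUNT
(level-set recursion for constant margins) with its four combinatorial pieces -/

/-- **stub_hostDescent — the many-parts face move (NEW, lead c3; provable now, size M: steps (1)–(2) of the landed …
(LANDED p119267; the full docstring — statement in words, proof route, sources — is carried by the tree file referenced in the proof term below; shortened here by lead c6 to keep the workfile under the 200 kB limit.) [folklore] -/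
theorem stub_hostDescent :
    ∀ (n : ℕ) (G : Finset (Fin n × Fin n)) (w : Fin n × Fin n → ℕ) (h : MvPolynomial (Fin n × Fin n) ℝ≥0),
      (∀ σ : Equiv.Perm (Fin n),
        (∀ i, (σ i, i) ∈ G) ↔ ∀ τ : Equiv.Perm (Fin n), (∑ i, w (τ i, i)) ≤ ∑ i, w (σ i, i)) →
      h ≠ 0 →
      (aeval (fun e => if e ∈ G then (X e : MvPolynomial (Fin n × Fin n) ℝ≥0) else 1)
          (topComponent w h)).support =
        (topComponent w h).support.image (fun m => m.filter (fun e => e ∈ G)) ∧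
      complexity ((∑ σ ∈ (Finset.univ : Finset (Equiv.Perm (Fin n))).filter (fun σ => ∀ i, (σ i, i) ∈ G),
            monomial (permMonomial σ) (1 : ℝ≥0)) *
          aeval (fun e => if e ∈ G then (X e : MvPolynomial (Fin n × Fin n) ℝ≥0) else 1) (topComponent w h)) ≤
        complexity (perPoly (Fin n) ℝ≥0 * h) :=
  -- LANDED p119267
  Summit.ValiantsHypothesis.ValiantsHypothesis.Theorems.DivisionGap.PerMultiplesHard.HostDescent.stub_hostDescent

/-- **stub_hostTorus — the torus/content normal form AT A HOST (NEW, lead c3; provable now, size S–M: the landed …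
(LANDED p119395; the full docstring — statement in words, proof route, sources — is carried by the tree file referenced in the proof term below; shortened here by lead c6 to keep the workfile under the 200 kB limit.) [folklore] -/
theorem stub_hostTorus :
    ∀ (n : ℕ) (G : Finset (Fin n × Fin n)) (q : MvPolynomial (Fin n × Fin n) ℝ≥0), q ≠ 0 →
      ∃ (g : (Fin n × Fin n) →₀ ℕ) (q' : MvPolynomial (Fin n × Fin n) ℝ≥0), q' ≠ 0 ∧
        (∃ r cc : Fin n → ℕ, ∀ m ∈ q'.support, (∀ i, ∑ j, m (i, j) = r i) ∧ (∀ j, ∑ i, m (i, j) = cc j)) ∧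
        (∀ e : Fin n × Fin n, ∃ m ∈ q'.support, m e = 0) ∧
        (∀ m' ∈ q'.support, g + m' ∈ q.support) ∧
        complexity ((∑ σ ∈ (Finset.univ : Finset (Equiv.Perm (Fin n))).filter (fun σ => ∀ i, (σ i, i) ∈ G),
              monomial (permMonomial σ) (1 : ℝ≥0)) * (monomial g (1 : ℝ≥0) * q')) ≤
          complexity ((∑ σ ∈ (Finset.univ : Finset (Equiv.Perm (Fin n))).filter (fun σ => ∀ i, (σ i, i) ∈ G),
              monomial (permMonomial σ) (1 : ℝ≥0)) * q) :=
  -- LANDED p119395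
  Summit.ValiantsHypothesis.ValiantsHypothesis.Theorems.DivisionGap.PerMultiplesHard.HostTorus.stub_hostTorus

/-- **stub_levelSlice — slicing one LEVEL out of a typed factor is free (NEW, lead c3; provable now, size M).**  Let `c` be …
(LANDED p119809; the full docstring — statement in words, proof route, sources — is carried by the tree file referenced in the proof term below; shortened here by lead c6 to keep the workfile under the 200 kB limit.) [folklore] -/
theorem stub_levelSlice :
    ∀ (m : ℕ) (c : MvPolynomial (Fin m × Fin m) ℝ≥0) (ρ γ : Fin m → ℕ) (v : ℕ), 1 ≤ v →
      (∀ M ∈ c.support, (∀ i, ∑ j, M (i, j) = ρ i) ∧ (∀ j, ∑ i, M (i, j) = γ j)) →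
      (∃ A ∈ c.support, ∃ σ : Equiv.Perm (Fin m), ∀ e ∈ A.support, e.1 = σ e.2) →
      (Finset.univ.filter fun i => ρ i = v).card = (Finset.univ.filter fun j => γ j = v).card ∧
      ∃ c' : MvPolynomial (Fin m × Fin m) ℝ≥0, complexity c' ≤ complexity c ∧
        (∀ M ∈ c'.support, (∀ i, ∑ j, M (i, j) = if ρ i = v then v else 0) ∧
          (∀ j, ∑ i, M (i, j) = if γ j = v then v else 0)) ∧
        (∀ A ∈ c.support, (∃ σ : Equiv.Perm (Fin m), ∀ e ∈ A.support, e.1 = σ e.2) →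
          A.filter (fun e => ρ e.1 = v) ∈ c'.support) :=
  -- LANDED p119809
  Summit.ValiantsHypothesis.ValiantsHypothesis.Theorems.DivisionGap.PerMultiplesHard.LevelSlice.stub_levelSlice

/-- **stub_boardCompressionGen — a level slice lives on its own board (NEW, lead c3; provable now, size M: the landed …
(LANDED p119565; the full docstring — statement in words, proof route, sources — is carried by the tree file referenced in the proof term below; shortened here by lead c6 to keep the workfile under the 200 kB limit.) [folklore] -/
theorem stub_boardCompressionGen :
    ∀ (m k v : ℕ) (S T : Finset (Fin m)) (c : MvPolynomial (Fin m × Fin m) ℝ≥0), S.card = k → T.card = k → 1 ≤ v →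
      (∀ M ∈ c.support, (∀ i, ∑ j, M (i, j) = if i ∈ S then v else 0) ∧
        (∀ j, ∑ i, M (i, j) = if j ∈ T then v else 0)) →
      ∃ c' : MvPolynomial (Fin k × Fin k) ℝ≥0,
        (∀ M ∈ c'.support, (∀ i, ∑ j, M (i, j) = v) ∧ (∀ j, ∑ i, M (i, j) = v)) ∧
        complexity c' ≤ complexity c ∧
        (c.support.filter fun M => ∃ σ : Equiv.Perm (Fin m), ∀ e ∈ M.support, e.1 = σ e.2).card ≤
          (c'.support.filter fun M => ∃ σ : Equiv.Perm (Fin k), ∀ e ∈ M.support, e.1 = σ e.2).card :=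
  -- LANDED p119565
  Summit.ValiantsHypothesis.ValiantsHypothesis.Theorems.DivisionGap.PerMultiplesHard.BoardCompressionGen.stub_boardCompressionGen

/-- **stub_pureLevelProduct — the pure exponents of a typed product inject into the product of the level slices (NEW, …
(LANDED p119710; the full docstring — statement in words, proof route, sources — is carried by the tree file referenced in the proof term below; shortened here by lead c6 to keep the workfile under the 200 kB limit.) [folklore] -/
theorem stub_pureLevelProduct :
    ∀ (m N : ℕ) (a b : MvPolynomial (Fin m × Fin m) ℝ≥0) (ρ γ : Fin m → ℕ),
      (∀ M ∈ a.support, (∀ i, ∑ j, M (i, j) = ρ i) ∧ (∀ j, ∑ i, M (i, j) = γ j)) →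
      (∀ i, ρ i ≤ N) →
      (∀ M ∈ (a * b).support, ∀ i, ∑ j, M (i, j) = N) →
      ∀ (X : ℕ → Finset ((Fin m × Fin m) →₀ ℕ)) (Y : Finset ((Fin m × Fin m) →₀ ℕ)),
        (∀ A ∈ a.support, (∃ σ : Equiv.Perm (Fin m), ∀ e ∈ A.support, e.1 = σ e.2) →
          ∀ v ∈ Finset.Icc 1 N, A.filter (fun e => ρ e.1 = v) ∈ X v) →
        (∀ B ∈ b.support, (∃ σ : Equiv.Perm (Fin m), ∀ e ∈ B.support, e.1 = σ e.2) →
          B.filter (fun e => ρ e.1 = 0) ∈ Y) →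
        ((a * b).support.filter fun M => ∃ σ : Equiv.Perm (Fin m), ∀ e ∈ M.support, e.1 = σ e.2).card ≤
          (∏ v ∈ Finset.Icc 1 N, (X v).card) * Y.card :=
  -- LANDED p119710
  Summit.ValiantsHypothesis.ValiantsHypothesis.Theorems.DivisionGap.PerMultiplesHard.PureLevelProduct.stub_pureLevelProduct

/-- **stub_levelEntropy — small levels are paid by the multinomial (NEW, lead c3; provable now, size S–M; elementary …
(LANDED p119639; the full docstring — statement in words, proof route, sources — is carried by the tree file referenced in the proof term below; shortened here by lead c6 to keep the workfile under the 200 kB limit.) [folklore] -/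
theorem stub_levelEntropy :
    ∀ (M : ℕ) (s : Finset ℕ) (k : ℕ → ℕ),
      M ^ (∑ v ∈ s.filter (fun v => M * k v < ∑ u ∈ s, k u), k v) * ∏ v ∈ s, (k v).factorial ≤
        9 ^ (∑ v ∈ s.filter (fun v => M * k v < ∑ u ∈ s, k u), k v) * (∑ v ∈ s, k v).factorial :=
  -- LANDED p119639
  Summit.ValiantsHypothesis.ValiantsHypothesis.Theorems.DivisionGap.PerMultiplesHard.LevelEntropy.stub_levelEntropy

/-- **stub_hostBlockProjection — the block-projection lever AT A HOST (NEW, lead c3; provable now, size M: the landed …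
(LANDED p119884; the full docstring — statement in words, proof route, sources — is carried by the tree file referenced in the proof term below; shortened here by lead c6 to keep the workfile under the 200 kB limit.) [folklore] -/
theorem stub_hostBlockProjection :
    ∀ (n : ℕ) (G : Finset (Fin n × Fin n)) (h : MvPolynomial (Fin n × Fin n) ℝ≥0), h ≠ 0 →
      ∀ (D : ℕ), (∀ d ∈ h.support, d.degree = D) →
      ∀ (A B : Finset (Fin n)) (u : (Fin n × Fin n) →₀ ℕ) (a : ℕ) (eA : Fin a ≃ {x // x ∈ A}) (eB : Fin a ≃ {x // x ∈ B}),
        ((∃ m ∈ h.support, ∀ e ∈ m.support, (e.1 ∈ A ↔ e.2 ∈ B)) ∧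
          ∀ m ∈ h.support, (∀ e ∈ m.support, (e.1 ∈ A ↔ e.2 ∈ B)) → ∀ e : Fin n × Fin n, e.1 ∈ A → e.2 ∈ B → m e = u e) →
        (∃ σ : Equiv.Perm (Fin n), (∀ i, (σ i, i) ∈ G) ∧ ∀ i, σ i ∈ A ↔ i ∈ B) →
        ∃ u' : (Fin a × Fin a) →₀ ℕ,
          complexity (monomial u' (1 : ℝ≥0) *
              ∑ σ ∈ (Finset.univ : Finset (Equiv.Perm (Fin a))).filter
                (fun σ => ∀ i, (((eA (σ i) : Fin n), (eB i : Fin n)) ∈ G)),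
                monomial (permMonomial σ) (1 : ℝ≥0)) ≤
            complexity ((∑ σ ∈ (Finset.univ : Finset (Equiv.Perm (Fin n))).filter (fun σ => ∀ i, (σ i, i) ∈ G),
              monomial (permMonomial σ) (1 : ℝ≥0)) * h) + 1 :=
  -- LANDED p119884
  Summit.ValiantsHypothesis.ValiantsHypothesis.Theorems.DivisionGap.PerMultiplesHard.HostBlockProjection.stub_hostBlockProjection

/-! ### The deep pure count (LANDED p120522 + p120837: `Theorems/DivisionGapPerMultiplesHardDeepPureCount{Levels,}.lean`) -/

/-- **deepPureCount — THE DEEP PURE COUNT (NEW, lead c3; the lead's stub: composition of `stub_typedDecompositionLL`, …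
(LANDED p120837; the full docstring — statement in words, proof route, sources — is carried by the tree file referenced in the proof term below; shortened here by lead c6 to keep the workfile under the 200 kB limit.) [folklore] -/
theorem deepPureCount : ∀ (D m : ℕ), 3 ^ ((D + 2) ^ 2) ≤ m → ∀ (N : ℕ), 1 ≤ N →
    ∀ g : MvPolynomial (Fin m × Fin m) ℝ≥0,
      (∀ M ∈ g.support, (∀ i, ∑ j, M (i, j) = N) ∧ (∀ j, ∑ i, M (i, j) = N)) →
      (g.support.filter fun M => ∃ σ : Equiv.Perm (Fin m), ∀ e ∈ M.support, e.1 = σ e.2).card *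
          3 ^ (D * m) ≤
        (complexity g + 1) ^ (3 ^ ((D + 1) ^ 2)) *
          (m.factorial * ((m + 1) ^ (3 ^ ((D + 1) ^ 2)) * 2 ^ (D * (m - m / 3) + 3 ^ ((D + 2) ^ 2)))) :=
  -- LANDED p120837 (proved by the lead; parts: p120522 `…DeepPureCountLevels`, p120837 `…DeepPureCount`)
  Summit.ValiantsHypothesis.ValiantsHypothesis.Theorems.DivisionGap.PerMultiplesHard.DeepPureCount.deepPureCount

/-! ### Cycle-3 wave-2 stubs (lead c3): multi-step levers (block parts at a host, descent inside a host) and the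
level form of the deep pure count -/

/-- **stub_hostBlockParts — the MANY-PARTS block projection at a host (NEW, lead c3 wave 2; provable now, size M: the landed …
(LANDED p121351; the full docstring — statement in words, proof route, sources — is carried by the tree file referenced in the proof term below; shortened here by lead c6 to keep the workfile under the 200 kB limit.) [folklore] -/
theorem stub_hostBlockParts :
    ∀ (n : ℕ) (G : Finset (Fin n × Fin n)) (h : MvPolynomial (Fin n × Fin n) ℝ≥0), h ≠ 0 →
      ∀ (D : ℕ), (∀ d ∈ h.support, d.degree = D) →
      ∀ (A B : Finset (Fin n)) (a : ℕ) (eA : Fin a ≃ {x // x ∈ A}) (eB : Fin a ≃ {x // x ∈ B}),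
        (∃ m ∈ h.support, ∀ e ∈ m.support, (e.1 ∈ A ↔ e.2 ∈ B)) →
        (∃ σ : Equiv.Perm (Fin n), (∀ i, (σ i, i) ∈ G) ∧ ∀ i, σ i ∈ A ↔ i ∈ B) →
        ∃ q : MvPolynomial (Fin a × Fin a) ℝ≥0, q ≠ 0 ∧
          (∀ m' : (Fin a × Fin a) →₀ ℕ, m' ∈ q.support ↔
            ∃ m ∈ h.support, (∀ e ∈ m.support, (e.1 ∈ A ↔ e.2 ∈ B)) ∧
              ∀ x y : Fin a, m' (x, y) = m ((eA x : Fin n), (eB y : Fin n))) ∧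
          complexity ((∑ σ ∈ (Finset.univ : Finset (Equiv.Perm (Fin a))).filter
                (fun σ => ∀ i, (((eA (σ i) : Fin n), (eB i : Fin n)) ∈ G)),
                monomial (permMonomial σ) (1 : ℝ≥0)) * q) ≤
            complexity ((∑ σ ∈ (Finset.univ : Finset (Equiv.Perm (Fin n))).filter (fun σ => ∀ i, (σ i, i) ∈ G),
              monomial (permMonomial σ) (1 : ℝ≥0)) * h) + 1 := by
  -- LANDED p121351
  exact Summit.ValiantsHypothesis.ValiantsHypothesis.Theorems.DivisionGap.PerMultiplesHard.HostBlockParts.stub_hostBlockParts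

/-- **stub_hostDescentIn — host descent INSIDE a host (NEW, lead c3 wave 2; provable now, size M: the landed …
(LANDED p121245; the full docstring — statement in words, proof route, sources — is carried by the tree file referenced in the proof term below; shortened here by lead c6 to keep the workfile under the 200 kB limit.) [folklore] -/
theorem stub_hostDescentIn :
    ∀ (n : ℕ) (G G' : Finset (Fin n × Fin n)) (w : Fin n × Fin n → ℕ) (h : MvPolynomial (Fin n × Fin n) ℝ≥0),
      (∀ σ : Equiv.Perm (Fin n), (∀ i, (σ i, i) ∈ G') ↔
        ((∀ i, (σ i, i) ∈ G) ∧ ∀ τ : Equiv.Perm (Fin n), (∀ i, (τ i, i) ∈ G) →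
          (∑ i, w (τ i, i)) ≤ ∑ i, w (σ i, i))) →
      (∃ σ : Equiv.Perm (Fin n), ∀ i, (σ i, i) ∈ G') →
      (aeval (fun e => if e ∈ G' then (X e : MvPolynomial (Fin n × Fin n) ℝ≥0) else 1)
          (topComponent w h)).support =
        (topComponent w h).support.image (fun m => m.filter (fun e => e ∈ G')) ∧
      complexity ((∑ σ ∈ (Finset.univ : Finset (Equiv.Perm (Fin n))).filter (fun σ => ∀ i, (σ i, i) ∈ G'),
            monomial (permMonomial σ) (1 : ℝ≥0)) *
          aeval (fun e => if e ∈ G' then (X e : MvPolynomial (Fin n × Fin n) ℝ≥0) else 1) (topComponent w h)) ≤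
        complexity ((∑ σ ∈ (Finset.univ : Finset (Equiv.Perm (Fin n))).filter (fun σ => ∀ i, (σ i, i) ∈ G),
            monomial (permMonomial σ) (1 : ℝ≥0)) * h) :=
  -- LANDED p121245
  Summit.ValiantsHypothesis.ValiantsHypothesis.Theorems.DivisionGap.PerMultiplesHard.HostDescentIn.stub_hostDescentIn

/-- **deepPureCountLevel — the deep pure count for ONE LEVEL of arbitrary margins (NEW, lead c3 wave 2; provable now, size S–M: …
(LANDED p121258; the full docstring — statement in words, proof route, sources — is carried by the tree file referenced in the proof term below; shortened here by lead c6 to keep the workfile under the 200 kB limit.) [folklore] -/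
theorem deepPureCountLevel :
    ∀ (D m : ℕ) (g : MvPolynomial (Fin m × Fin m) ℝ≥0) (R C : Fin m → ℕ) (v : ℕ),
      (∀ M ∈ g.support, (∀ i, ∑ j, M (i, j) = R i) ∧ (∀ j, ∑ i, M (i, j) = C j)) →
      1 ≤ v → 3 ^ ((D + 2) ^ 2) ≤ (Finset.univ.filter fun i => R i = v).card →
      ((g.support.filter fun M => ∃ σ : Equiv.Perm (Fin m), ∀ e ∈ M.support, e.1 = σ e.2).image
          (fun M => M.filter (fun e => R e.1 = v))).card *
          3 ^ (D * (Finset.univ.filter fun i => R i = v).card) ≤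
        (complexity g + 1) ^ (3 ^ ((D + 1) ^ 2)) *
          (((Finset.univ.filter fun i => R i = v).card).factorial *
            (((Finset.univ.filter fun i => R i = v).card + 1) ^ (3 ^ ((D + 1) ^ 2)) *
              2 ^ (D * ((Finset.univ.filter fun i => R i = v).card -
                (Finset.univ.filter fun i => R i = v).card / 3) + 3 ^ ((D + 2) ^ 2)))) :=
  -- LANDED p121258
  Summit.ValiantsHypothesis.ValiantsHypothesis.Theorems.DivisionGap.PerMultiplesHard.DeepPureCountLevel.deepPureCountLevel

/-! ### Cycle 10 (lead c10): the MASS JAW — the degree-free Jerrum–Snir decomposition balanced by TOTAL DEGREE (mass), typed -/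

/-- **stub_massRectangleBound — the generic rectangle engine in the MASS grading (NEW, lead c10; provable now, size M).**
For `1 ≤ n`, a nonzero torus-homogeneous `g ∈ ℝ≥0[x_ij]` (all monomials have row margins `R`, column margins `C`; hence `g`
is homogeneous of total degree `Σ R`) with `3 ≤ Σ R` has a MASS-BALANCED typed rectangle: `a ≠ 0`, `b ≠ 0`,
`L(a) ≤ L(g)`, `L(b) ≤ 8 L(g) + 8`, `supp (a · b) ⊆ supp g`, `#supp g ≤ L(g) · #supp a · #supp b`, and `a`
torus-homogeneous with margins `(ρ, γ)` whose MASS `Σ ρ` lies in the middle third: `Σ R < 3 Σ ρ ≤ 2 Σ R`.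
WHY (the point of cycle 10): the window is located by total degree, which is subadditive along the circuit, so NO
homogenisation and NO degree charge is paid however large `deg h` is — the Literature template
`Literature.Barriers.ValiantsHypothesis.exists_decomposition` (window `(m, 2m]`, `m := Σ R / 3`, for the homogeneous `P.eval`
of degree `Σ R`) already gives the list decomposition per circuit; `a` is automatically homogeneous AND torus-typed because
`supp a + supp b ⊆ supp g` (`TypedDecomposition.exists_margins_of_support_mul_subset`), so `deg a = Σ ρ`; the cost bounds are
those of the two-sided template `TypedDecompositionLL.exists_typed_list_LL` (gate value = prefix circuit, complement = link
circuit `LinkCircuit.exists_linkCircuit`, `8·size + 8`), re-run with `MvPolynomial.totalDegree` in place of the row-support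
measure (descent: `exists_prodGate_of_lt_totalDegree`); pigeonhole = `RectangleBound.exists_rectangle_of_eq_sum`.
Repeated-squaring cofactors are exactly what this grading sees: for `h = coper(x^D) = Σ_π x^{D(𝟙−P_π)}` every mass-balanced
typed rectangle of `supp(per·h)` has relative size `≤ 4^{-n+o(n)}` (Bregman; crux NOTES §L), while its ROW-typed rectangles
(`stub_rectangleBound`) have relative size `≥ e^{-1}` (singleton `a = Σ_{i∈I} e_{(i,j)}`), i.e. the c2 engine is void there.
[cite: JerrumSnir1982, §3 (Lemma 3.1(iii), Thm. 3.2)] [folklore] -/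
theorem stub_massRectangleBound : ∀ (n : ℕ), 1 ≤ n →
    ∀ (g : MvPolynomial (Fin n × Fin n) ℝ≥0) (R C : Fin n → ℕ),
      (∀ m ∈ g.support, (∀ i, ∑ j, m (i, j) = R i) ∧ (∀ j, ∑ i, m (i, j) = C j)) →
      3 ≤ ∑ i, R i → g ≠ 0 →
      ∃ a b : MvPolynomial (Fin n × Fin n) ℝ≥0, a ≠ 0 ∧ b ≠ 0 ∧
        complexity a ≤ complexity g ∧ complexity b ≤ 8 * complexity g + 8 ∧
        (a * b).support ⊆ g.support ∧
        g.support.card ≤ complexity g * (a.support.card * b.support.card) ∧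
        ∃ ρ γ : Fin n → ℕ,
          (∀ m ∈ a.support, (∀ i, ∑ j, m (i, j) = ρ i) ∧ (∀ j, ∑ i, m (i, j) = γ j)) ∧
          (∑ i, R i) < 3 * (∑ i, ρ i) ∧ 3 * (∑ i, ρ i) ≤ 2 * (∑ i, R i) :=
  -- LANDED p163982 (c10 wave 1)
  Summit.ValiantsHypothesis.ValiantsHypothesis.Theorems.DivisionGap.PerMultiplesHard.MassRectangleBound.stub_massRectangleBound

/-- **stub_residual — THE OPEN STUB (hardest): the crux on the stall class of the walk (RESHAPED by lead c1).**
For all levels `a, b` and all large `n`: if `h ≠ 0` is torus-homogeneous, CONTENT-FREE (every cell is missed by some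
monomial), CONCENTRATION-POOR at level `a` — no exponent of `h` has more than `(log₂ n + a)^a + 3` columns concentrated in
one row, nor that many rows concentrated in one column (NEW, c1; in particular `h` has at most that many zero-margin rows
and columns, and no row of any monomial swallows more than that many whole columns) — ALIGNED at level `b` — on every face
`G` cut out by a weight `w` and rich enough that `n! · 2^{(log₂ n + b)^b} < #PM(G) · 2^{n/3}`, the top fibre of `h` has at
least two `G`-parts — and PURE-POOR at level `a` — `#Pure(per·h) ≤ 2^{(log₂ n + a)^a} · K_n · #Pure_π(per·h)` for some `π`
— then still `2^{(log₂ n + a)^a} < L(per_n · h)`.  LITERALLY the crux restricted to this class, hence implied by the crux.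
Members: NONE KNOWN (state after lead c2's cycle 2).  Every family named by any seat dies inside `PerMultiplesHard_of`: `h_far` and the
complete classes `T(q·1+v; q·1+v')` by the spread jaw (c1), staircase / low-offset classes by line projection, `Reg_k` / `h_fat` / Young
products by block projection or powers, permutation codes of density `≥ n^{−n/2}` by the Z-jaw with `#Z ≈ e·δ^{−1/n}` consecutive shifts,
thinner codes by isolation on a random deep-rich face through a codeword + `richFacesDeepD` at depth `≈ log₂(1/p)/0.918`, dense regular hosts
(`DensePerHard`) by `richFacesDeepD` + van der Waerden.  NEW HYPOTHESIS (lead c3, cycle 3): NO CHEAP TRIPLE IS DEEP-PURE-RICH — for every board size `k' ≤ n`, host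
`G ⊆ [k']²`, content `u` and torus-homogeneous multiplier `q` with `L(x^u · per_G · q) ≤ 2^{(log₂ n + a)^a} + 1` (every host-descent
/ host-block-projection descendant of `per_n · h` is such a triple: `stub_hostDescent`, `stub_hostTorus`, `stub_hostBlockProjection`), every
level `v` of the row margins `r' + 1` of `per_G · q` of size `k_v ≥ 3^{(D+2)²}` carries at most
`(2^{B_b}+1)^{3^{(D+1)²}} · k_v! · (k_v+1)^{3^{(D+1)²}} · 2^{D(k_v − k_v/3) + 3^{(D+2)²}} / 3^{D k_v}` distinct level slices of pure exponents
(discharged in `PerMultiplesHard_of` by JSS + `stub_levelSlice` + `stub_boardCompressionGen` + `deepPureCount`).  This kills c2's explicit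
candidates `h_pad` (padded face `Y = X_{s₀} ∪ R`, depth 1) and `h_univ = (Σ_{X α-regular} x^X)·g_𝒯` for every constant `α` (descent to `X₀`,
`#pure = #PM(X₀) ≈ n!αⁿ`, depth `D > log₂(1/α)/0.918`), and their fat variants (descent + host block projection + content strip).
NEW HYPOTHESIS (lead c9, cycle 9): NO RICH COMPLETE-CLASS CHEAP TRIPLE — on every `k'`-board with `dd·(B_b+2) ≤ k' ≤ n`, a host with
`k'! ≤ K^{k'}·#PM` and a complete class of balanced `k'`-close margins of offset `≥ 3k'³` on it never form a cheap triple (negation of the now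
unconditional `richHostCompleteClassHard`; discharged in `PerMultiplesHard_of` with `K := c + 1`, `dd := d(K) + n₀(K)`).
The stub now asks: is the class {torus-homogeneous, content-free, concentration-poor, spread/Z-poor, no single block part,
deep-aligned at all depths, rectangle-fat, pure-poor, NO deep-pure-rich cheap triple up to level a, NO rich complete-class cheap triple} EMPTY for large `n`?  (If yes, the crux follows
from the composition; if a member exists it is the universal test object = candidate support barrier.)
NOT members (handled by the other stubs through `PerMultiplesHard_of`): monomial content, anything rigid on one deep-rich face,
anything pure-rich (`per^k`, dense permutation sums), anything with a fat row (staircase classes of offset `< n`, cofactors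
missing `polylog` rows or columns, Disproof's block class), anything Z-dense, anything rectangle-thin.  Why it might fail: only with the
crux.  Size: open problem. -/
theorem stub_residual :
    ∀ a b e dd K : ℕ, ∃ n₀ : ℕ, ∀ n ≥ n₀, ∀ h : MvPolynomial (Fin n × Fin n) ℝ≥0, h ≠ 0 →
      ∀ r cc : Fin n → ℕ,
        (∀ m ∈ h.support, (∀ i, ∑ j, m (i, j) = r i) ∧ (∀ j, ∑ i, m (i, j) = cc j)) →
        (∀ e : Fin n × Fin n, ∃ m ∈ h.support, m e = 0) →
        (∀ (i : Fin n) (A : Finset (Fin n)),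
          (∃ d₀ ∈ h.support, ∀ e ∈ d₀.support, e.2 ∈ A → e.1 = i) → A.card ≤ (Nat.log 2 n + a) ^ a + 3) →
        (∀ (j : Fin n) (A : Finset (Fin n)),
          (∃ d₀ ∈ h.support, ∀ e ∈ d₀.support, e.1 ∈ A → e.2 = j) → A.card ≤ (Nat.log 2 n + a) ^ a + 3) →
        (∀ ζ : Equiv.Perm (Fin n), spreadCount ζ (perPoly (Fin n) ℝ≥0 * h) * 5 ^ (n / 10) ≤
          2 ^ ((Nat.log 2 n + a) ^ a) * (4 ^ (n / 10) * n.factorial)) →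
        (∀ ζ : Equiv.Perm (Fin n), colSpreadCount ζ (perPoly (Fin n) ℝ≥0 * h) * 5 ^ (n / 10) ≤
          2 ^ ((Nat.log 2 n + a) ^ a) * (4 ^ (n / 10) * n.factorial)) →
        (∀ Z : Finset (Equiv.Perm (Fin n)), 1 ≤ Z.card → 3 * Z.card ≤ n →
          zCount Z (perPoly (Fin n) ℝ≥0 * h) * 3 ^ (n / (3 * Z.card ^ 2)) ≤
            2 ^ ((Nat.log 2 n + a) ^ a) * (2 ^ (n / (3 * Z.card ^ 2)) * n.factorial)) →
        (∀ Z : Finset (Equiv.Perm (Fin n)), 1 ≤ Z.card → 3 * Z.card ≤ n →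
          colZCount Z (perPoly (Fin n) ℝ≥0 * h) * 3 ^ (n / (3 * Z.card ^ 2)) ≤
            2 ^ ((Nat.log 2 n + a) ^ a) * (2 ^ (n / (3 * Z.card ^ 2)) * n.factorial)) →
        (∀ (A B : Finset (Fin n)) (u : (Fin n × Fin n) →₀ ℕ), A.card = B.card →
          HasSingleBlockPart A B h u → A.card ≤ (Nat.log 2 n + e) ^ e + 2) →
        (∀ (D : ℕ), 1 ≤ D → 3 ^ (D + 1) ≤ n →
          ∀ (G : Finset (Fin n × Fin n)) (w : Fin n × Fin n → ℕ) (u : (Fin n × Fin n) →₀ ℕ), CutsOut w G →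
          n.factorial * ((n + 1) ^ (2 ^ D - 1) * 2 ^ (D * (n - n / 3) + 4 * D * 2 ^ D)) *
              (2 ^ ((Nat.log 2 n + b) ^ b) + 1) ^ (2 ^ D - 1) < pmCount G * 3 ^ (D * n) →
          ¬ HasSingleGPart G w h u) →
        (∃ p q : MvPolynomial (Fin n × Fin n) ℝ≥0, p ≠ 0 ∧ q ≠ 0 ∧
          complexity p ≤ 2 ^ ((Nat.log 2 n + a) ^ a) ∧ complexity q ≤ 8 * 2 ^ ((Nat.log 2 n + a) ^ a) + 8 ∧
          (p * q).support ⊆ (perPoly (Fin n) ℝ≥0 * h).support ∧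
          (perPoly (Fin n) ℝ≥0 * h).support.card ≤ 2 ^ ((Nat.log 2 n + a) ^ a) * (p.support.card * q.support.card) ∧
          ∃ ρ γ : Fin n → ℕ, (∀ m ∈ p.support, (∀ i, ∑ j, m (i, j) = ρ i) ∧ (∀ j, ∑ i, m (i, j) = γ j)) ∧
            n < 3 * (Finset.univ.filter fun i => ρ i ≠ 0).card ∧ 3 * (Finset.univ.filter fun i => ρ i ≠ 0).card ≤ 2 * n) →
        -- NEW (c10): MASS-FAT — `supp(per·h)` contains a typed rectangle `p·q` of relative size `≥ 2^{-B_a}` whose factor `p` is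
        -- balanced by TOTAL DEGREE (mass `Σ ρ` in the middle third of `n + Σ r`), cheap on both sides (negation of the mass jaw,
        -- `stub_massRectangleBound`; degree-free: no homogenisation is paid however large `deg h` is)
        (∃ p q : MvPolynomial (Fin n × Fin n) ℝ≥0, p ≠ 0 ∧ q ≠ 0 ∧
          complexity p ≤ 2 ^ ((Nat.log 2 n + a) ^ a) ∧ complexity q ≤ 8 * 2 ^ ((Nat.log 2 n + a) ^ a) + 8 ∧
          (p * q).support ⊆ (perPoly (Fin n) ℝ≥0 * h).support ∧
          (perPoly (Fin n) ℝ≥0 * h).support.card ≤ 2 ^ ((Nat.log 2 n + a) ^ a) * (p.support.card * q.support.card) ∧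
          ∃ ρ γ : Fin n → ℕ, (∀ m ∈ p.support, (∀ i, ∑ j, m (i, j) = ρ i) ∧ (∀ j, ∑ i, m (i, j) = γ j)) ∧
            (n + ∑ i, r i) < 3 * (∑ i, ρ i) ∧ 3 * (∑ i, ρ i) ≤ 2 * (n + ∑ i, r i)) →
        (∀ (D k' : ℕ) (G : Finset (Fin k' × Fin k')) (u : (Fin k' × Fin k') →₀ ℕ)
          (q : MvPolynomial (Fin k' × Fin k') ℝ≥0) (r' c' : Fin k' → ℕ) (v : ℕ),
          k' ≤ n → 1 ≤ v → 3 ^ ((D + 2) ^ 2) ≤ (Finset.univ.filter fun i => r' i + 1 = v).card →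
          (∀ m ∈ q.support, (∀ i, ∑ j, m (i, j) = r' i) ∧ (∀ j, ∑ i, m (i, j) = c' j)) →
          complexity (monomial u (1 : ℝ≥0) * (facePer G * q)) ≤ 2 ^ ((Nat.log 2 n + a) ^ a) + 1 →
          (((facePer G * q).support.filter fun M => ∃ σ : Equiv.Perm (Fin k'), ∀ e ∈ M.support, e.1 = σ e.2).image
              (fun M => M.filter (fun e => r' e.1 + 1 = v))).card *
              3 ^ (D * (Finset.univ.filter fun i => r' i + 1 = v).card) ≤
            (2 ^ ((Nat.log 2 n + b) ^ b) + 1) ^ (3 ^ ((D + 1) ^ 2)) *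
              (((Finset.univ.filter fun i => r' i + 1 = v).card).factorial *
                (((Finset.univ.filter fun i => r' i + 1 = v).card + 1) ^ (3 ^ ((D + 1) ^ 2)) *
                  2 ^ (D * ((Finset.univ.filter fun i => r' i + 1 = v).card -
                    (Finset.univ.filter fun i => r' i + 1 = v).card / 3) + 3 ^ ((D + 2) ^ 2))))) →
        (∀ (k' : ℕ) (G : Finset (Fin k' × Fin k')) (u : (Fin k' × Fin k') →₀ ℕ)
          (q : MvPolynomial (Fin k' × Fin k') ℝ≥0) (r' c' : Fin k' → ℕ) (ζ : Equiv.Perm (Fin k')),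
          5 ≤ k' → k' ≤ n →
          (∀ m ∈ q.support, (∀ i, ∑ j, m (i, j) = r' i) ∧ (∀ j, ∑ i, m (i, j) = c' j)) →
          complexity (monomial u (1 : ℝ≥0) * (facePer G * q)) ≤ 2 ^ ((Nat.log 2 n + a) ^ a) + 1 →
          spreadCount ζ (facePer G * q) * 5 ^ (k' / 10) ≤
            2 ^ ((Nat.log 2 n + b) ^ b) * (4 ^ (k' / 10) * k'.factorial)) →
        (∀ (k' : ℕ) (G : Finset (Fin k' × Fin k')) (u : (Fin k' × Fin k') →₀ ℕ)
          (q : MvPolynomial (Fin k' × Fin k') ℝ≥0) (r' c' : Fin k' → ℕ) (ζ : Equiv.Perm (Fin k')),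
          5 ≤ k' → k' ≤ n →
          (∀ m ∈ q.support, (∀ i, ∑ j, m (i, j) = r' i) ∧ (∀ j, ∑ i, m (i, j) = c' j)) →
          complexity (monomial u (1 : ℝ≥0) * (facePer G * q)) ≤ 2 ^ ((Nat.log 2 n + a) ^ a) + 1 →
          colSpreadCount ζ (facePer G * q) * 5 ^ (k' / 10) ≤
            2 ^ ((Nat.log 2 n + b) ^ b) * (4 ^ (k' / 10) * k'.factorial)) →
        (∀ (k' : ℕ) (G : Finset (Fin k' × Fin k')) (u : (Fin k' × Fin k') →₀ ℕ)
          (q : MvPolynomial (Fin k' × Fin k') ℝ≥0) (r' c' : Fin k' → ℕ) (Z : Finset (Equiv.Perm (Fin k'))),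
          k' ≤ n → 1 ≤ Z.card → 3 * Z.card ≤ k' →
          (∀ m ∈ q.support, (∀ i, ∑ j, m (i, j) = r' i) ∧ (∀ j, ∑ i, m (i, j) = c' j)) →
          complexity (monomial u (1 : ℝ≥0) * (facePer G * q)) ≤ 2 ^ ((Nat.log 2 n + a) ^ a) + 1 →
          zCount Z (facePer G * q) * 3 ^ (k' / (3 * Z.card ^ 2)) ≤
            2 ^ ((Nat.log 2 n + b) ^ b) * (2 ^ (k' / (3 * Z.card ^ 2)) * k'.factorial)) →
        (∀ (k' : ℕ) (G : Finset (Fin k' × Fin k')) (u : (Fin k' × Fin k') →₀ ℕ)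
          (q : MvPolynomial (Fin k' × Fin k') ℝ≥0) (r' c' : Fin k' → ℕ) (Z : Finset (Equiv.Perm (Fin k'))),
          k' ≤ n → 1 ≤ Z.card → 3 * Z.card ≤ k' →
          (∀ m ∈ q.support, (∀ i, ∑ j, m (i, j) = r' i) ∧ (∀ j, ∑ i, m (i, j) = c' j)) →
          complexity (monomial u (1 : ℝ≥0) * (facePer G * q)) ≤ 2 ^ ((Nat.log 2 n + a) ^ a) + 1 →
          colZCount Z (facePer G * q) * 3 ^ (k' / (3 * Z.card ^ 2)) ≤
            2 ^ ((Nat.log 2 n + b) ^ b) * (2 ^ (k' / (3 * Z.card ^ 2)) * k'.factorial)) →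
        -- NEW (c5): RELATIVELY spread-poor at every cheap triple, rows — inside EVERY comparison set `P` the `ζ`-probed permutations
        -- are `2^{-B_b}`-captured by ONE window rectangle (negation of `stub_spreadPatternsRel` after the JSS strip)
        (∀ (k' : ℕ) (G : Finset (Fin k' × Fin k')) (u : (Fin k' × Fin k') →₀ ℕ)
          (q : MvPolynomial (Fin k' × Fin k') ℝ≥0) (r' c' : Fin k' → ℕ) (ζ : Equiv.Perm (Fin k'))
          (P : Finset (Equiv.Perm (Fin k'))),
          5 ≤ k' → k' ≤ n →
          (∀ m ∈ q.support, (∀ i, ∑ j, m (i, j) = r' i) ∧ (∀ j, ∑ i, m (i, j) = c' j)) →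
          complexity (monomial u (1 : ℝ≥0) * (facePer G * q)) ≤ 2 ^ ((Nat.log 2 n + a) ^ a) + 1 →
          ∃ S T : Finset (Fin k'), k' < 5 * S.card ∧ 5 * S.card ≤ 2 * k' ∧
            (P.filter fun π => ∃ M ∈ (facePer G * q).support, ∀ e ∈ M.support, π e.2 = e.1 ∨ π e.2 = ζ e.1).card ≤
              2 ^ ((Nat.log 2 n + b) ^ b) *
                (P.filter fun π => (∀ i ∈ S, π.symm i ∈ T ∨ π.symm (ζ i) ∈ T) ∧
                  (∀ j ∈ T, π j ∈ S ∨ ∃ i ∈ S, ζ i = π j)).card) →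
        -- NEW (c5): RELATIVELY column-spread-poor at every cheap triple
        (∀ (k' : ℕ) (G : Finset (Fin k' × Fin k')) (u : (Fin k' × Fin k') →₀ ℕ)
          (q : MvPolynomial (Fin k' × Fin k') ℝ≥0) (r' c' : Fin k' → ℕ) (ζ : Equiv.Perm (Fin k'))
          (P : Finset (Equiv.Perm (Fin k'))),
          5 ≤ k' → k' ≤ n →
          (∀ m ∈ q.support, (∀ i, ∑ j, m (i, j) = r' i) ∧ (∀ j, ∑ i, m (i, j) = c' j)) →
          complexity (monomial u (1 : ℝ≥0) * (facePer G * q)) ≤ 2 ^ ((Nat.log 2 n + a) ^ a) + 1 →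
          ∃ S T : Finset (Fin k'), k' < 5 * S.card ∧ 5 * S.card ≤ 2 * k' ∧
            (P.filter fun π => ∃ M ∈ (facePer G * q).support, ∀ e ∈ M.support, π e.1 = e.2 ∨ π e.1 = ζ e.2).card ≤
              2 ^ ((Nat.log 2 n + b) ^ b) *
                (P.filter fun π => (∀ i ∈ S, π.symm i ∈ T ∨ π.symm (ζ i) ∈ T) ∧
                  (∀ j ∈ T, π j ∈ S ∨ ∃ i ∈ S, ζ i = π j)).card) →
        -- NEW (c5): RELATIVELY Z-poor and column-Z-poor at every cheap triple (k-cell engines, relative)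
        (∀ (k' : ℕ) (G : Finset (Fin k' × Fin k')) (u : (Fin k' × Fin k') →₀ ℕ)
          (q : MvPolynomial (Fin k' × Fin k') ℝ≥0) (r' c' : Fin k' → ℕ) (Z : Finset (Equiv.Perm (Fin k')))
          (P : Finset (Equiv.Perm (Fin k'))),
          k' ≤ n → 1 ≤ Z.card → 3 * Z.card ≤ k' →
          (∀ m ∈ q.support, (∀ i, ∑ j, m (i, j) = r' i) ∧ (∀ j, ∑ i, m (i, j) = c' j)) →
          complexity (monomial u (1 : ℝ≥0) * (facePer G * q)) ≤ 2 ^ ((Nat.log 2 n + a) ^ a) + 1 →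
          ∃ S T : Finset (Fin k'), k' < 3 * Z.card * S.card ∧ 3 * Z.card * S.card ≤ 2 * k' ∧
            (P.filter fun π => ∃ M ∈ (facePer G * q).support, ∀ e ∈ M.support, ∃ ζ ∈ Z, π e.2 = ζ e.1).card ≤
              2 ^ ((Nat.log 2 n + b) ^ b) *
                (P.filter fun π => (∀ i ∈ S, ∃ ζ ∈ Z, π.symm (ζ i) ∈ T) ∧
                  (∀ j ∈ T, ∃ ζ ∈ Z, ∃ i ∈ S, ζ i = π j)).card) →
        (∀ (k' : ℕ) (G : Finset (Fin k' × Fin k')) (u : (Fin k' × Fin k') →₀ ℕ)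
          (q : MvPolynomial (Fin k' × Fin k') ℝ≥0) (r' c' : Fin k' → ℕ) (Z : Finset (Equiv.Perm (Fin k')))
          (P : Finset (Equiv.Perm (Fin k'))),
          k' ≤ n → 1 ≤ Z.card → 3 * Z.card ≤ k' →
          (∀ m ∈ q.support, (∀ i, ∑ j, m (i, j) = r' i) ∧ (∀ j, ∑ i, m (i, j) = c' j)) →
          complexity (monomial u (1 : ℝ≥0) * (facePer G * q)) ≤ 2 ^ ((Nat.log 2 n + a) ^ a) + 1 →
          ∃ S T : Finset (Fin k'), k' < 3 * Z.card * S.card ∧ 3 * Z.card * S.card ≤ 2 * k' ∧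
            (P.filter fun π => ∃ M ∈ (facePer G * q).support, ∀ e ∈ M.support, ∃ ζ ∈ Z, π e.1 = ζ e.2).card ≤
              2 ^ ((Nat.log 2 n + b) ^ b) *
                (P.filter fun π => (∀ i ∈ S, ∃ ζ ∈ Z, π.symm (ζ i) ∈ T) ∧
                  (∀ j ∈ T, ∃ ζ ∈ Z, ∃ i ∈ S, ζ i = π j)).card) →
        -- NEW (c5): RELATIVELY ALIGNED — every cheap face permanent `x^u · per_G` (any `k'`-board) has its matchings `2^{-B_b}`-captured
        -- by ONE block-diagonal fibre `{π : π(T) = S}` of the degree window, inside EVERY comparison set `P` (negation of relative Jerrum–Snir)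
        (∀ (k' : ℕ) (G : Finset (Fin k' × Fin k')) (u : (Fin k' × Fin k') →₀ ℕ) (P : Finset (Equiv.Perm (Fin k'))),
          3 ≤ k' → k' ≤ n →
          complexity (monomial u (1 : ℝ≥0) * facePer G) ≤ 2 ^ ((Nat.log 2 n + a) ^ a) + 1 →
          ∃ S T : Finset (Fin k'), k' < 3 * T.card ∧ 3 * T.card ≤ 2 * k' ∧ S.card = T.card ∧
            (P.filter fun π => ∀ i, (π i, i) ∈ G).card ≤
              2 ^ ((Nat.log 2 n + b) ^ b) * (P.filter fun π : Equiv.Perm (Fin k') => T.image ⇑π = S).card) →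
        -- NEW (c9): NO RICH COMPLETE-CLASS cheap triple — on every `k'`-board with `dd·(B_b + 2) ≤ k' ≤ n`, for every host `G` with
        -- `k'! ≤ K^{k'}·#PM(G)` and every COMPLETE CLASS `t` on `G` of balanced, `k'`-close margins of offset `≥ 3k'³` (with some table), the triple
        -- `x^u · per_G · t` is NOT cheap (negation of `richHostCompleteClassHard`, unconditional since cycle 9 — crux NOTES §K)
        (∀ (k' : ℕ) (G : Finset (Fin k' × Fin k')) (u : (Fin k' × Fin k') →₀ ℕ)
          (t : MvPolynomial (Fin k' × Fin k') ℝ≥0) (R C : Fin k' → ℕ),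
          dd * ((Nat.log 2 n + b) ^ b + 2) ≤ k' → k' ≤ n →
          k'.factorial ≤ K ^ k' * pmCount G →
          (∀ m ∈ t.support, (∀ i, ∑ j, m (i, j) = R i) ∧ (∀ j, ∑ i, m (i, j) = C j)) →
          (∀ M : (Fin k' × Fin k') →₀ ℕ, M.support ⊆ G →
            (∀ i, ∑ j, M (i, j) = R i) → (∀ j, ∑ i, M (i, j) = C j) → M ∈ t.support) →
          (∃ M : (Fin k' × Fin k') →₀ ℕ, M.support ⊆ G ∧ (∀ i, ∑ j, M (i, j) = R i) ∧ (∀ j, ∑ i, M (i, j) = C j)) →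
          ∑ i, R i = ∑ j, C j → (∀ i j, R i ≤ C j + k' ∧ C j ≤ R i + k') → (∀ i, 3 * k' ^ 3 ≤ R i) →
          2 ^ ((Nat.log 2 n + a) ^ a) + 1 < complexity (monomial u (1 : ℝ≥0) * (facePer G * t))) →
        (∃ π : Equiv.Perm (Fin n),
          pureCount (perPoly (Fin n) ℝ≥0 * h) ≤
            2 ^ ((Nat.log 2 n + a) ^ a) * typeK n * pureCountAt (perPoly (Fin n) ℝ≥0 * h) π) →
        2 ^ ((Nat.log 2 n + a) ^ a) < complexity (perPoly (Fin n) ℝ≥0 * h) := by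
  sorry

/-! ### Cycle 4 (lead c4): the COMPLETE-CLASS RUNG — two registered stubs and their sorry-free composition -/

/-- **stub_twoBandTable — 2-band (spread) probes exist in every complete class of close margins and offset `> n²` …
(LANDED p123280; the full docstring — statement in words, proof route, sources — is carried by the tree file referenced in the proof term below; shortened here by lead c6 to keep the workfile under the 200 kB limit.) [folklore] -/
theorem stub_twoBandTable :
    ∀ (n : ℕ) (π : Equiv.Perm (Fin n)) (R C : Fin n → ℕ),
      ∑ i, R i = ∑ j, C j →
      (∀ i j, R i ≤ C j + n ∧ C j ≤ R i + n) →
      (∀ i, n ^ 2 + 1 ≤ R i) →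
      ∃ M : (Fin n × Fin n) →₀ ℕ,
        (∀ e ∈ M.support, π e.2 = e.1 ∨ π e.2 = finRotate n e.1) ∧
        (∀ i, ∑ j, M (i, j) = R i) ∧ (∀ j, ∑ i, M (i, j) = C j) :=
  -- LANDED p123280 (lead c4 wave 1)
  Summit.ValiantsHypothesis.ValiantsHypothesis.Theorems.DivisionGap.PerMultiplesHard.TwoBandTable.stub_twoBandTable

/-- **stub_completeClassRung — a cofactor carrying a spread probe for EVERY permutation makes `per_n · t` cost `(5/4)^{n/10}` …
(LANDED p123406; the full docstring — statement in words, proof route, sources — is carried by the tree file referenced in the proof term below; shortened here by lead c6 to keep the workfile under the 200 kB limit.) [folklore] -/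
theorem stub_completeClassRung :
    ∀ n ≥ 5, ∀ (t : MvPolynomial (Fin n × Fin n) ℝ≥0) (R C : Fin n → ℕ),
      (∀ m ∈ t.support, (∀ i, ∑ j, m (i, j) = R i) ∧ (∀ j, ∑ i, m (i, j) = C j)) →
      (∀ π : Equiv.Perm (Fin n), ∃ M ∈ t.support, ∀ e ∈ M.support, π e.2 = e.1 ∨ π e.2 = finRotate n e.1) →
      5 ^ (n / 10) ≤ complexity (perPoly (Fin n) ℝ≥0 * t) * 4 ^ (n / 10) :=
  -- LANDED p123406 (lead c4 wave 1)
  Summit.ValiantsHypothesis.ValiantsHypothesis.Theorems.DivisionGap.PerMultiplesHard.CompleteClassRung.stub_completeClassRung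

/-! `completeClassMultiplesHard` (lead c4; `5^{⌊n/10⌋} ≤ L⁺(per_n · t) · 4^{⌊n/10⌋}` for every complete class of close margins, offset `> n²`): the sorry-free composition of
`stub_twoBandTable` + `stub_completeClassRung` is LANDED inside `Theorems/…RelDenseCompleteClass.lean`'s sibling files and kept in the evidence copies; removed here for size. -/

/-! ### Cycle-5 stubs (lead c5): the counting jaws in RELATIVE (scale-free) form

Every landed counting engine bounds the number of permutations ONE typed rectangle serves against `n!`.  On a HOST
`X` of density `α` the probed permutations are only an `α^{2n}` fraction of `S_n`, so the absolute jaws are void below density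
`≈ 0.98` (lead c4, crux NOTES §F1–F2) — but the served FRACTION of the probed set is what matters, and it is the same on a
pseudo-random host as on `K_{n,n}`.  The relative jaws below intersect both sides of the engine inequality with an arbitrary
comparison set `P ⊆ S_n` (the proofs are the landed ones with `Finset.univ` replaced by `P`); the application to a host takes
`P = PM(X ∩ ζX)` and bounds the captured part by Brégman–Minc (`stub_bregmanFibre`, from the TREE theorem
`Literature.Combinatorics.Enumerative.card_le_prod_factorial_rpow`) against van der Waerden (named fact, to file). -/

/-- **stub_spreadPatternsRel — the relative spread engine, rows (NEW, lead c5; provable now, size S: the landed …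
(LANDED p125091; the full docstring — statement in words, proof route, sources — is carried by the tree file referenced in the proof term below; shortened here by lead c6 to keep the workfile under the 200 kB limit.) [folklore] -/
theorem stub_spreadPatternsRel :
    ∀ n ≥ 5, ∀ (ζ : Equiv.Perm (Fin n)) (g : MvPolynomial (Fin n × Fin n) ℝ≥0) (R C : Fin n → ℕ),
      (∀ m ∈ g.support, (∀ i, ∑ j, m (i, j) = R i) ∧ (∀ j, ∑ i, m (i, j) = C j)) →
      (∀ i, R i ≠ 0) →
      ∀ P : Finset (Equiv.Perm (Fin n)), ∃ S T : Finset (Fin n),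
        n < 5 * S.card ∧ 5 * S.card ≤ 2 * n ∧
        (P.filter fun π => ∃ m ∈ g.support, ∀ e ∈ m.support, π e.2 = e.1 ∨ π e.2 = ζ e.1).card ≤
          complexity g *
            (P.filter fun π => (∀ i ∈ S, π.symm i ∈ T ∨ π.symm (ζ i) ∈ T) ∧
              (∀ j ∈ T, π j ∈ S ∨ ∃ i ∈ S, ζ i = π j)).card :=
  -- LANDED p125091 (lead c5 wave 1; olean built, wired by lead c6)
  Summit.ValiantsHypothesis.ValiantsHypothesis.Theorems.DivisionGap.PerMultiplesHard.SpreadPatternsRel.stub_spreadPatternsRel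

/-- **stub_spreadPatternsColRel — the relative spread engine, columns (NEW, lead c5; provable now, size S).**  The transpose of
`stub_spreadPatternsRel`: all COLUMNS hit, column probes (`π a = b ∨ π a = ζ b` for every cell `(a, b)`), same compatibility formula (it is
the row statement for `rename Prod.swap g`, whose complexity is the same, `complexity_rename_of_injective_holds`, and whose row probes for `π`
are the column probes of `g` — exactly as the landed `SpreadPatterns.spreadPatternsCol` is derived from `spreadPatterns`). [folklore] -/
theorem stub_spreadPatternsColRel :
    ∀ n ≥ 5, ∀ (ζ : Equiv.Perm (Fin n)) (g : MvPolynomial (Fin n × Fin n) ℝ≥0) (R C : Fin n → ℕ),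
      (∀ m ∈ g.support, (∀ i, ∑ j, m (i, j) = R i) ∧ (∀ j, ∑ i, m (i, j) = C j)) →
      (∀ j, C j ≠ 0) →
      ∀ P : Finset (Equiv.Perm (Fin n)), ∃ S T : Finset (Fin n),
        n < 5 * S.card ∧ 5 * S.card ≤ 2 * n ∧
        (P.filter fun π => ∃ m ∈ g.support, ∀ e ∈ m.support, π e.1 = e.2 ∨ π e.1 = ζ e.2).card ≤
          complexity g *
            (P.filter fun π => (∀ i ∈ S, π.symm i ∈ T ∨ π.symm (ζ i) ∈ T) ∧
              (∀ j ∈ T, π j ∈ S ∨ ∃ i ∈ S, ζ i = π j)).card :=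
  -- LANDED p125091 (lead c5 wave 1; olean built, wired by lead c6)
  Summit.ValiantsHypothesis.ValiantsHypothesis.Theorems.DivisionGap.PerMultiplesHard.SpreadPatternsRel.stub_spreadPatternsColRel

/-- **stub_zSpreadPatternsRel — the relative k-cell engine, rows (NEW, lead c5; provable now, size S: the landed
`ZSpreadPatterns.zSpreadPatterns` with `Finset.univ` replaced by `P`).**  For `#Z = k ≥ 1`, `3k ≤ n`, a torus-homogeneous `g` with all rows
hit and any `P`: some typed rectangle `(S, T)` with `n < 3k·#S ≤ 2n` has
`#{π ∈ P : supp g has a Z-probe for π} ≤ L(g) · #{π ∈ P : π Z-compatible with (S, T)}`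
(`typedDecompositionWindow n (3k)` + `ZSpreadPatterns.zCompatible_of_probe` + max over `t`). [folklore] -/
theorem stub_zSpreadPatternsRel :
    ∀ (n k : ℕ) (Z : Finset (Equiv.Perm (Fin n))), Z.card = k → 1 ≤ k → 3 * k ≤ n →
      ∀ (g : MvPolynomial (Fin n × Fin n) ℝ≥0) (R C : Fin n → ℕ),
        (∀ m ∈ g.support, (∀ i, ∑ j, m (i, j) = R i) ∧ (∀ j, ∑ i, m (i, j) = C j)) → (∀ i, R i ≠ 0) →
        ∀ P : Finset (Equiv.Perm (Fin n)), ∃ S T : Finset (Fin n),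
          n < 3 * k * S.card ∧ 3 * k * S.card ≤ 2 * n ∧
          (P.filter fun π => ∃ m ∈ g.support, ∀ e ∈ m.support, ∃ ζ ∈ Z, π e.2 = ζ e.1).card ≤
            complexity g *
              (P.filter fun π => (∀ i ∈ S, ∃ ζ ∈ Z, π.symm (ζ i) ∈ T) ∧
                (∀ j ∈ T, ∃ ζ ∈ Z, ∃ i ∈ S, ζ i = π j)).card :=
  -- LANDED p125236 (lead c5 wave 1; olean built, wired by lead c6)
  Summit.ValiantsHypothesis.ValiantsHypothesis.Theorems.DivisionGap.PerMultiplesHard.ZSpreadPatternsRel.stub_zSpreadPatternsRel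

/-- **stub_zSpreadPatternsColRel — the relative k-cell engine, columns (NEW, lead c5; provable now, size S).**  Transpose of
`stub_zSpreadPatternsRel` (all columns hit; column `Z`-probes `π a = ζ b`), via `rename Prod.swap` as in the landed
`ZSpreadPatterns.zSpreadPatternsCol`. [folklore] -/
theorem stub_zSpreadPatternsColRel :
    ∀ (n k : ℕ) (Z : Finset (Equiv.Perm (Fin n))), Z.card = k → 1 ≤ k → 3 * k ≤ n →
      ∀ (g : MvPolynomial (Fin n × Fin n) ℝ≥0) (R C : Fin n → ℕ),
        (∀ m ∈ g.support, (∀ i, ∑ j, m (i, j) = R i) ∧ (∀ j, ∑ i, m (i, j) = C j)) → (∀ j, C j ≠ 0) →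
        ∀ P : Finset (Equiv.Perm (Fin n)), ∃ S T : Finset (Fin n),
          n < 3 * k * S.card ∧ 3 * k * S.card ≤ 2 * n ∧
          (P.filter fun π => ∃ m ∈ g.support, ∀ e ∈ m.support, ∃ ζ ∈ Z, π e.1 = ζ e.2).card ≤
            complexity g *
              (P.filter fun π => (∀ i ∈ S, ∃ ζ ∈ Z, π.symm (ζ i) ∈ T) ∧
                (∀ j ∈ T, ∃ ζ ∈ Z, ∃ i ∈ S, ζ i = π j)).card :=
  -- LANDED p125236 (lead c5 wave 1; olean built, wired by lead c6)
  Summit.ValiantsHypothesis.ValiantsHypothesis.Theorems.DivisionGap.PerMultiplesHard.ZSpreadPatternsRel.stub_zSpreadPatternsColRel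

/-- **stub_subSupportCountRel — Jerrum–Snir by sub-support, RELATIVE (NEW, lead c5; provable now, size M: the landed …
(LANDED p125483; the full docstring — statement in words, proof route, sources — is carried by the tree file referenced in the proof term below; shortened here by lead c6 to keep the workfile under the 200 kB limit.) [folklore] -/
theorem stub_subSupportCountRel :
    ∀ (m : ℕ), 3 ≤ m → ∀ (p : MvPolynomial (Fin m × Fin m) ℝ≥0),
      p.support ⊆ (perPoly (Fin m) ℝ≥0).support →
      ∀ P : Finset (Equiv.Perm (Fin m)), ∃ S T : Finset (Fin m),
        m < 3 * T.card ∧ 3 * T.card ≤ 2 * m ∧ S.card = T.card ∧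
        (P.filter fun π => permMonomial π ∈ p.support).card ≤
          complexity p * (P.filter fun π : Equiv.Perm (Fin m) => T.image ⇑π = S).card :=
  -- LANDED p125483 (lead c5 wave 1; olean built, wired by lead c6)
  Summit.ValiantsHypothesis.ValiantsHypothesis.Theorems.DivisionGap.PerMultiplesHard.SubSupportCountRel.stub_subSupportCountRel

/-- **stub_spreadCaptureRel — compatible sets split into few block-diagonal fibres, inside any `P` (NEW, lead c5; provable now, …
(LANDED p125331; the full docstring — statement in words, proof route, sources — is carried by the tree file referenced in the proof term below; shortened here by lead c6 to keep the workfile under the 200 kB limit.) [folklore] -/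
theorem stub_spreadCaptureRel :
    ∀ (n : ℕ) (ζ : Equiv.Perm (Fin n)) (S T : Finset (Fin n)) (P : Finset (Equiv.Perm (Fin n))) (M : ℕ),
      (∀ U : Finset (Fin n), U ⊆ S ∪ S.image ⇑ζ → U.card = T.card →
        (P.filter fun π : Equiv.Perm (Fin n) => T.image ⇑π = U).card ≤ M) →
      (P.filter fun π => (∀ i ∈ S, π.symm i ∈ T ∨ π.symm (ζ i) ∈ T) ∧
          (∀ j ∈ T, π j ∈ S ∨ ∃ i ∈ S, ζ i = π j)).card ≤ (2 * S.card).choose T.card * M ∧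
      ((P.filter fun π => (∀ i ∈ S, π.symm i ∈ T ∨ π.symm (ζ i) ∈ T) ∧
          (∀ j ∈ T, π j ∈ S ∨ ∃ i ∈ S, ζ i = π j)).Nonempty → S.card ≤ 2 * T.card ∧ T.card ≤ 2 * S.card) :=
  -- LANDED p125331 (lead c5 wave 1; olean built, wired by lead c6)
  Summit.ValiantsHypothesis.ValiantsHypothesis.Theorems.DivisionGap.PerMultiplesHard.SpreadCaptureRel.stub_spreadCaptureRel

/-- **stub_bregmanFibre — Brégman–Minc bounds every block-diagonal fibre of `PM(Y)` by the column degrees of `Y` (NEW, lead c5; …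
(LANDED p125371; the full docstring — statement in words, proof route, sources — is carried by the tree file referenced in the proof term below; shortened here by lead c6 to keep the workfile under the 200 kB limit.) [folklore] -/
theorem stub_bregmanFibre :
    ∀ (n : ℕ) (Y : Finset (Fin n × Fin n)) (T U : Finset (Fin n)),
      ((((Finset.univ : Finset (Equiv.Perm (Fin n))).filter fun π : Equiv.Perm (Fin n) =>
            (∀ j, (π j, j) ∈ Y) ∧ T.image ⇑π = U).card : ℕ) : ℝ) ≤
        ∏ j : Fin n,
          ((((if j ∈ T then U.filter fun i => (i, j) ∈ Y else Uᶜ.filter fun i => (i, j) ∈ Y).card.factorial : ℕ) : ℝ) ^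
            ((1 : ℝ) / ((if j ∈ T then U.filter fun i => (i, j) ∈ Y else Uᶜ.filter fun i => (i, j) ∈ Y).card : ℝ))) :=
  -- LANDED p125371 (lead c5 wave 1; olean built, wired by lead c6)
  Summit.ValiantsHypothesis.ValiantsHypothesis.Theorems.DivisionGap.PerMultiplesHard.BregmanFibre.stub_bregmanFibre

/-! ### Cycle-5 wave-2 stubs (lead c5): toward the CONDITIONAL dense-host kill `relDenseHost_of_vdW`
(crux NOTES §G2 steps (3)–(8) for an explicitly `(β, ε)`-regular host: Z-capture, Jensen for `log(d!)/d`, Stirling majorant) -/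

/-- **stub_zCaptureRel — Z-compatible sets split into few block-diagonal fibres, inside any `P` (NEW, lead c5 wave 2; provable now, size S: …
(LANDED p125979; the full docstring — statement in words, proof route, sources — is carried by the tree file referenced in the proof term below; shortened here by lead c6 to keep the workfile under the 200 kB limit.) [folklore] -/
theorem stub_zCaptureRel :
    ∀ (n : ℕ) (Z : Finset (Equiv.Perm (Fin n))) (S T : Finset (Fin n)) (P : Finset (Equiv.Perm (Fin n))) (M : ℕ),
      (∀ U : Finset (Fin n), U ⊆ Z.biUnion (fun ζ => S.image ⇑ζ) → U.card = T.card →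
        (P.filter fun π : Equiv.Perm (Fin n) => T.image ⇑π = U).card ≤ M) →
      (P.filter fun π : Equiv.Perm (Fin n) => (∀ i ∈ S, ∃ ζ ∈ Z, π.symm (ζ i) ∈ T) ∧
          (∀ j ∈ T, ∃ ζ ∈ Z, ∃ i ∈ S, ζ i = π j)).card ≤ (Z.card * S.card).choose T.card * M ∧
      ((P.filter fun π : Equiv.Perm (Fin n) => (∀ i ∈ S, ∃ ζ ∈ Z, π.symm (ζ i) ∈ T) ∧
          (∀ j ∈ T, ∃ ζ ∈ Z, ∃ i ∈ S, ζ i = π j)).Nonempty → S.card ≤ Z.card * T.card ∧ T.card ≤ Z.card * S.card) :=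
  -- LANDED p125979 (lead c5 wave 2; wired by lead c6)
  Summit.ValiantsHypothesis.ValiantsHypothesis.Theorems.DivisionGap.PerMultiplesHard.ZCaptureRel.stub_zCaptureRel

/-- **stub_logFactorialJensen — Jensen for the Brégman exponent (NEW, lead c5 wave 2; provable now, size M, real analysis on `ℕ`).**  The Brégman …
(LANDED p126116; the full docstring — statement in words, proof route, sources — is carried by the tree file referenced in the proof term below; shortened here by lead c6 to keep the workfile under the 200 kB limit.) [folklore] -/
theorem stub_logFactorialJensen :
    ∀ (u D : ℕ) (d : Fin u → ℕ), 1 ≤ D → (∀ b, 1 ≤ d b) → ∑ b, d b ≤ u * D →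
      ∑ b, Real.log (((d b).factorial : ℕ) : ℝ) / ((d b : ℕ) : ℝ) ≤
        (u : ℝ) * (Real.log ((D.factorial : ℕ) : ℝ) / ((D : ℕ) : ℝ)) :=
  -- LANDED p126116 (lead c5 wave 2; wired by lead c6)
  Summit.ValiantsHypothesis.ValiantsHypothesis.Theorems.DivisionGap.PerMultiplesHard.LogFactorialJensen.stub_logFactorialJensen

/-- **stub_stirlingGamma — the Stirling majorant of the Brégman exponent (NEW, lead c5 wave 2; provable now, size S from Mathlib's `Stirling`).**
For `D ≥ 1`: `log(D!) ≤ D·log D − D + (log D)/2 + 1`, i.e. `D! ≤ e·√D·(D/e)^D` — Mathlib: `Stirling.stirlingSeq n = n!/(√(2n)(n/e)^n)`,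
`Stirling.stirlingSeq'_antitone` (antitone from `n = 1` on) and `Stirling.stirlingSeq_one = e/√2`.  So `γ(D) = log(D!)/D ≤ log D − 1 + (log D + 2)/(2D)`.
[folklore] -/
theorem stub_stirlingGamma :
    ∀ (D : ℕ), 1 ≤ D →
      Real.log ((D.factorial : ℕ) : ℝ) ≤ (D : ℝ) * Real.log (D : ℝ) - (D : ℝ) + Real.log (D : ℝ) / 2 + 1 :=
  -- LANDED p125977 (lead c5 wave 2; wired by lead c6)
  Summit.ValiantsHypothesis.ValiantsHypothesis.Theorems.DivisionGap.PerMultiplesHard.StirlingGamma.stub_stirlingGamma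

/-- **stub_relDenseHost — the CONDITIONAL dense-host kill (NEW, lead c5 wave 3; provable now from the cycle-5 stubs, size L ≈ 300–400 lines; …
(LANDED p127004; the full docstring — statement in words, proof route, sources — is carried by the tree file referenced in the proof term below; shortened here by lead c6 to keep the workfile under the 200 kB limit.) [folklore] -/
theorem stub_relDenseHost :
    (∀ (m : ℕ) (A : Matrix (Fin m) (Fin m) ℝ), (∀ i j, 0 ≤ A i j) →
      (∀ i, ∑ j, A i j = 1) → (∀ j, ∑ i, A i j = 1) →
      (m.factorial : ℝ) ≤ (m : ℝ) ^ m * A.permanent) →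
    ∀ n ≥ 5, ∀ (Y Y' : Finset (Fin n × Fin n)) (f : ℕ), Y' ⊆ Y → 1 ≤ f →
      (∀ i : Fin n, (Finset.univ.filter fun j : Fin n => (i, j) ∈ Y').card = f) →
      (∀ j : Fin n, (Finset.univ.filter fun i : Fin n => (i, j) ∈ Y').card = f) →
      ∀ (β ε : ℝ), 0 < β → β ≤ 1 → 0 ≤ ε → ε ≤ 1 →
      (∀ A B : Finset (Fin n),
        ((Y.filter fun e => e.1 ∈ A ∧ e.2 ∈ B).card : ℝ) ≤ β * A.card * B.card + ε * (n : ℝ) ^ 2) →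
      ∀ (ζ : Equiv.Perm (Fin n)) (g : MvPolynomial (Fin n × Fin n) ℝ≥0) (R C : Fin n → ℕ),
        (∀ m ∈ g.support, (∀ i, ∑ j, m (i, j) = R i) ∧ (∀ j, ∑ i, m (i, j) = C j)) →
        (∀ i, R i ≠ 0) →
        (∀ π : Equiv.Perm (Fin n), (∀ j, (π j, j) ∈ Y) →
          ∃ M ∈ g.support, ∀ e ∈ M.support, π e.2 = e.1 ∨ π e.2 = ζ e.1) →
        (f : ℝ) ^ n * (5 : ℝ) ^ (n / 10) ≤
          (complexity g : ℝ) * (β * n) ^ n * (4 : ℝ) ^ (n / 10) *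
            Real.exp (15 * ε * n / β + (Real.log n + 12) / β) :=
  -- LANDED p127004 (lead c5; wired by lead c6)
  Summit.ValiantsHypothesis.ValiantsHypothesis.Theorems.DivisionGap.PerMultiplesHard.RelDenseHost.stub_relDenseHost

/-! ### Cycle-6 stubs (lead c6): richness is load-bearing (thin hosts of bounded path-width carry CHEAP complete classes — transfer-matrix DP, crux NOTES
§H1), the matching-spreading tool `stub_sparseAvoidingMatchings`, and the rich-host target (now below, cycle 7). -/

/-- **stub_sparseAvoidingMatchings — few perfect matchings live inside a sparse cell set (NEW, lead c6; provable now, size M, from the TREE …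
(LANDED p127823; the full docstring — statement in words, proof route, sources — is carried by the tree file referenced in the proof term below; shortened here by lead c6 to keep the workfile under the 200 kB limit.) [folklore] -/
theorem stub_sparseAvoidingMatchings :
    ∀ (n s D : ℕ) (E : Finset (Fin n × Fin n)), s ≤ n → 1 ≤ D → E.card ≤ (n - s) * D →
      ((((Finset.univ : Finset (Equiv.Perm (Fin n))).filter fun π : Equiv.Perm (Fin n) =>
            (Finset.univ.filter fun j : Fin n => (π j, j) ∉ E).card ≤ s).card : ℕ) : ℝ) ≤
        (n.choose s : ℝ) *
          Real.exp ((s : ℝ) * (Real.log ((n.factorial : ℕ) : ℝ) / (n : ℝ)) +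
            ((n - s : ℕ) : ℝ) * (Real.log ((D.factorial : ℕ) : ℝ) / (D : ℝ))) :=
  -- LANDED p127823 (lead c6 wave 1, W2)
  Summit.ValiantsHypothesis.ValiantsHypothesis.Theorems.DivisionGap.PerMultiplesHard.SparseAvoidingMatchings.stub_sparseAvoidingMatchings

-- `richHostCompleteClassHard`: MOVED below (cycle 7, lead c7) — it is now a THEOREM modulo the structure target `stub_richSquareBlock`.

/-! ### Cycle-6 stubs (lead c6), second group: VAN DER WAERDEN DISCHARGED by Gurvits' capacity argument — restatements REMOVED FROM THE
WORKFILE by lead c7 (all LANDED: `stub_gurvitsUnivariate` p128059, `stub_realRootedRestriction` p127994/p128333, `stub_prodLinearFormsStable` p128003,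
`stub_coeff_prodLinearForms` p127956, `stub_stepStable` p128638, and the assembly `Literature.Combinatorics.Enumerative.VanDerWaerdenPermanent_holds`
p128756, used directly below). -/

/-! `densePerHardReg_unconditional`, `relDenseHost_unconditional`, `relDenseCompleteClassHard_unconditional` (lead c6): the tree theorems `DensePerHardReg.densePerHardReg`,
`RelDenseHost.stub_relDenseHost`, `RelDenseCompleteClass.relDenseCompleteClassHard` applied to `Literature.Combinatorics.Enumerative.VanDerWaerdenPermanent_holds` (p128756);
restatements removed from the workfile by lead c7 for size (evidence copies ≤ 2026-08-16T23:10Z keep them). -/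

/-- **stub_regularFactor — the bipartite `f`-factor theorem (Ore 1956 / Gale–Ryser; NEW, lead c6; provable now, size M–L, from the TREE theorem …
(LANDED p128420; the full docstring — statement in words, proof route, sources — is carried by the tree file referenced in the proof term below; shortened here by lead c6 to keep the workfile under the 200 kB limit.) [folklore] -/
theorem stub_regularFactor :
    ∀ (n f : ℕ) (Y : Finset (Fin n × Fin n)),
      (∀ A B : Finset (Fin n), f * (A.card + B.card) ≤ f * n + (Y.filter fun e => e.1 ∈ A ∧ e.2 ∈ B).card) →
      ∃ Y' : Finset (Fin n × Fin n), Y' ⊆ Y ∧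
        (∀ i : Fin n, (Finset.univ.filter fun j : Fin n => (i, j) ∈ Y').card = f) ∧
        (∀ j : Fin n, (Finset.univ.filter fun i : Fin n => (i, j) ∈ Y').card = f) :=
  -- LANDED p128420 (wrapper) / Literature p128116 `Literature.Combinatorics.Optimization.exists_regular_subgraph_of_cut_condition` (lead c6 wave 1, W3)
  Summit.ValiantsHypothesis.ValiantsHypothesis.Theorems.DivisionGap.PerMultiplesHard.RegularFactor.stub_regularFactor

/-! ### Cycle-6 wave-2 stubs (lead c6): the constant-margin rich-host rung, the `f`-factor from mixing data, the two-host
dense rung, and the LOCALISED typed decomposition (first piece of the hybrid-probe engine, crux NOTES §H2(c)) -/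

/-- **stub_richHostConstantMarginsRaw — rich host + complete class with CONSTANT margins, closed form (NEW, lead c6 wave 2; provable now, …
(LANDED p129306; the full docstring — statement in words, proof route, sources — is carried by the tree file referenced in the proof term below; shortened here by lead c6 to keep the workfile under the 200 kB limit.) [folklore] -/
theorem stub_richHostConstantMarginsRaw :
    ∀ (D n : ℕ), 3 ^ ((D + 2) ^ 2) ≤ n →
      ∀ (G : Finset (Fin n × Fin n)) (t : MvPolynomial (Fin n × Fin n) ℝ≥0) (q : ℕ), 1 ≤ q →
      (∀ m ∈ t.support, (∀ i, ∑ j, m (i, j) = q) ∧ (∀ j, ∑ i, m (i, j) = q)) →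
      (∀ π : Equiv.Perm (Fin n), (∀ i, (π i, i) ∈ G) → q • permMonomial π ∈ t.support) →
      ((Finset.univ : Finset (Equiv.Perm (Fin n))).filter (fun σ => ∀ i, (σ i, i) ∈ G)).card * 3 ^ (D * n) ≤
        (complexity ((∑ σ ∈ (Finset.univ : Finset (Equiv.Perm (Fin n))).filter (fun σ => ∀ i, (σ i, i) ∈ G),
            monomial (permMonomial σ) (1 : ℝ≥0)) * t) + 1) ^ (3 ^ ((D + 1) ^ 2)) *
          (n.factorial * ((n + 1) ^ (3 ^ ((D + 1) ^ 2)) * 2 ^ (D * (n - n / 3) + 3 ^ ((D + 2) ^ 2)))) :=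
  -- LANDED p129306 (lead c6 wave 2, S1a)
  Summit.ValiantsHypothesis.ValiantsHypothesis.Theorems.DivisionGap.PerMultiplesHard.RichHostConstantMarginsRaw.stub_richHostConstantMarginsRaw

/-- **stub_richHostConstantMargins — the RICH-HOST COMPLETE-CLASS RUNG for constant margins (NEW, lead c6 wave 2; provable now, size M: …
(LANDED p129494; the full docstring — statement in words, proof route, sources — is carried by the tree file referenced in the proof term below; shortened here by lead c6 to keep the workfile under the 200 kB limit.) [folklore] -/
theorem stub_richHostConstantMargins :
    ∀ K : ℕ, 1 ≤ K → ∃ d n₀ : ℕ, ∀ n ≥ n₀,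
      ∀ (G : Finset (Fin n × Fin n)) (t : MvPolynomial (Fin n × Fin n) ℝ≥0) (q : ℕ), 1 ≤ q →
      n.factorial ≤ K ^ n * ((Finset.univ : Finset (Equiv.Perm (Fin n))).filter (fun σ => ∀ i, (σ i, i) ∈ G)).card →
      (∀ m ∈ t.support, (∀ i, ∑ j, m (i, j) = q) ∧ (∀ j, ∑ i, m (i, j) = q)) →
      (∀ π : Equiv.Perm (Fin n), (∀ i, (π i, i) ∈ G) → q • permMonomial π ∈ t.support) →
      2 ^ (n / d) ≤ complexity ((∑ σ ∈ (Finset.univ : Finset (Equiv.Perm (Fin n))).filter (fun σ => ∀ i, (σ i, i) ∈ G),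
            monomial (permMonomial σ) (1 : ℝ≥0)) * t) :=
  -- LANDED p129494 (lead c6 wave 2, S1b): the rich-host complete-class rung for constant margins, unconditional
  Summit.ValiantsHypothesis.ValiantsHypothesis.Theorems.DivisionGap.PerMultiplesHard.RichHostConstantMargins.stub_richHostConstantMargins

/-- **stub_regularPairFactor — the `f`-factor cut condition from two-sided mixing and minimum degree (NEW, lead c6 wave 2; provable now, size M, …
(LANDED p129453; the full docstring — statement in words, proof route, sources — is carried by the tree file referenced in the proof term below; shortened here by lead c6 to keep the workfile under the 200 kB limit.) [folklore] -/
theorem stub_regularPairFactor :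
    ∀ (n f : ℕ) (Y : Finset (Fin n × Fin n)) (β ε η : ℝ), 0 < β → 0 ≤ ε → 0 ≤ η →
      (∀ A B : Finset (Fin n),
        β * A.card * B.card - ε * (n : ℝ) ^ 2 ≤ ((Y.filter fun e => e.1 ∈ A ∧ e.2 ∈ B).card : ℝ)) →
      (∀ i : Fin n, (β - η) * n ≤ ((Finset.univ.filter fun j : Fin n => (i, j) ∈ Y).card : ℝ)) →
      (∀ j : Fin n, (β - η) * n ≤ ((Finset.univ.filter fun i : Fin n => (i, j) ∈ Y).card : ℝ)) →
      (f : ℝ) ≤ (β - η - Real.sqrt (ε / β)) * n →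
      ∀ A B : Finset (Fin n), f * (A.card + B.card) ≤ f * n + (Y.filter fun e => e.1 ∈ A ∧ e.2 ∈ B).card :=
  -- LANDED p129453 (lead c6 wave 2, S2; + `exists_regularFactor_of_mixing`)
  Summit.ValiantsHypothesis.ValiantsHypothesis.Theorems.DivisionGap.PerMultiplesHard.RegularPairFactor.stub_regularPairFactor

/-- **stub_relDenseCompleteClassHard2 — the dense-host complete-class rung, TWO-HOST form, unconditional (NEW, lead c6 wave 2; provable now, size S–M: …
(LANDED p129351; the full docstring — statement in words, proof route, sources — is carried by the tree file referenced in the proof term below; shortened here by lead c6 to keep the workfile under the 200 kB limit.) [folklore] -/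
theorem stub_relDenseCompleteClassHard2 :
    ∀ n ≥ 5, ∀ (G Y₀ Y' : Finset (Fin n × Fin n)) (f : ℕ),
      Y₀ ⊆ G.filter (fun e => ((finRotate n).symm e.1, e.2) ∈ G) → Y' ⊆ Y₀ → 1 ≤ f →
      (∀ i : Fin n, (Finset.univ.filter fun j : Fin n => (i, j) ∈ Y').card = f) →
      (∀ j : Fin n, (Finset.univ.filter fun i : Fin n => (i, j) ∈ Y').card = f) →
      ∀ (β ε : ℝ), 0 < β → β ≤ 1 → 0 ≤ ε → ε ≤ 1 →
      (∀ A B : Finset (Fin n),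
        ((Y₀.filter fun e => e.1 ∈ A ∧ e.2 ∈ B).card : ℝ) ≤ β * A.card * B.card + ε * (n : ℝ) ^ 2) →
      ∀ (t : MvPolynomial (Fin n × Fin n) ℝ≥0) (R C : Fin n → ℕ),
        (∀ m ∈ t.support, (∀ i, ∑ j, m (i, j) = R i) ∧ (∀ j, ∑ i, m (i, j) = C j)) →
        (∀ M : (Fin n × Fin n) →₀ ℕ, M.support ⊆ G →
          (∀ i, ∑ j, M (i, j) = R i) → (∀ j, ∑ i, M (i, j) = C j) → M ∈ t.support) →
        ∑ i, R i = ∑ j, C j → (∀ i j, R i ≤ C j + n ∧ C j ≤ R i + n) → (∀ i, n ^ 2 + 1 ≤ R i) →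
        (f : ℝ) ^ n * (5 : ℝ) ^ (n / 10) ≤
          (complexity ((∑ σ ∈ (Finset.univ : Finset (Equiv.Perm (Fin n))).filter (fun σ => ∀ i, (σ i, i) ∈ G),
              monomial (permMonomial σ) (1 : ℝ≥0)) * t) : ℝ) * (β * n) ^ n * (4 : ℝ) ^ (n / 10) *
            Real.exp (15 * ε * n / β + (Real.log n + 12) / β) :=
  -- LANDED p129351 (lead c6 wave 2, S3; unconditional, helper `probe_of_subhost`)
  Summit.ValiantsHypothesis.ValiantsHypothesis.Theorems.DivisionGap.PerMultiplesHard.RelDenseCompleteClassTwoHost.stub_relDenseCompleteClassHard2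

/-- **stub_typedDecompositionLocal — the typed decomposition with the window measured INSIDE a row set `A` (NEW, lead c6 wave 2; provable now, size M–L: …
(LANDED p129421; the full docstring — statement in words, proof route, sources — is carried by the tree file referenced in the proof term below; shortened here by lead c6 to keep the workfile under the 200 kB limit.) [folklore] -/
theorem stub_typedDecompositionLocal :
    ∀ (n D : ℕ) (A : Finset (Fin n)), 3 ≤ D → D ≤ A.card →
      ∀ (g : MvPolynomial (Fin n × Fin n) ℝ≥0) (R C : Fin n → ℕ),
        (∀ m ∈ g.support, (∀ i, ∑ j, m (i, j) = R i) ∧ (∀ j, ∑ i, m (i, j) = C j)) →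
        (∀ i ∈ A, R i ≠ 0) →
        ∃ s : ℕ, s ≤ complexity g ∧
          ∃ a b : Fin s → MvPolynomial (Fin n × Fin n) ℝ≥0,
            g = ∑ t, a t * b t ∧
            ∀ t, ∃ ρ γ : Fin n → ℕ,
              (∀ m ∈ (a t).support, (∀ i, ∑ j, m (i, j) = ρ i) ∧ (∀ j, ∑ i, m (i, j) = γ j)) ∧
              A.card < D * (A.filter fun i => ρ i ≠ 0).card ∧
              D * (A.filter fun i => ρ i ≠ 0).card ≤ 2 * A.card :=
  -- LANDED p129421 (lead c6 wave 2, S4)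
  Summit.ValiantsHypothesis.ValiantsHypothesis.Theorems.DivisionGap.PerMultiplesHard.TypedDecompositionLocal.stub_typedDecompositionLocal

/-! ### Cycle-6 wave-3/4 stubs (lead c6, the hybrid-probe engine, all LANDED p130231 p130077 p130101 p130296 p130192 p130191 p130781 p130696 p130703): restatements removed by lead c7; modules stay imported. -/

/-! ### Cycle-7 stubs (lead c7; ALL LANDED, restatements removed from the workfile by lead c9 for size — the tree modules stay imported and the
evidence copy of this skeleton of 2026-08-17T02:56Z keeps the in-file copies): `stub_transportation` p132315, `stub_heavyTable` p132436,
`stub_blockSliceParts` p132596, `stub_marginSlice` p132712, `stub_twoBandTableW` p132839, `stub_spreadPatternsRelD` p132928, `stub_relRegularCount` p133095,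
`stub_faceOntoHost` p133330, `stub_blockCompletion` p133419, `stub_blockMargins` p133459, `stub_smallWindowArith` p133456, `stub_eventuallyExp` p133353;
compositions `richHost_of_squareBlock` p134108, `relRegularCompleteClassHard` p134445 (crux NOTES §I). -/


/-! ### Cycle-8 stubs (lead c8; ALL LANDED, restatements removed from the workfile by lead c9 for size — modules imported, evidence copy
2026-08-17T02:56Z keeps them): `stub_codegreeMixing` p136789, `stub_permCounts` p137058, `stub_fewRunsCount` p136806, `stub_columnRunsArith` p137721,
`stub_swapRepair` p137100; composition `stub_orderedFactor` p139129 (kept below, wired by name) and `richHost_of_quasiRandomBlock` p139326 (crux NOTES §J). -/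


/-! ### Cycle 9 (lead c9): the EXTRACTION IS A THEOREM — richness potential + near-tight splits + Hall surplus (extendability) + Szemerédi

WHY `stub_quasiRandomSquareBlock` HOLDS (lead c9; crux NOTES §K).  A block `(A, B)` of a host `G` is σ-square for SOME perfect matching `σ ⊆ G`
iff `G[A, B]` and the COMPLEMENT `G[Aᶜ, Bᶜ]` both have perfect matchings.  If `G` has HALL SURPLUS `s` (`#N(U) ≥ #U + s` for every nonempty row
set `U` with `#U + s ≤ n`; Plummer's `s`-extendability) then EVERY block with `#A = #B ≤ s` has a perfectly matchable complement, so any dense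
ε-regular pair of the regularity lemma, cleaned to minimum degrees, is a quasi-random σ-square block.  If the surplus fails at `U`, the host nearly
splits into `(U, N(U))` and the rest, and the RICHNESS DENSITY `(1/n')·log(#PM/n'!)` of the better part goes UP by `≥ (1/n')·(log C(n',#U) −
log C(#U+s, s)) > 0`; low-degree rows are removed the same way.  So the sub-board MAXIMISING `Φ(R', C') := (log #PM(G[R',C']) − log(n'!))/n' +
log(n')/(32K)` over all σ₀-square sub-boards (`σ₀ ∈ PM(G)`) is `n'/(2048K²)`-extendable with minimum degrees `n'/(4K)` and has `n' ≥ n/K^{32K}`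
(`stub_richPiece`, the lead's composition of `stub_matchingCount` + `stub_matchingGlue`); Szemerédi (`stub_denseRegularPair`, Mathlib's
`szemeredi_regularity`) gives a dense ε-regular balanced pair inside it of size below the extendability scale, `stub_regularPairClean` cleans it to
(H1), (H3) + Hall, `stub_codegreeDeviation` supplies (H2), and `stub_matchingGlue` completes the block matching to `σ ∈ PM(G)`.  The matchings of a
sub-board `(R', C')` are counted INTRINSICALLY as functions `f : Fin n → Fin n` that map `C'` injectively into `R'` inside `G` and fix every column
outside `C'` (`#𝓜(R',C')`; for `(univ, univ)` these are the permutations inside `G`). -/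

/-- **stub_denseRegularPair — one dense ε-regular BALANCED pair from Szemerédi's lemma (NEW, lead c9; provable now from Mathlib's
`szemeredi_regularity`, size M–L).**  For `D, P, Cc ≥ 1` there are `M, N₀` such that every bipartite graph `X ⊆ Fin N × Fin N` (rows `e.1`, columns
`e.2`, `N ≥ N₀`) with `N² ≤ D·#X` contains row and column sets `V, W` of the SAME size `m`, `N/M ≤ m ≤ N/Cc`, with density `e(V,W) ≥ m²/(256D)` and
`1/P`-REGULAR: for all `S ⊆ V`, `T ⊆ W` with `#S ≥ m/P`, `#T ≥ m/P`, `|e(S,T)/(#S#T) − e(V,W)/m²| ≤ 1/P`.  ROUTE.  The simple graph `Γ` on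
`Fin N ⊕ Fin N` with `inl x ∼ inr y ↔ (x,y) ∈ X` has `#X ≥ (2N)²/(4D)` edges.  `szemeredi_regularity Γ (ε₁ := 1/(1024·D·P)) (l := max (⌈4/ε₁⌉₊+1) (4Cc))`
gives an equipartition `𝒫` of `univ` with `l ≤ #parts ≤ bound ε₁ l` that is `ε₁`-uniform.  Ordered adjacent pairs number `2#X ≥ (2N)²/(2D)`; those inside
parts are `≤ (ε₁/2)(2N)²` (`IsEquipartition.card_biUnion_offDiag_le`, needs `4/ε₁ ≤ #parts`), those in non-uniform pairs `< 4ε₁(2N)²`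
(`IsEquipartition.sum_nonUniforms_lt`), those in pairs of edge density `< 1/(16D)` are `≤ (2N)²/(4D)` (`IsEquipartition.card_interedges_sparsePairs_le`);
so some ordered pair of DISTINCT parts `(U, U')` is `ε₁`-uniform (`SimpleGraph.IsUniform`) with `Γ.edgeDensity U U' ≥ 1/(16D)`.  Split `U = U_R ⊔ U_C`,
`U' = U'_R ⊔ U'_C` by the summands: `e_Γ(U,U') = e_X(U_R,U'_C) + e_X(U'_R,U_C)`, so one of them, say `e_X(U_R, U'_C)`, is `≥ #U#U'/(32D)`, forcing
`#U_R ≥ #U/(32D)`, `#U'_C ≥ #U'/(32D)`.  Take ANY `V ⊆ U_R`, `W ⊆ U'_C` of size `m := ⌈#U/(64D)⌉` (parts have sizes `⌊2N/k⌋` or `+1`): `ε₁`-uniformity of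
`(U,U')` applied to `(V, W)` and to `(S, T)` (all of size `≥ ε₁·(#U+1)`) gives density `≥ 1/(16D) − ε₁` and `|d(S,T) − d(V,W)| < 2ε₁ ≤ 1/P`; `m ≤ N/Cc` from
`k ≥ 4Cc`, `m ≥ N/M` with `M := 64·D·bound ε₁ l`.  (The transposed case `e_X(U'_R, U_C)` is symmetric.) [folklore] -/
theorem stub_denseRegularPair :
    ∀ D P Cc : ℕ, 1 ≤ D → 1 ≤ P → 1 ≤ Cc → ∃ M N₀ : ℕ, 1 ≤ M ∧ ∀ N ≥ N₀, ∀ X : Finset (Fin N × Fin N),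
      N ^ 2 ≤ D * X.card →
      ∃ (m : ℕ) (V W : Finset (Fin N)), V.card = m ∧ W.card = m ∧ N ≤ M * m ∧ Cc * m ≤ N ∧
        m * m ≤ 256 * D * (X.filter fun e => e.1 ∈ V ∧ e.2 ∈ W).card ∧
        ∀ S ⊆ V, ∀ T ⊆ W, m ≤ P * S.card → m ≤ P * T.card →
          |(((X.filter fun e => e.1 ∈ S ∧ e.2 ∈ T).card : ℕ) : ℝ) / ((S.card : ℝ) * (T.card : ℝ)) -
            (((X.filter fun e => e.1 ∈ V ∧ e.2 ∈ W).card : ℕ) : ℝ) / ((m : ℝ) * (m : ℝ))| ≤ 1 / (P : ℝ) :=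
  -- LANDED p142053 (lead c9 wave 1)
  Summit.ValiantsHypothesis.ValiantsHypothesis.Theorems.DivisionGap.PerMultiplesHard.DenseRegularPair.stub_denseRegularPair

/-- **stub_regularPairClean — cleaning a dense regular pair to minimum degrees, few low-codegree partners and a perfect matching (NEW, lead c9;
provable now, size M–L; elementary + Mathlib's Hall theorem `Finset.all_card_le_biUnion_card_iff_exists_injective`).**  For `Dd, E ≥ 1` there are
`P₀, m₀` such that: if `(V, W)` (`#V = #W = m ≥ m₀`) has density `p := e(V,W)/m² ≥ 1/Dd` and is `1/P`-regular (`P ≥ P₀`, regularity as in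
`stub_denseRegularPair`), then there are `A ⊆ V`, `B ⊆ W`, `#A = #B = a`, `m ≤ 16a`, with (h1) every row of `A` has `≥ a/(4Dd)` neighbours in `B` and every
column of `B` has `≥ a/(4Dd)` neighbours in `A`; (h3) every `x ∈ A` has at most `a/E` rows `x' ∈ A`, `x' ≠ x`, with `codeg_B(x,x') < a/(64Dd²)`; (pm) an
injection `g : A → B` along edges; (dens) `a² ≤ 2Dd·e(A,B)`; (reg) `(A, B)` is `1/(P/16)`-regular for its own density.  ROUTE (`ε := 1/P`; every "fewer than
`εm` exceptions" below is ONE application of regularity to the exceptional set, which would otherwise be a `≥ m/P`-fraction of density off by more than `ε`):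
`a := m/8`; `W₁ := {y ∈ W : deg_V y ≥ (p−ε)m}` (`#(W∖W₁) < εm`); any `B' ⊆ W₁` with `#B' = a`; `V₂ := {x : deg_{B'} x ≥ (p−ε)a}` (`#(V∖V₂) < εm`); any
`A ⊆ V₂`, `#A = a`; `Bad := {y ∈ B' : deg_A y < (p−ε)a}` (`#Bad < εm`); replace `Bad` inside `B'` by as many columns of `{y ∈ W∖B' : deg_A y ≥ (p−ε)a}`
(which has `≥ m − a − εm` elements) to get `B`.  Then columns of `B` have `deg_A ≥ (p−ε)a`, rows of `A` have `deg_B ≥ (p−ε)a − εm ≥ pa/2` (`P ≥ 64Dd`);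
for `x ∈ A` the set `N_{B'}(x)` has `≥ m/P` elements, so all but `< εm` rows `x'` have `codeg_{B'}(x,x') ≥ (p−ε)²a`, hence `codeg_B ≥ (p−ε)²a − εm ≥ a/(8Dd²)`
(`P ≥ 128Dd²`), and `εm ≤ a/E` (`P ≥ 16E`, `m ≥ m₀`); HALL for `U ⊆ A`: `#U ≤ pa/2` ⇒ `#N_B(U) ≥ deg ≥ #U`; `pa/2 < #U ≤ a − εm` ⇒ `B∖N_B(U)` has `< εm`
elements (regularity against `U`, density `0` vs `p > ε`); `#U > a − εm` ⇒ every `y ∈ B` (degree `(p−ε)a > εm` into `A`) sees `U`, `N_B(U) = B`; density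
and inherited regularity (`16a ≥ m`, reference densities differ by `≤ 1/P`, so `|d(S,T) − d(A,B)| ≤ 2/P ≤ 1/(P/16)`) are immediate. [folklore] -/
theorem stub_regularPairClean :
    ∀ Dd E : ℕ, 1 ≤ Dd → 1 ≤ E → ∃ P₀ m₀ : ℕ, ∀ (N m P : ℕ) (X : Finset (Fin N × Fin N)) (V W : Finset (Fin N)),
      P₀ ≤ P → V.card = m → W.card = m → m₀ ≤ m →
      m * m ≤ Dd * (X.filter fun e => e.1 ∈ V ∧ e.2 ∈ W).card →
      (∀ S ⊆ V, ∀ T ⊆ W, m ≤ P * S.card → m ≤ P * T.card →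
        |(((X.filter fun e => e.1 ∈ S ∧ e.2 ∈ T).card : ℕ) : ℝ) / ((S.card : ℝ) * (T.card : ℝ)) -
          (((X.filter fun e => e.1 ∈ V ∧ e.2 ∈ W).card : ℕ) : ℝ) / ((m : ℝ) * (m : ℝ))| ≤ 1 / (P : ℝ)) →
      ∃ (a : ℕ) (A B : Finset (Fin N)) (g : Fin N → Fin N), A ⊆ V ∧ B ⊆ W ∧ A.card = a ∧ B.card = a ∧ 1 ≤ a ∧ m ≤ 16 * a ∧
        (∀ x ∈ A, a ≤ 4 * Dd * (B.filter fun y => (x, y) ∈ X).card) ∧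
        (∀ y ∈ B, a ≤ 4 * Dd * (A.filter fun x => (x, y) ∈ X).card) ∧
        (∀ x ∈ A, E * (A.filter fun x' => x' ≠ x ∧
            (B.filter fun y => (x, y) ∈ X ∧ (x', y) ∈ X).card < a / (64 * Dd ^ 2)).card ≤ a) ∧
        (∀ x ∈ A, g x ∈ B ∧ (x, g x) ∈ X) ∧ (∀ x ∈ A, ∀ x' ∈ A, g x = g x' → x = x') ∧
        a * a ≤ 2 * Dd * (X.filter fun e => e.1 ∈ A ∧ e.2 ∈ B).card ∧
        (∀ S ⊆ A, ∀ T ⊆ B, a ≤ (P / 16) * S.card → a ≤ (P / 16) * T.card →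
          |(((X.filter fun e => e.1 ∈ S ∧ e.2 ∈ T).card : ℕ) : ℝ) / ((S.card : ℝ) * (T.card : ℝ)) -
            (((X.filter fun e => e.1 ∈ A ∧ e.2 ∈ B).card : ℕ) : ℝ) / ((a : ℝ) * (a : ℝ))| ≤ 1 / ((P / 16 : ℕ) : ℝ)) :=
  -- LANDED p142231 (+Aux p141920) (lead c9 wave 1)
  Summit.ValiantsHypothesis.ValiantsHypothesis.Theorems.DivisionGap.PerMultiplesHard.RegularPairClean.stub_regularPairClean

/-- **stub_codegreeDeviation — ε-regular ⇒ small `ℓ¹` deviations of the 2- and 4-wise row codegrees, i.e. (H2) (NEW, lead c9; provable now, size M–L;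
elementary iterated-neighbourhood counting).**  For `Dd, D₃ ≥ 1` there are `P, a₀` such that every `X' ⊆ Fin a × Fin a` (`a ≥ a₀`) of density
`p := #X'/a² ≥ 1/Dd` that is `1/P`-regular on the full `a`-board (for all row/column sets `S, T` of size `≥ a/P`: `|e(S,T)/(#S#T) − p| ≤ 1/P`) admits
`c₂ := ⌊p²a⌋ ≤ a` (so `#X'² ≤ (c₂+1)·a³`) and `c₄ := ⌊p⁴a⌋` with `Σ_{x≠x'} |codeg(x,x') − c₂| ≤ a³/D₃`, `Σ_{(x₁..x₄) distinct} |#(N x₁ ∩ N x₂ ∩ N x₃ ∩ N x₄) − c₄|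
≤ a⁵/D₃` and `D₃·|c₄ a − c₂²| ≤ a²` (`|c₄a − c₂²| ≤ 3a`).  ROUTE (`ε := 1/P`, `P := 64·D₃·Dd³`).  Regularity applied to an exceptional row set gives: for every
column set `Y` with `#Y ≥ a/P`, fewer than `a/P` rows `x` have `deg_Y x < (p−ε)#Y`, fewer than `a/P` have `deg_Y x > (p+ε)#Y`.  With `Y = univ`: all but
`2a/P` rows have `deg ∈ (p±ε)a`; for such `x`, `Y = N(x)` (`#Y ≥ (p−ε)a ≥ a/P`): all but `2a/P` rows `x'` have `codeg(x,x') = deg_{N x} x' ∈ (p±ε)²a ⊆ p²a ± 3εa`,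
so `|codeg − c₂| ≤ 3εa + 1` on the typical pairs and `≤ a` on the `≤ 4a²/P` atypical ones: total `≤ 7a³/P + a²`.  Depth 4 the same way along the chain
`N x₁ ⊇ N x₁ ∩ N x₂ ⊇ …` (each level keeps size `≥ (p−ε)³a ≥ a/P` and loses `< 2a/P` exceptional rows): typical `|quad − c₄| ≤ 15εa + 1`, atypical
tuples `≤ 8a⁴/P`, total `≤ 23a⁵/P + a⁴`. [folklore] -/
theorem stub_codegreeDeviation :
    ∀ Dd D₃ : ℕ, 1 ≤ Dd → 1 ≤ D₃ → ∃ P a₀ : ℕ, 1 ≤ P ∧ ∀ a ≥ a₀, ∀ X' : Finset (Fin a × Fin a),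
      a * a ≤ Dd * X'.card →
      (∀ S T : Finset (Fin a), a ≤ P * S.card → a ≤ P * T.card →
        |(((X'.filter fun e => e.1 ∈ S ∧ e.2 ∈ T).card : ℕ) : ℝ) / ((S.card : ℝ) * (T.card : ℝ)) -
          ((X'.card : ℕ) : ℝ) / ((a : ℝ) * (a : ℝ))| ≤ 1 / (P : ℝ)) →
      ∃ c₂ c₄ : ℕ, c₂ ≤ a ∧ ((X'.card : ℕ) : ℝ) ^ 2 ≤ ((c₂ : ℝ) + 1) * (a : ℝ) ^ 3 ∧
        (D₃ : ℝ) * (∑ x : Fin a, ∑ x' ∈ Finset.univ.erase x,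
            |(((Finset.univ.filter fun y : Fin a => (x, y) ∈ X' ∧ (x', y) ∈ X').card : ℕ) : ℝ) - c₂|) ≤ (a : ℝ) ^ 3 ∧
        (D₃ : ℝ) * (∑ x₁ : Fin a, ∑ x₂ ∈ Finset.univ.erase x₁, ∑ x₃ ∈ (Finset.univ.erase x₁).erase x₂,
            ∑ x₄ ∈ ((Finset.univ.erase x₁).erase x₂).erase x₃,
            |(((Finset.univ.filter fun y : Fin a =>
                (x₁, y) ∈ X' ∧ (x₂, y) ∈ X' ∧ (x₃, y) ∈ X' ∧ (x₄, y) ∈ X').card : ℕ) : ℝ) - c₄|) ≤ (a : ℝ) ^ 5 ∧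
        (D₃ : ℝ) * |(c₄ : ℝ) * a - (c₂ : ℝ) ^ 2| ≤ (a : ℝ) ^ 2 :=
  -- LANDED p142486 (+Aux p142109) (lead c9 wave 1)
  Summit.ValiantsHypothesis.ValiantsHypothesis.Theorems.DivisionGap.PerMultiplesHard.CodegreeDeviation.stub_codegreeDeviation

/-- **stub_matchingGlue — gluing partial matchings into a perfect matching of the host (NEW, lead c9; provable now, size M; Mathlib's Hall theorem +
`Equiv.ofBijective` / `Finite.injective_iff_bijective`).**  (i) EXTENSION UNDER HALL SURPLUS (Plummer's extendability, bipartite case): `σ₀ ⊆ G` a perfect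
matching with `σ₀(C) = R`; the sub-board `(R, C)` has surplus `s < #R` — every nonempty row set `U ⊆ R` with `#U + s ≤ #R` sees `≥ #U + s` columns of `C`
through `G` —; `A ⊆ R`, `B ⊆ C`, `#A = #B ≤ s`, and `g` an injection of `A` into `B` along cells of `G`.  Then some perfect matching `σ ⊆ G` has
`σ(B) = A` and `σ(C) = R`: Hall holds in `G[R∖A, C∖B]` (for `#U + s ≤ #R`: `#(N(U)∖B) ≥ #U + s − #B ≥ #U`; otherwise a sub-`U'` of size `#R − s ≥ 1` already
sees all of `C`, so `#(C∖B) = #(R∖A) ≥ #U`), giving an injection `R∖A ↪ C∖B` along `G` (a bijection by cardinality); glue its inverse on `C∖B` with `g⁻¹` on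
`B` and `σ₀` on `Cᶜ` — an injective self-map of `Fin n`, hence a permutation.  (ii) THREE-PIECE GLUING: `σ₀` as before, `U ⊆ R`, `S ⊆ C`, `#U = #S`, `f₁` an
injection of `S` into `U` along `G`, `f₂` an injection of `C∖S` into `R∖U` along `G` ⇒ a perfect matching `σ ⊆ G` with `σ(S) = U`, `σ(C) = R`. [folklore] -/
theorem stub_matchingGlue :
    (∀ (n s : ℕ) (G : Finset (Fin n × Fin n)) (R C A B : Finset (Fin n)) (σ₀ : Equiv.Perm (Fin n)) (g : Fin n → Fin n),
      (∀ i, (σ₀ i, i) ∈ G) → (∀ i, σ₀ i ∈ R ↔ i ∈ C) → s < R.card →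
      (∀ U ⊆ R, U.Nonempty → U.card + s ≤ R.card →
        U.card + s ≤ (C.filter fun j => ∃ r ∈ U, (r, j) ∈ G).card) →
      A ⊆ R → B ⊆ C → A.card = B.card → A.card ≤ s →
      (∀ x ∈ A, g x ∈ B ∧ (x, g x) ∈ G) → (∀ x ∈ A, ∀ x' ∈ A, g x = g x' → x = x') →
      ∃ σ : Equiv.Perm (Fin n), (∀ i, (σ i, i) ∈ G) ∧ (∀ i, σ i ∈ A ↔ i ∈ B) ∧ (∀ i, σ i ∈ R ↔ i ∈ C)) ∧
    (∀ (n : ℕ) (G : Finset (Fin n × Fin n)) (R C U S : Finset (Fin n)) (σ₀ : Equiv.Perm (Fin n)) (f₁ f₂ : Fin n → Fin n),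
      (∀ i, (σ₀ i, i) ∈ G) → (∀ i, σ₀ i ∈ R ↔ i ∈ C) → U ⊆ R → S ⊆ C → U.card = S.card →
      (∀ j ∈ S, f₁ j ∈ U ∧ (f₁ j, j) ∈ G) → (∀ j ∈ S, ∀ j' ∈ S, f₁ j = f₁ j' → j = j') →
      (∀ j ∈ C \ S, f₂ j ∈ R \ U ∧ (f₂ j, j) ∈ G) → (∀ j ∈ C \ S, ∀ j' ∈ C \ S, f₂ j = f₂ j' → j = j') →
      ∃ σ : Equiv.Perm (Fin n), (∀ i, (σ i, i) ∈ G) ∧ (∀ i, σ i ∈ U ↔ i ∈ S) ∧ (∀ i, σ i ∈ R ↔ i ∈ C)) :=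
  -- LANDED p141377 (lead c9 wave 1)
  Summit.ValiantsHypothesis.ValiantsHypothesis.Theorems.DivisionGap.PerMultiplesHard.MatchingGlue.stub_matchingGlue

/-- **stub_matchingCount — the fibre inequalities for INTRINSIC matching counts of sub-boards (NEW, lead c9; provable now, size M–L; elementary
`Finset.card` bookkeeping, cf. `stub_permCounts`).**  For `G ⊆ [n]²` and row/column sets `R, C` let `𝓜(R,C)` be the set of functions `f : Fin n → Fin n` that
map `C` injectively into `R` along cells of `G` (`(f j, j) ∈ G`) and FIX every column outside `C` (so `#𝓜(R,C)` = number of perfect matchings of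
`G[R, C]` when `#R = #C`).  (a) `#PM(G) ≤ #𝓜(univ, univ)` (`σ ↦ ⇑σ` is injective).  (b) SPLIT: `U ⊆ R`, `#R = #C`, `NU := {j ∈ C : ∃ r ∈ U, (r,j) ∈ G}`: for some
`S ⊆ C` with `#S = #U`, `#𝓜(R,C) ≤ C(#NU, #U) · #𝓜(U,S) · #𝓜(R∖U, C∖S)` — fibre `𝓜(R,C)` over `S_f := {j ∈ C : f j ∈ U}` (a `#U`-subset of `NU`, since
`f|_C` is a bijection onto `R ⊇ U`), and inject the fibre into `𝓜(U,S) × 𝓜(R∖U,C∖S)` by `f ↦ (f on S / id elsewhere, f on C∖S / id elsewhere)`; take the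
largest fibre (any `S` if `𝓜(R,C) = ∅`).  (c) ROW REMOVAL: `x ∈ R`, `#R = #C`: for some `y ∈ C` with `(x,y) ∈ G` (or `𝓜(R,C) = ∅`),
`#𝓜(R,C) ≤ deg_C(x) · #𝓜(R∖x, C∖y)` — fibre over the column sent to `x`, inject by `f ↦ f[y ↦ y]`.  (d) COLUMN REMOVAL: `y ∈ C`: for some `x ∈ R` with
`(x,y) ∈ G` (or `𝓜 = ∅`), `#𝓜(R,C) ≤ deg_R(y) · #𝓜(R∖x, C∖y)` — fibre over `f y`.  (e) `#𝓜(R,C) ≤ (#C)!` when `#R = #C` ((d) and induction; `𝓜(∅,∅) = {id}`).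
[folklore] -/
theorem stub_matchingCount :
    (∀ (n : ℕ) (G : Finset (Fin n × Fin n)),
      ((Finset.univ : Finset (Equiv.Perm (Fin n))).filter (fun σ => ∀ i, (σ i, i) ∈ G)).card ≤
        ((Finset.univ : Finset (Fin n → Fin n)).filter fun f =>
          (∀ j ∈ (Finset.univ : Finset (Fin n)), f j ∈ (Finset.univ : Finset (Fin n)) ∧ (f j, j) ∈ G) ∧
          (∀ j, j ∉ (Finset.univ : Finset (Fin n)) → f j = j) ∧
          (∀ j ∈ (Finset.univ : Finset (Fin n)), ∀ j' ∈ (Finset.univ : Finset (Fin n)), f j = f j' → j = j')).card) ∧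
    (∀ (n : ℕ) (G : Finset (Fin n × Fin n)) (R C U : Finset (Fin n)), U ⊆ R → R.card = C.card →
      ∃ S ⊆ C, S.card = U.card ∧
        ((Finset.univ : Finset (Fin n → Fin n)).filter fun f =>
          (∀ j ∈ C, f j ∈ R ∧ (f j, j) ∈ G) ∧ (∀ j, j ∉ C → f j = j) ∧
          (∀ j ∈ C, ∀ j' ∈ C, f j = f j' → j = j')).card ≤
        (C.filter fun j => ∃ r ∈ U, (r, j) ∈ G).card.choose U.card *
          (((Finset.univ : Finset (Fin n → Fin n)).filter fun f =>
              (∀ j ∈ S, f j ∈ U ∧ (f j, j) ∈ G) ∧ (∀ j, j ∉ S → f j = j) ∧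
              (∀ j ∈ S, ∀ j' ∈ S, f j = f j' → j = j')).card *
           ((Finset.univ : Finset (Fin n → Fin n)).filter fun f =>
              (∀ j ∈ C \ S, f j ∈ R \ U ∧ (f j, j) ∈ G) ∧ (∀ j, j ∉ C \ S → f j = j) ∧
              (∀ j ∈ C \ S, ∀ j' ∈ C \ S, f j = f j' → j = j')).card)) ∧
    (∀ (n : ℕ) (G : Finset (Fin n × Fin n)) (R C : Finset (Fin n)) (x : Fin n), x ∈ R → R.card = C.card →
      ∃ y ∈ C, ((x, y) ∈ G ∨
          ((Finset.univ : Finset (Fin n → Fin n)).filter fun f =>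
            (∀ j ∈ C, f j ∈ R ∧ (f j, j) ∈ G) ∧ (∀ j, j ∉ C → f j = j) ∧
            (∀ j ∈ C, ∀ j' ∈ C, f j = f j' → j = j')).card = 0) ∧
        ((Finset.univ : Finset (Fin n → Fin n)).filter fun f =>
          (∀ j ∈ C, f j ∈ R ∧ (f j, j) ∈ G) ∧ (∀ j, j ∉ C → f j = j) ∧
          (∀ j ∈ C, ∀ j' ∈ C, f j = f j' → j = j')).card ≤
        (C.filter fun j => (x, j) ∈ G).card *
          ((Finset.univ : Finset (Fin n → Fin n)).filter fun f =>
            (∀ j ∈ C.erase y, f j ∈ R.erase x ∧ (f j, j) ∈ G) ∧ (∀ j, j ∉ C.erase y → f j = j) ∧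
            (∀ j ∈ C.erase y, ∀ j' ∈ C.erase y, f j = f j' → j = j')).card) ∧
    (∀ (n : ℕ) (G : Finset (Fin n × Fin n)) (R C : Finset (Fin n)) (y : Fin n), y ∈ C → R.card = C.card →
      ∃ x ∈ R, ((x, y) ∈ G ∨
          ((Finset.univ : Finset (Fin n → Fin n)).filter fun f =>
            (∀ j ∈ C, f j ∈ R ∧ (f j, j) ∈ G) ∧ (∀ j, j ∉ C → f j = j) ∧
            (∀ j ∈ C, ∀ j' ∈ C, f j = f j' → j = j')).card = 0) ∧
        ((Finset.univ : Finset (Fin n → Fin n)).filter fun f =>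
          (∀ j ∈ C, f j ∈ R ∧ (f j, j) ∈ G) ∧ (∀ j, j ∉ C → f j = j) ∧
          (∀ j ∈ C, ∀ j' ∈ C, f j = f j' → j = j')).card ≤
        (R.filter fun i => (i, y) ∈ G).card *
          ((Finset.univ : Finset (Fin n → Fin n)).filter fun f =>
            (∀ j ∈ C.erase y, f j ∈ R.erase x ∧ (f j, j) ∈ G) ∧ (∀ j, j ∉ C.erase y → f j = j) ∧
            (∀ j ∈ C.erase y, ∀ j' ∈ C.erase y, f j = f j' → j = j')).card) ∧
    (∀ (n : ℕ) (G : Finset (Fin n × Fin n)) (R C : Finset (Fin n)), R.card = C.card →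
      ((Finset.univ : Finset (Fin n → Fin n)).filter fun f =>
          (∀ j ∈ C, f j ∈ R ∧ (f j, j) ∈ G) ∧ (∀ j, j ∉ C → f j = j) ∧
          (∀ j ∈ C, ∀ j' ∈ C, f j = f j' → j = j')).card ≤ C.card.factorial) :=
  -- LANDED p141817 (lead c9 wave 1)
  Summit.ValiantsHypothesis.ValiantsHypothesis.Theorems.DivisionGap.PerMultiplesHard.MatchingCount.stub_matchingCount


/-- **stub_quasiRandomSquareBlock — the EXTRACTION TARGET (lead c8) is a THEOREM (lead c9, LANDED p144798: `stub_richPiece` (extremal σ₀-square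
sub-board: linear, min degrees `n'/(4K)`, Hall surplus `n'/(2048K²)`; p144228) → `stub_denseRegularPair` → `stub_regularPairClean` → transport to the `a`-board →
`stub_codegreeDeviation` → `stub_matchingGlue` (i); see the cycle-9 section above and crux NOTES §K).**  For every richness scale `K` there are DENSITY constants `D₁, D₂` (depending on
`K` only) such that for every requested PRECISION `D₃, E` there are `Cf, n₀` with: every rich host `G ⊆ [n]²` (`n! ≤ K^n·#PM(G)`, `n ≥ n₀`) contains a
σ-SQUARE BLOCK — a perfect matching `σ ⊆ G`, `A × B` with `σ(B) = A`, `#A = a ≥ n/Cf`, enumerations `eA, eB`, transported host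
`X = {(x,y) : (eA x, eB y) ∈ G}` on the `a`-board — which is QUASI-RANDOM WITH MINIMUM DEGREES: (H1) every row and every column of `X` has
`≥ a/D₁` cells; (H2) for some typical codegree `c₂` (`a/D₂ ≤ c₂ ≤ a`) and typical 4-wise row intersection `c₄` with `|c₄·a − c₂²| ≤ a²/D₃`, the
`ℓ¹` deviations `Σ_{x≠x'} |codeg(x,x') − c₂| ≤ a³/D₃` and `Σ_{(x₁..x₄) distinct} |#(N(x₁)∩N(x₂)∩N(x₃)∩N(x₄)) − c₄| ≤ a⁵/D₃`; (H3) every row `x` has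
at most `a/E` rows `y ≠ x` of codegree `< a/D₂`.  (By `stub_orderedFactor` such a block carries a cyclic order with a linear regular factor in
`X ∩ ζX`, i.e. c7's `stub_richSquareBlock`; the precision the factor needs is polynomial in `D₁, D₂`.)  KNOWN (all with a COMPLETE block, `c₂ = c₄ = a`,
zero deviations): `G = K` (`a = n`); block sums `⊕ K_{b,b}` (one block); blow-ups `C_{2k} ⊗ J` (a class, carried by a TYPICAL matching); Ferrers
boards (top rows × the columns an anti-diagonal matching gives them); circulant bands `{(i−j) mod n ∈ [0,w)}` (an interval of `w/2` rows × its
shift by `w/2`, carried by the matching `j ↦ j + w/2`); quasi-random `G` of density `p` (`a = n`, `c₂ ≈ p²n`, `c₄ ≈ p⁴n`, deviations `O(n^{5/2})`,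
`O(n^{9/2})`).  WHY IT MIGHT FAIL: richness is only "linear degrees + many matchings" (every `βn`-regular bipartite graph is rich), so the target
asserts that EVERY dense bipartite graph with `n!K^{−n}` perfect matchings has a linear quasi-random σ-square block; a host all of whose typical
matchings shred every quasi-random pair (the slicing phenomenon of crux NOTES §I4/§J2, realised hereditarily at every linear scale) would refute
it — none is known, and the permanental-measure analysis of §J3 (near-closed classes of the PM-average matrix live at the spread scale `≥ n/M(K)`)
says where to look.  Cheapest search (fix DENSITY, not richness, at small `n`: `n!·4^{−n}` matchings allow average degree `< 2` for `n ≤ 20`): `n ≤ 16`, minimum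
degree `≥ n/2`, minimise over `(π ∈ PM(G), A)`, `#A ≥ n/3`, the codegree spread of `G[A, π(A)]` inside `π(A)`. [folklore] -/
theorem stub_quasiRandomSquareBlock :
    ∀ K : ℕ, 1 ≤ K → ∃ D₁ D₂ : ℕ, 1 ≤ D₁ ∧ 1 ≤ D₂ ∧ ∀ D₃ E : ℕ, 1 ≤ D₃ → 1 ≤ E →
      ∃ Cf n₀ : ℕ, 1 ≤ Cf ∧ ∀ n ≥ n₀, ∀ G : Finset (Fin n × Fin n),
      n.factorial ≤ K ^ n * ((Finset.univ : Finset (Equiv.Perm (Fin n))).filter (fun σ => ∀ i, (σ i, i) ∈ G)).card →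
      ∃ (a : ℕ) (A B : Finset (Fin n)) (eA : Fin a ≃ {x // x ∈ A}) (eB : Fin a ≃ {x // x ∈ B})
        (σ : Equiv.Perm (Fin n)) (X : Finset (Fin a × Fin a)) (c₂ c₄ : ℕ),
        n ≤ Cf * a ∧ (∀ i, (σ i, i) ∈ G) ∧ (∀ i, σ i ∈ A ↔ i ∈ B) ∧
        (∀ e : Fin a × Fin a, e ∈ X ↔ ((eA e.1 : Fin n), (eB e.2 : Fin n)) ∈ G) ∧
        (∀ x : Fin a, a ≤ D₁ * (Finset.univ.filter fun y : Fin a => (x, y) ∈ X).card) ∧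
        (∀ y : Fin a, a ≤ D₁ * (Finset.univ.filter fun x : Fin a => (x, y) ∈ X).card) ∧
        a ≤ D₂ * c₂ ∧ c₂ ≤ a ∧
        (D₃ : ℝ) * (∑ x : Fin a, ∑ x' ∈ Finset.univ.erase x,
            |(((Finset.univ.filter fun y : Fin a => (x, y) ∈ X ∧ (x', y) ∈ X).card : ℕ) : ℝ) - c₂|) ≤ (a : ℝ) ^ 3 ∧
        (D₃ : ℝ) * (∑ x₁ : Fin a, ∑ x₂ ∈ Finset.univ.erase x₁, ∑ x₃ ∈ (Finset.univ.erase x₁).erase x₂,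
            ∑ x₄ ∈ ((Finset.univ.erase x₁).erase x₂).erase x₃,
            |(((Finset.univ.filter fun y : Fin a =>
                (x₁, y) ∈ X ∧ (x₂, y) ∈ X ∧ (x₃, y) ∈ X ∧ (x₄, y) ∈ X).card : ℕ) : ℝ) - c₄|) ≤ (a : ℝ) ^ 5 ∧
        (D₃ : ℝ) * |(c₄ : ℝ) * a - (c₂ : ℝ) ^ 2| ≤ (a : ℝ) ^ 2 ∧
        (∀ x : Fin a, E * (Finset.univ.filter fun y : Fin a => y ≠ x ∧
            (Finset.univ.filter fun z : Fin a => (x, z) ∈ X ∧ (y, z) ∈ X).card < a / D₂).card ≤ a) :=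
  -- LANDED p144798 (lead c9: `quasiRandomSquareBlock_of_richPiece` ∘ `RichPiece.stub_richPiece` p144228 ∘ p143745 ∘ p143491, on the wave-1 stubs)
  Summit.ValiantsHypothesis.ValiantsHypothesis.Theorems.DivisionGap.PerMultiplesHard.Extraction.stub_quasiRandomSquareBlock

/-! ### Cycle 8 (lead c8): the ORDERED-FACTOR composition — LANDED as five Theorems files (p138655 `…OrderedFactorCounts`, p138749
`…OrderedFactorFirstMoment`, p139015 `…OrderedFactorPerturb`, p139129 `…OrderedFactor` = `stub_orderedFactor`, p139326 `…OrderedFactorRichHost` =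
`richHost_of_quasiRandomBlock`); the development copy `work/OrderedFactor.lean` of the lead's folder is the readable version with named statistics. -/

/-- **stub_orderedFactor — a quasi-random block has a cyclic order whose shifted intersection carries a linear regular factor (NEW, lead c8;
HELD BY THE LEAD — it is the COMPOSITION of `stub_permCounts`, `stub_fewRunsCount`, `stub_columnRunsArith` (first moment over the `a!` orders:
some `ρ` has `≤ 8·mean` bad consecutive pairs, `≤ 8·mean` 2- and 4-wise deviation sums along the order, and NO column with fewer than `a/(64D₁⁴)`
consecutive pairs inside its neighbourhood), `stub_swapRepair` (no bad pair left; `≤ 32·mean` consecutive pairs changed, so every statistic moves by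
`O(a/E)` per unit), `stub_codegreeMixing` (lower mixing of `H = X^ρ ∩ ζX^ρ` with `β = c₂/a`, `ε = √(O(1/D₃ + 1/E + 1/a))`) and the tree's
`stub_regularPairFactor` + `stub_regularFactor` (minimum degrees `a/D₂` for rows, `a/(64D₁⁴) − O(a/E)` for columns); not a worker stub).**
For all `D₁, D₂ ≥ 1` there are `D₃, E, Cf, a₀` (polynomial in `D₁, D₂`) such that every `X ⊆ Fin a × Fin a` (`a ≥ a₀`) with (H1)–(H3) of
`stub_quasiRandomSquareBlock` at these parameters has an order `ρ ∈ Perm(Fin a)` and an `f`-regular `Y'` (`f ≥ 1`, `a ≤ Cf·f`) inside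
`{(k, y) : (ρ k, y) ∈ X ∧ (ρ(k−1), y) ∈ X}`. [folklore] -/
theorem stub_orderedFactor :
    ∀ D₁ D₂ : ℕ, 1 ≤ D₁ → 1 ≤ D₂ → ∃ D₃ E Cf a₀ : ℕ, 1 ≤ D₃ ∧ 1 ≤ E ∧ 1 ≤ Cf ∧
      ∀ a ≥ a₀, ∀ (X : Finset (Fin a × Fin a)) (c₂ c₄ : ℕ),
        (∀ x : Fin a, a ≤ D₁ * (Finset.univ.filter fun y : Fin a => (x, y) ∈ X).card) →
        (∀ y : Fin a, a ≤ D₁ * (Finset.univ.filter fun x : Fin a => (x, y) ∈ X).card) →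
        a ≤ D₂ * c₂ → c₂ ≤ a →
        (D₃ : ℝ) * (∑ x : Fin a, ∑ x' ∈ Finset.univ.erase x,
            |(((Finset.univ.filter fun y : Fin a => (x, y) ∈ X ∧ (x', y) ∈ X).card : ℕ) : ℝ) - c₂|) ≤ (a : ℝ) ^ 3 →
        (D₃ : ℝ) * (∑ x₁ : Fin a, ∑ x₂ ∈ Finset.univ.erase x₁, ∑ x₃ ∈ (Finset.univ.erase x₁).erase x₂,
            ∑ x₄ ∈ ((Finset.univ.erase x₁).erase x₂).erase x₃,
            |(((Finset.univ.filter fun y : Fin a =>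
                (x₁, y) ∈ X ∧ (x₂, y) ∈ X ∧ (x₃, y) ∈ X ∧ (x₄, y) ∈ X).card : ℕ) : ℝ) - c₄|) ≤ (a : ℝ) ^ 5 →
        (D₃ : ℝ) * |(c₄ : ℝ) * a - (c₂ : ℝ) ^ 2| ≤ (a : ℝ) ^ 2 →
        (∀ x : Fin a, E * (Finset.univ.filter fun y : Fin a => y ≠ x ∧
            (Finset.univ.filter fun z : Fin a => (x, z) ∈ X ∧ (y, z) ∈ X).card < a / D₂).card ≤ a) →
        ∃ (ρ : Equiv.Perm (Fin a)) (Y' : Finset (Fin a × Fin a)) (f : ℕ), 1 ≤ f ∧ a ≤ Cf * f ∧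
          Y' ⊆ Finset.univ.filter (fun e : Fin a × Fin a =>
            (ρ e.1, e.2) ∈ X ∧ (ρ ((finRotate a).symm e.1), e.2) ∈ X) ∧
          (∀ x : Fin a, (Finset.univ.filter fun y : Fin a => (x, y) ∈ Y').card = f) ∧
          (∀ y : Fin a, (Finset.univ.filter fun x : Fin a => (x, y) ∈ Y').card = f) :=
  -- LANDED p139129 (lead c8: composition of the five cycle-8 stubs)
  Summit.ValiantsHypothesis.ValiantsHypothesis.Theorems.DivisionGap.PerMultiplesHard.OrderedFactor.stub_orderedFactor

/-- **stub_richSquareBlock — c7's STRUCTURE TARGET, now PROVED in-file (lead c8) as `stub_quasiRandomSquareBlock` ∘ `stub_orderedFactor` (the new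
enumeration of `A` is `ρ.trans eA`: position `k` carries the row `eA (ρ k)`).**  For every richness scale `K` there are `Cf, n₀` such that every
RICH host `G ⊆ [n]²` (`n! ≤ K^n · #PM(G)`, `n ≥ n₀`) has a σ-SQUARE BLOCK with a good cyclic order: a perfect matching `σ` inside `G`, a block
`A × B` with `σ(B) = A` of linear size `a ≥ n/Cf`, enumerations `eA, eB : Fin a ≃ A, B` (the cyclic order on `A` is `eA ∘ finRotate ∘ eA⁻¹`), and an
`f`-REGULAR `Y'` on the `a`-board, `f ≥ a/Cf`, every cell of which lies in the transported block host `X = {(x,y) : (eA x, eB y) ∈ G}` TOGETHER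
WITH its shift `((finRotate a)⁻¹ x, y)`.  Consumed by `richHostCompleteClassHard` through the tree's `richHost_of_squareBlock` (p134108).
WHY IT MIGHT FAIL: only with `stub_quasiRandomSquareBlock`. [folklore] -/
theorem stub_richSquareBlock :
    ∀ K : ℕ, 1 ≤ K → ∃ Cf n₀ : ℕ, 1 ≤ Cf ∧ ∀ n ≥ n₀, ∀ G : Finset (Fin n × Fin n),
      n.factorial ≤ K ^ n * pmCount G →
      ∃ (a : ℕ) (A B : Finset (Fin n)) (eA : Fin a ≃ {x // x ∈ A}) (eB : Fin a ≃ {x // x ∈ B})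
        (σ : Equiv.Perm (Fin n)) (Y' : Finset (Fin a × Fin a)) (f : ℕ),
        n ≤ Cf * a ∧ (∀ i, (σ i, i) ∈ G) ∧ (∀ i, σ i ∈ A ↔ i ∈ B) ∧ 1 ≤ f ∧ a ≤ Cf * f ∧
        (∀ e ∈ Y', ((eA e.1 : Fin n), (eB e.2 : Fin n)) ∈ G ∧
          ((eA ((finRotate a).symm e.1) : Fin n), (eB e.2 : Fin n)) ∈ G) ∧
        (∀ x : Fin a, (Finset.univ.filter fun y : Fin a => (x, y) ∈ Y').card = f) ∧
        (∀ y : Fin a, (Finset.univ.filter fun x : Fin a => (x, y) ∈ Y').card = f) := by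
  intro K hK
  obtain ⟨D₁, D₂, hD₁, hD₂, hX⟩ := stub_quasiRandomSquareBlock K hK
  obtain ⟨D₃, E, Cf', a₀, hD₃, hE, hCf', hOF⟩ := stub_orderedFactor D₁ D₂ hD₁ hD₂
  obtain ⟨Cf, n₀, hCf, hG⟩ := hX D₃ E hD₃ hE
  refine ⟨Cf * Cf', n₀ + Cf * a₀, le_trans hCf (Nat.le_mul_of_pos_right _ hCf'), ?_⟩
  intro n hn G hrich
  obtain ⟨a, A, B, eA, eB, σ, X, c₂, c₄, hna, hσG, hσAB, hXG, hr, hc, hc₂, hc₂a, hdev₂, hdev₄, hc₄, hbad⟩ :=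
    hG n (by omega) G hrich
  have ha₀ : a₀ ≤ a := by
    by_contra h
    have h1 : Cf * a < Cf * a₀ := Nat.mul_lt_mul_of_pos_left (lt_of_not_ge h) hCf
    omega
  obtain ⟨ρ, Y', f, hf1, haf, hY'H, hYrow, hYcol⟩ := hOF a ha₀ X c₂ c₄ hr hc hc₂ hc₂a hdev₂ hdev₄ hc₄ hbad
  refine ⟨a, A, B, ρ.trans eA, eB, σ, Y', f, ?_, hσG, hσAB, hf1, ?_, ?_, hYrow, hYcol⟩
  · calc n ≤ Cf * a := hna
      _ ≤ Cf * Cf' * a := by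
          rw [Nat.mul_assoc]; exact Nat.mul_le_mul_left _ (Nat.le_mul_of_pos_left _ hCf')
  · calc a ≤ Cf' * f := haf
      _ ≤ Cf * Cf' * f := by
          rw [Nat.mul_assoc]; exact Nat.le_mul_of_pos_left _ hCf
  · intro e he
    have hmem := (Finset.mem_filter.mp (hY'H he)).2
    exact ⟨(hXG _).mp hmem.1, (hXG _).mp hmem.2⟩



/-! ### The spread engines (LANDED, lead c2 cycle 2: `Theorems/DivisionGapPerMultiplesHardSpreadPatterns.lean` p108487 and
`Theorems/DivisionGapPerMultiplesHardZSpreadPatterns.lean` p108483; the compositions of lead c1 are now imported by name) -/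

/-- **The spread engine** (`spreadPatterns`; composition of `stub_typedDecompositionFifth` + `stub_spreadRigidityGen`, LANDED p108487):
for `n ≥ 5`, a fixed row shift `ζ` and a torus-homogeneous `g` with all rows hit, `spreadCount ζ g · 5^{⌊n/10⌋} ≤ L(g) · 4^{⌊n/10⌋} · n!`.
[cite: JerrumSnir1982, §3–4; Jukna2023, L.3.1] -/
theorem spreadPatterns :
    ∀ n ≥ 5, ∀ (ζ : Equiv.Perm (Fin n)) (g : MvPolynomial (Fin n × Fin n) ℝ≥0) (R C : Fin n → ℕ),
      (∀ m ∈ g.support, (∀ i, ∑ j, m (i, j) = R i) ∧ (∀ j, ∑ i, m (i, j) = C j)) →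
      (∀ i, R i ≠ 0) →
      spreadCount ζ g * 5 ^ (n / 10) ≤ complexity g * (4 ^ (n / 10) * n.factorial) := by
  intro n hn ζ g R C hg hR
  classical
  have h := Summit.ValiantsHypothesis.ValiantsHypothesis.Theorems.DivisionGap.PerMultiplesHard.SpreadPatterns.spreadPatterns
    n hn ζ g R C hg hR
  unfold spreadCount IsSpreadProbe
  convert h

/-- **The transposed spread engine** (`spreadPatternsCol`, LANDED p108487): columns hit, column probes. [folklore] -/
theorem spreadPatternsCol :
    ∀ n ≥ 5, ∀ (ζ : Equiv.Perm (Fin n)) (g : MvPolynomial (Fin n × Fin n) ℝ≥0) (R C : Fin n → ℕ),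
      (∀ m ∈ g.support, (∀ i, ∑ j, m (i, j) = R i) ∧ (∀ j, ∑ i, m (i, j) = C j)) →
      (∀ j, C j ≠ 0) →
      colSpreadCount ζ g * 5 ^ (n / 10) ≤ complexity g * (4 ^ (n / 10) * n.factorial) := by
  intro n hn ζ g R C hg hC
  classical
  have h := Summit.ValiantsHypothesis.ValiantsHypothesis.Theorems.DivisionGap.PerMultiplesHard.SpreadPatterns.spreadPatternsCol
    n hn ζ g R C hg hC
  unfold colSpreadCount IsColSpreadProbe
  convert h

/-- **The k-cell spread engine** (`zSpreadPatterns`; composition of `stub_typedDecompositionWindow` + `stub_zRigidity`, LANDED p108483):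
`zCount Z g · 3^{⌊n/(3k²)⌋} ≤ L(g) · 2^{⌊n/(3k²)⌋} · n!` for `#Z = k ≥ 1`, `3k ≤ n`. [folklore] -/
theorem zSpreadPatterns :
    ∀ (n k : ℕ) (Z : Finset (Equiv.Perm (Fin n))), Z.card = k → 1 ≤ k → 3 * k ≤ n →
      ∀ (g : MvPolynomial (Fin n × Fin n) ℝ≥0) (R C : Fin n → ℕ),
        (∀ m ∈ g.support, (∀ i, ∑ j, m (i, j) = R i) ∧ (∀ j, ∑ i, m (i, j) = C j)) → (∀ i, R i ≠ 0) →
        zCount Z g * 3 ^ (n / (3 * k ^ 2)) ≤ complexity g * (2 ^ (n / (3 * k ^ 2)) * n.factorial) := by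
  intro n k Z hZ hk hkn g R C hg hR
  classical
  have h := Summit.ValiantsHypothesis.ValiantsHypothesis.Theorems.DivisionGap.PerMultiplesHard.ZSpreadPatterns.zSpreadPatterns
    n k Z hZ hk hkn g R C hg hR
  unfold zCount IsZProbe
  convert h

/-- **The transposed k-cell engine** (`zSpreadPatternsCol`, LANDED p108483). [folklore] -/
theorem zSpreadPatternsCol :
    ∀ (n k : ℕ) (Z : Finset (Equiv.Perm (Fin n))), Z.card = k → 1 ≤ k → 3 * k ≤ n →
      ∀ (g : MvPolynomial (Fin n × Fin n) ℝ≥0) (R C : Fin n → ℕ),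
        (∀ m ∈ g.support, (∀ i, ∑ j, m (i, j) = R i) ∧ (∀ j, ∑ i, m (i, j) = C j)) → (∀ j, C j ≠ 0) →
        colZCount Z g * 3 ^ (n / (3 * k ^ 2)) ≤ complexity g * (2 ^ (n / (3 * k ^ 2)) * n.factorial) := by
  intro n k Z hZ hk hkn g R C hg hC
  classical
  have h := Summit.ValiantsHypothesis.ValiantsHypothesis.Theorems.DivisionGap.PerMultiplesHard.ZSpreadPatterns.zSpreadPatternsCol
    n k Z hZ hk hkn g R C hg hC
  unfold colZCount IsColZProbe
  convert h

/-! ### The typed vertex count (LANDED: `Theorems/DivisionGapPerMultiplesHardThinPatterns.lean`, p91347) -/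

/-- **thinPatterns (the second jaw)** — now the tree theorem
`…Theorems.DivisionGap.PerMultiplesHard.ThinPatterns.thinPatterns` (stub_typedDecomposition +
stub_alignedRigidity + the counting lemma), read back in the line's vocabulary. -/
theorem thinPatterns :
    ∀ n ≥ 3, ∀ (g : MvPolynomial (Fin n × Fin n) ℝ≥0) (R C : Fin n → ℕ),
      (∀ m ∈ g.support, (∀ i, ∑ j, m (i, j) = R i) ∧ (∀ j, ∑ i, m (i, j) = C j)) →
      (∀ i, R i ≠ 0) →
      pureCount g ≤ complexity g * typeK n *
        Finset.univ.sup (fun π : Equiv.Perm (Fin n) => pureCountAt g π) :=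
  Summit.ValiantsHypothesis.ValiantsHypothesis.Theorems.DivisionGap.PerMultiplesHard.ThinPatterns.thinPatterns

/-! ### Sorry-free glue lemmas -/

/-- **Quasi-polynomial absorption**: for all `c, κ` there is `d` with
`((n+2)·(2^{(log₂ n + c)^c} + 3))^κ ≤ 2^{(log₂ n + d)^d}` for every `n` (take `d = κ + c + 5`).
[folklore] -/
theorem qp_absorb (c κ : ℕ) : ∃ d : ℕ, ∀ n : ℕ,
    ((n + 2) * (2 ^ ((Nat.log 2 n + c) ^ c) + 3)) ^ κ ≤ 2 ^ ((Nat.log 2 n + d) ^ d) := by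
  refine ⟨κ + c + 5, fun n => ?_⟩
  set L := Nat.log 2 n with hL
  set B := (L + c) ^ c with hB
  set D := κ + c + 5 with hD
  have hB1 : 1 ≤ B := by
    rcases Nat.eq_zero_or_pos c with hc | hc
    · simp [hB, hc]
    · exact Nat.one_le_iff_ne_zero.mpr (pow_ne_zero _ (by omega))
  -- `n + 2 ≤ 2^(L+2)`
  have hn : n + 2 ≤ 2 ^ (L + 2) := by
    have h1 : n < 2 ^ (L + 1) := Nat.lt_pow_succ_log_self one_lt_two n
    have h2 : 1 ≤ 2 ^ (L + 1) := Nat.one_le_two_pow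
    have h3 : 2 ^ (L + 2) = 2 ^ (L + 1) * 2 := pow_succ 2 (L + 1)
    omega
  -- `2^B + 3 ≤ 2^(B+2)`
  have hb : 2 ^ B + 3 ≤ 2 ^ (B + 2) := by
    have h1 : 1 ≤ 2 ^ B := Nat.one_le_two_pow
    have h2 : 2 ^ (B + 2) = 2 ^ B * 2 ^ 2 := pow_add 2 B 2
    omega
  have hprod : (n + 2) * (2 ^ B + 3) ≤ 2 ^ (L + B + 4) := by
    calc (n + 2) * (2 ^ B + 3) ≤ 2 ^ (L + 2) * 2 ^ (B + 2) := Nat.mul_le_mul hn hb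
      _ = 2 ^ (L + B + 4) := by rw [← pow_add]; ring_nf
  have hpow : ((n + 2) * (2 ^ B + 3)) ^ κ ≤ 2 ^ ((L + B + 4) * κ) := by
    calc ((n + 2) * (2 ^ B + 3)) ^ κ ≤ (2 ^ (L + B + 4)) ^ κ := Nat.pow_le_pow_left hprod κ
      _ = 2 ^ ((L + B + 4) * κ) := by rw [← pow_mul]
  -- exponent comparison `(L + B + 4) κ ≤ (L + D)^D`
  have hE1 : L + B + 4 ≤ B * (L + 5) := by nlinarith [hB1]
  have hLD : 1 ≤ L + D := by omega
  have hE2 : (L + B + 4) * κ ≤ (L + D) ^ D := by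
    calc (L + B + 4) * κ ≤ B * (L + 5) * κ := Nat.mul_le_mul_right κ hE1
      _ ≤ (L + D) ^ c * (L + D) * (L + D) := by
          apply Nat.mul_le_mul (Nat.mul_le_mul ?_ ?_) ?_
          · exact Nat.pow_le_pow_left (by omega) c
          · omega
          · omega
      _ = (L + D) ^ (c + 2) := by ring
      _ ≤ (L + D) ^ D := Nat.pow_le_pow_right hLD (by omega)
  calc ((n + 2) * (2 ^ B + 3)) ^ κ ≤ 2 ^ ((L + B + 4) * κ) := hpow
    _ ≤ 2 ^ ((L + D) ^ D) := Nat.pow_le_pow_right two_pos hE2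

/-- **Concentration is absurd at level `B`**: `B + 3 ≤ m`, `L ≤ 2^B` and `m (2^{m-1} - 1) ≤ 2 L + 2` cannot hold
together (`2^{m-1} ≥ 4 · 2^B` and `m ≥ 3`). [folklore] -/
theorem conc_absurd {m B L : ℕ} (hm : B + 3 ≤ m) (hL : L ≤ 2 ^ B)
    (h : m * (2 ^ (m - 1) - 1) ≤ 2 * L + 2) : False := by
  have hP : 2 ^ (B + 2) ≤ 2 ^ (m - 1) := Nat.pow_le_pow_right two_pos (by omega)
  have hP4 : 2 ^ (B + 2) = 2 ^ B * 4 := by rw [pow_add]; norm_num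
  have hQ : 1 ≤ 2 ^ B := Nat.one_le_two_pow
  have h3 : 3 * (2 ^ (m - 1) - 1) ≤ m * (2 ^ (m - 1) - 1) := Nat.mul_le_mul_right _ (by omega)
  omega

/-- The exponents of a torus-homogeneous polynomial all have the same total degree `Σ_i r_i`. [folklore] -/
theorem degree_eq_of_margins {n : ℕ} {h : MvPolynomial (Fin n × Fin n) ℝ≥0} {r : Fin n → ℕ}
    (hth : ∀ m ∈ h.support, ∀ i, ∑ j, m (i, j) = r i) :
    ∀ d ∈ h.support, d.degree = ∑ i, r i := by
  intro d hd
  have h1 : d.degree = ∑ e : Fin n × Fin n, d e := by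
    unfold Finsupp.degree
    exact Finset.sum_subset (Finset.subset_univ _) (fun e _ he => Finsupp.notMem_support_iff.mp he)
  rw [h1, Fintype.sum_prod_type]
  exact Finset.sum_congr rfl (fun i _ => hth d hd i)


/-- `per_G · q` is torus-homogeneous with margins `(r + 1, cc + 1)` when `q` has margins `(r, cc)`:
every exponent of the face permanent is a permutation matrix. [folklore] -/
theorem margins_facePer_mul {n : ℕ} (G : Finset (Fin n × Fin n)) {q : MvPolynomial (Fin n × Fin n) ℝ≥0}
    {r cc : Fin n → ℕ} (hq : ∀ m ∈ q.support, (∀ i, ∑ j, m (i, j) = r i) ∧ (∀ j, ∑ i, m (i, j) = cc j)) :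
    ∀ m ∈ (facePer G * q).support, (∀ i, ∑ j, m (i, j) = r i + 1) ∧ (∀ j, ∑ i, m (i, j) = cc j + 1) := by
  classical
  intro m hm
  obtain ⟨u, hu, A, hA, rfl⟩ := Finset.mem_add.mp (MvPolynomial.support_mul _ _ hm)
  obtain ⟨σ, -, rfl⟩ :=
    (Summit.ValiantsHypothesis.ValiantsHypothesis.Theorems.DivisionGap.PerMultiplesHard.BoardCompression.mem_support_sum_monomial_iff
      permMonomial_injective.injOn (fun _ _ => one_ne_zero) u).1 hu
  obtain ⟨hr, hc⟩ := hq A hA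
  refine ⟨fun i => ?_, fun j => ?_⟩
  · have h1 : ∑ j, permMonomial σ (i, j) = 1 := rowCount_permMonomial σ i
    have h2 := hr i
    simp only [Finsupp.coe_add, Pi.add_apply, Finset.sum_add_distrib, h1, h2]
    omega
  · have h1 : ∑ i, permMonomial σ (i, j) = 1 := colCount_permMonomial σ j
    have h2 := hc j
    simp only [Finsupp.coe_add, Pi.add_apply, Finset.sum_add_distrib, h1, h2]
    omega

/-- **Probes lift through `per_G`** (lead c5): if `π` lies inside `G` and `M ∈ supp t` is a `ζ`-spread probe for `π`, then
`μ_π + M ∈ supp (per_G · t)` is a `ζ`-spread probe for `π` (no cancellation over `ℝ≥0`). [folklore] -/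
theorem probe_facePer_mul {n : ℕ} (G : Finset (Fin n × Fin n)) {ζ : Equiv.Perm (Fin n)}
    {t : MvPolynomial (Fin n × Fin n) ℝ≥0} (π : Equiv.Perm (Fin n)) (hπ : ∀ i, (π i, i) ∈ G)
    {M : (Fin n × Fin n) →₀ ℕ} (hM : M ∈ t.support) (hprobe : ∀ e ∈ M.support, π e.2 = e.1 ∨ π e.2 = ζ e.1) :
    ∃ m ∈ (facePer G * t).support, ∀ e ∈ m.support, π e.2 = e.1 ∨ π e.2 = ζ e.1 := by
  classical
  refine ⟨permMonomial π + M,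
    Summit.ValiantsHypothesis.ValiantsHypothesis.Theorems.DivisionGap.PerMultiplesHard.ThinPatterns.add_mem_support_mul
      ((Summit.ValiantsHypothesis.ValiantsHypothesis.Theorems.DivisionGap.PerMultiplesHard.PushOff.mem_support_facePer).2
        ⟨π, hπ, rfl⟩) hM, ?_⟩
  rintro ⟨r, c⟩ he
  rcases Finset.mem_union.mp (Finsupp.support_add he) with h | h
  · left
    have h' := Finsupp.mem_support_iff.mp h
    rw [permMonomial_apply] at h'
    by_contra hne
    exact h' (if_neg hne)
  · exact hprobe _ h

/-! ### Cycle 7 (lead c7): the BLOCK-SLICE COMPOSITION — LANDED as `Theorems/…RichHostOfSquareBlock.lean` (p134108: `blockSlice_descent`, `blockProbes`,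
`smallWindowEngine`, `richHost_of_squareBlock`) and `Theorems/…RelRegularCompleteClass.lean` (p134445); the in-file copies were removed by lead c8 (evidence copy
of this skeleton 2026-08-17T00:46Z keeps them).  `richHostCompleteClassHard` below is wired to the tree theorem BY NAME. -/

/-- **richHostCompleteClassHard — the RICH-HOST COMPLETE-CLASS RUNG, a THEOREM modulo the extraction target (lead c7 cycle 7; lead c8 cycle 8:
`stub_richSquareBlock` is now itself proved from `stub_quasiRandomSquareBlock` ∘ `stub_orderedFactor`, and this theorem is the tree's
`richHost_of_squareBlock` (p134108) applied to the block that `stub_richSquareBlock` delivers).**  For every richness scale `K ≥ 1` there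
are `d, n₀` such that for `n ≥ n₀`: if the host `G ⊆ [n]²` is RICH (`n! ≤ K^n · #PM(G)`), `t` is torus-homogeneous with margins `(R, C)`,
COMPLETE on `G` (every table on `G` with margins `(R;C)` is an exponent), some such table exists, the margins are balanced, close
(`|R_i − C_j| ≤ n`) and of offset `≥ 3n³`, then `2^{⌊n/d⌋} ≤ L⁺(per_G · t)`.  KNOWN UNCONDITIONALLY (tree): `G = K` (`completeClassMultiplesHard`),
quasi-random `G` (`relDenseCompleteClassHard_unconditional`), regular shift-hosts with no mixing (`relRegularCompleteClassHard`, p134445), commensurable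
margins (`stub_richHostConstantMargins`).  WHY IT MIGHT FAIL: only with `stub_quasiRandomSquareBlock`. [folklore] -/
theorem richHostCompleteClassHard :
    ∀ K : ℕ, 1 ≤ K → ∃ d n₀ : ℕ, 1 ≤ d ∧ ∀ n ≥ n₀, ∀ (G : Finset (Fin n × Fin n))
      (t : MvPolynomial (Fin n × Fin n) ℝ≥0) (R C : Fin n → ℕ),
      n.factorial ≤ K ^ n * pmCount G →
      (∀ m ∈ t.support, (∀ i, ∑ j, m (i, j) = R i) ∧ (∀ j, ∑ i, m (i, j) = C j)) →
      (∀ M : (Fin n × Fin n) →₀ ℕ, M.support ⊆ G →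
        (∀ i, ∑ j, M (i, j) = R i) → (∀ j, ∑ i, M (i, j) = C j) → M ∈ t.support) →
      (∃ M : (Fin n × Fin n) →₀ ℕ, M.support ⊆ G ∧ (∀ i, ∑ j, M (i, j) = R i) ∧ (∀ j, ∑ i, M (i, j) = C j)) →
      ∑ i, R i = ∑ j, C j →
      (∀ i j, R i ≤ C j + n ∧ C j ≤ R i + n) →
      (∀ i, 3 * n ^ 3 ≤ R i) →
      2 ^ (n / d) ≤ complexity (facePer G * t) := by
  classical
  intro K hK
  obtain ⟨Cf, n₁, hCf, hstruct⟩ := stub_richSquareBlock K hK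
  obtain ⟨n₂, hmain⟩ :=
    Summit.ValiantsHypothesis.ValiantsHypothesis.Theorems.DivisionGap.PerMultiplesHard.RichHostOfSquareBlock.richHost_of_squareBlock
      Cf hCf
  refine ⟨Cf * (1024 * Cf), n₁ + n₂, Nat.one_le_iff_ne_zero.mpr (by positivity), ?_⟩
  intro n hn G t R C hrich ht hcomp hex hbal hclose hoff
  obtain ⟨a, A, B, eA, eB, σ, Y', f, hna, hσG, hσAB, hf1, haf, hY', hYrow, hYcol⟩ := hstruct n (by omega) G hrich
  exact hmain n (by omega) G t R C ht hcomp hex hbal hclose hoff a A B eA eB σ Y' f hna hσG hσAB hf1 haf hY' hYrow hYcol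

/-! ### The HYBRID-PROBE ENGINE `hybridDenseBlockHard` (lead c6): removed from the workfile by lead c7 (superseded by the block-slice descent; all parts landed
p130231 p130077 p130101 p130296 p130192 p130191 p130781 p130696 p130703; composition kept in the evidence copy of 2026-08-16T23:10Z). -/

/-! ### The kernel-checked composition -/

/-- **Composition (audited skeleton theorem).**  Concludes the crux `DivisionGap.PerMultiplesHard`
BY NAME from exactly the registered stubs (`stub_torus`, `stub_faceDescent`, `stub_jssContraction`,
`stub_richFaces`, `stub_typedDecomposition`, `stub_alignedRigidity` — the last two through the sorry-free
`thinPatterns` —, the two concentration stubs `stub_rowConcentration` / `stub_colConcentration`, and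
`stub_residual`, invoked by name); no `sorry` of its own; logic + `qp_absorb` + `margins_perPoly_mul` +
`conc_absurd` + `degree_eq_of_margins`. -/
theorem PerMultiplesHard_of :
    Summit.ValiantsHypothesis.ValiantsHypothesis.Theses.DivisionGap.PerMultiplesHard := by
  classical
  intro c
  obtain ⟨κ, hcon⟩ := stub_jssContraction
  obtain ⟨d, hd⟩ := qp_absorb c κ
  obtain ⟨d', hd'⟩ := qp_absorb d κ
  -- NEW (c9): the unconditional rich-host complete-class rung, at richness scale `c + 1`
  obtain ⟨d₁, n₁, hd₁, hRH⟩ := richHostCompleteClassHard (c + 1) (by omega)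
  obtain ⟨n₀, hres⟩ := stub_residual d d' d' (d₁ + n₁) (c + 1)
  refine ⟨n₀ + 10, ?_⟩
  intro n hn h hh
  have hn6 : 6 ≤ n := by omega
  have hn5 : 5 ≤ n := by omega
  have hn3 : 3 ≤ n := by omega
  have hn0 : n ≥ n₀ := by omega
  -- the free normal form: `per · x^g · h'` is no dearer, `h'` torus-homogeneous and content-free
  obtain ⟨g, h', hh', ⟨r, cc, hth⟩, hcf, hle⟩ := stub_torus n h hh
  by_contra hlt
  have hleB : complexity (perPoly (Fin n) ℝ≥0 * h) ≤ 2 ^ ((Nat.log 2 n + c) ^ c) := not_lt.mp hlt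
  -- strip the content `x^g` (JSS): `L(per · h') ≤ 2^{B_d}`
  have hstrip : complexity (perPoly (Fin n) ℝ≥0 * h') ≤ 2 ^ ((Nat.log 2 n + d) ^ d) := by
    have h1 := hcon n (perPoly (Fin n) ℝ≥0 * h') g
    have h2 : monomial g (1 : ℝ≥0) * (perPoly (Fin n) ℝ≥0 * h') =
        perPoly (Fin n) ℝ≥0 * (monomial g (1 : ℝ≥0) * h') := by ring
    rw [h2] at h1
    have h3 : complexity (perPoly (Fin n) ℝ≥0 * (monomial g (1 : ℝ≥0) * h')) + 2 ≤
        2 ^ ((Nat.log 2 n + c) ^ c) + 3 := by omega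
    calc complexity (perPoly (Fin n) ℝ≥0 * h')
        ≤ ((n + 2) * (complexity (perPoly (Fin n) ℝ≥0 * (monomial g (1 : ℝ≥0) * h')) + 2)) ^ κ := h1
      _ ≤ ((n + 2) * (2 ^ ((Nat.log 2 n + c) ^ c) + 3)) ^ κ :=
          Nat.pow_le_pow_left (Nat.mul_le_mul_left _ h3) κ
      _ ≤ 2 ^ ((Nat.log 2 n + d) ^ d) := hd n
  -- every exponent of `h'` has total degree `Σ r`
  have hdeg : ∀ m ∈ h'.support, m.degree = ∑ i, r i := degree_eq_of_margins (fun m hm => (hth m hm).1)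
  -- NEW (c1): no row of any monomial swallows `≥ B_d + 4` whole columns (line-projection rung, row form)
  by_cases hrow : ∀ (i : Fin n) (A : Finset (Fin n)),
      (∃ d₀ ∈ h'.support, ∀ e ∈ d₀.support, e.2 ∈ A → e.1 = i) → A.card ≤ (Nat.log 2 n + d) ^ d + 3
  swap
  · push Not at hrow
    obtain ⟨i, A, hA, hcard⟩ := hrow
    have hconc := stub_rowConcentration n h' hh' _ hdeg i A (A.card - 1) hA (by omega) (by omega)
    exact conc_absurd (B := (Nat.log 2 n + d) ^ d) (by omega) hstrip hconc
  -- NEW (c1): no column of any monomial swallows `≥ B_d + 4` whole rows (column form)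
  by_cases hcol : ∀ (j : Fin n) (A : Finset (Fin n)),
      (∃ d₀ ∈ h'.support, ∀ e ∈ d₀.support, e.1 ∈ A → e.2 = j) → A.card ≤ (Nat.log 2 n + d) ^ d + 3
  swap
  · push Not at hcol
    obtain ⟨j, A, hA, hcard⟩ := hcol
    have hconc := stub_colConcentration n h' hh' _ hdeg j A (A.card - 1) hA (by omega) (by omega)
    exact conc_absurd (B := (Nat.log 2 n + d) ^ d) (by omega) hstrip hconc
  -- NEW (c1): SPREAD-POOR — few permutations carry a spread probe of `per · h'` (the spread engine)
  have hmarg := Summit.ValiantsHypothesis.ValiantsHypothesis.Theorems.DivisionGap.PerMultiplesHard.ThinPatterns.margins_perPoly_mul hth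
  -- NEW (c2, wave 4): the GENERIC RECTANGLE ENGINE — `supp(per·h')` contains a typed rectangle of relative size `≥ 1/L ≥ 2^{-B_d}`
  have hg0 : perPoly (Fin n) ℝ≥0 * h' ≠ 0 := mul_ne_zero (perPoly_ne_zero (Fin n) ℝ≥0) hh'
  have hrect : ∃ p q : MvPolynomial (Fin n × Fin n) ℝ≥0, p ≠ 0 ∧ q ≠ 0 ∧
      complexity p ≤ 2 ^ ((Nat.log 2 n + d) ^ d) ∧ complexity q ≤ 8 * 2 ^ ((Nat.log 2 n + d) ^ d) + 8 ∧
      (p * q).support ⊆ (perPoly (Fin n) ℝ≥0 * h').support ∧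
      (perPoly (Fin n) ℝ≥0 * h').support.card ≤ 2 ^ ((Nat.log 2 n + d) ^ d) * (p.support.card * q.support.card) ∧
      ∃ ρ γ : Fin n → ℕ, (∀ m ∈ p.support, (∀ i, ∑ j, m (i, j) = ρ i) ∧ (∀ j, ∑ i, m (i, j) = γ j)) ∧
        n < 3 * (Finset.univ.filter fun i => ρ i ≠ 0).card ∧ 3 * (Finset.univ.filter fun i => ρ i ≠ 0).card ≤ 2 * n := by
    obtain ⟨p, q, hp, hq, hcp, hcq, hsub, hcard, ρ, γ, hty, hlo, hhi⟩ :=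
      stub_rectangleBound n hn3 (perPoly (Fin n) ℝ≥0 * h') (fun i => r i + 1) (fun j => cc j + 1) hmarg
        (fun i => Nat.succ_ne_zero _) hg0
    refine ⟨p, q, hp, hq, hcp.trans hstrip, hcq.trans (by omega), hsub,
      hcard.trans (Nat.mul_le_mul_right _ hstrip), ρ, γ, hty, hlo, hhi⟩
  -- NEW (c10): the MASS JAW — `supp(per·h')` contains a typed rectangle balanced by TOTAL DEGREE of relative size `≥ 1/L ≥ 2^{-B_d}`
  -- (degree-free Jerrum–Snir window on the homogeneous `per·h'` of degree `n + Σ r`; `stub_massRectangleBound`)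
  have hsumR : ∑ i, (r i + 1) = n + ∑ i, r i := by
    rw [Finset.sum_add_distrib, Finset.sum_const, Finset.card_univ, Fintype.card_fin, smul_eq_mul, mul_one, add_comm]
  have hmrect : ∃ p q : MvPolynomial (Fin n × Fin n) ℝ≥0, p ≠ 0 ∧ q ≠ 0 ∧
      complexity p ≤ 2 ^ ((Nat.log 2 n + d) ^ d) ∧ complexity q ≤ 8 * 2 ^ ((Nat.log 2 n + d) ^ d) + 8 ∧
      (p * q).support ⊆ (perPoly (Fin n) ℝ≥0 * h').support ∧
      (perPoly (Fin n) ℝ≥0 * h').support.card ≤ 2 ^ ((Nat.log 2 n + d) ^ d) * (p.support.card * q.support.card) ∧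
      ∃ ρ γ : Fin n → ℕ, (∀ m ∈ p.support, (∀ i, ∑ j, m (i, j) = ρ i) ∧ (∀ j, ∑ i, m (i, j) = γ j)) ∧
        (n + ∑ i, r i) < 3 * (∑ i, ρ i) ∧ 3 * (∑ i, ρ i) ≤ 2 * (n + ∑ i, r i) := by
    obtain ⟨p, q, hp, hq, hcp, hcq, hsub, hcard, ρ, γ, hty, hlo, hhi⟩ :=
      stub_massRectangleBound n (by omega) (perPoly (Fin n) ℝ≥0 * h') (fun i => r i + 1) (fun j => cc j + 1) hmarg
        (by rw [hsumR]; omega) hg0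
    rw [hsumR] at hlo hhi
    exact ⟨p, q, hp, hq, hcp.trans hstrip, hcq.trans (by omega), hsub,
      hcard.trans (Nat.mul_le_mul_right _ hstrip), ρ, γ, hty, hlo, hhi⟩
  -- NEW (c3): no cheap triple (host `G` on a `k'`-board, content `u`, torus multiplier `q`) has a DEEP-PURE-RICH level slice
  -- (JSS + `stub_levelSlice` + `stub_boardCompressionGen` + `deepPureCount`)
  by_cases htri : ∀ (D k' : ℕ) (G : Finset (Fin k' × Fin k')) (u : (Fin k' × Fin k') →₀ ℕ)
      (q : MvPolynomial (Fin k' × Fin k') ℝ≥0) (r' c' : Fin k' → ℕ) (v : ℕ),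
      k' ≤ n → 1 ≤ v → 3 ^ ((D + 2) ^ 2) ≤ (Finset.univ.filter fun i => r' i + 1 = v).card →
      (∀ m ∈ q.support, (∀ i, ∑ j, m (i, j) = r' i) ∧ (∀ j, ∑ i, m (i, j) = c' j)) →
      complexity (monomial u (1 : ℝ≥0) * (facePer G * q)) ≤ 2 ^ ((Nat.log 2 n + d) ^ d) + 1 →
      (((facePer G * q).support.filter fun M => ∃ σ : Equiv.Perm (Fin k'), ∀ e ∈ M.support, e.1 = σ e.2).image
          (fun M => M.filter (fun e => r' e.1 + 1 = v))).card *
          3 ^ (D * (Finset.univ.filter fun i => r' i + 1 = v).card) ≤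
        (2 ^ ((Nat.log 2 n + d') ^ d') + 1) ^ (3 ^ ((D + 1) ^ 2)) *
          (((Finset.univ.filter fun i => r' i + 1 = v).card).factorial *
            (((Finset.univ.filter fun i => r' i + 1 = v).card + 1) ^ (3 ^ ((D + 1) ^ 2)) *
              2 ^ (D * ((Finset.univ.filter fun i => r' i + 1 = v).card -
                (Finset.univ.filter fun i => r' i + 1 = v).card / 3) + 3 ^ ((D + 2) ^ 2))))
  swap
  · push Not at htri
    obtain ⟨D, k', G, u, q, r', c', v, hk'n, hv1, hkv, htq, hcheap, hrich⟩ := htri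
    set kv := (Finset.univ.filter fun i => r' i + 1 = v).card with hkvdef
    set g := facePer G * q with hgdef
    set Img := ((g.support.filter fun M => ∃ σ : Equiv.Perm (Fin k'), ∀ e ∈ M.support, e.1 = σ e.2).image
      (fun M => M.filter (fun e => r' e.1 + 1 = v))) with hImg
    -- strip the content `u` (JSS at board size `k' ≤ n`)
    have hstripG : complexity g ≤ 2 ^ ((Nat.log 2 n + d') ^ d') := by
      have h1 := hcon k' g u
      have h3 : complexity (monomial u (1 : ℝ≥0) * g) + 2 ≤ 2 ^ ((Nat.log 2 n + d) ^ d) + 3 := by omega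
      calc complexity g ≤ ((k' + 2) * (complexity (monomial u (1 : ℝ≥0) * g) + 2)) ^ κ := h1
        _ ≤ ((n + 2) * (2 ^ ((Nat.log 2 n + d) ^ d) + 3)) ^ κ :=
            Nat.pow_le_pow_left (Nat.mul_le_mul (by omega) h3) κ
        _ ≤ 2 ^ ((Nat.log 2 n + d') ^ d') := hd' n
    -- `g` is torus-homogeneous with margins `(r' + 1, c' + 1)`
    have hmargG := margins_facePer_mul G htq
    -- a pure exponent exists (richness is strict)
    have hImgpos : 0 < Img.card := by
      rcases Nat.eq_zero_or_pos Img.card with h0 | h0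
      · rw [h0, zero_mul] at hrich
        exact absurd (Nat.zero_le _) (not_le.2 hrich)
      · exact h0
    obtain ⟨M₁, hM₁⟩ := Finset.card_pos.1 hImgpos
    obtain ⟨M, hM, -⟩ := Finset.mem_image.1 hM₁
    obtain ⟨hMg, σ, hσ⟩ := Finset.mem_filter.1 hM
    -- slice the level `v` of `R = r' + 1`
    obtain ⟨hcardv, gv, hLgv, hmargv, hslv⟩ :=
      stub_levelSlice k' g (fun i => r' i + 1) (fun j => c' j + 1) v hv1 hmargG ⟨M, hMg, σ, hσ⟩
    have hImgsub : Img ⊆ gv.support.filter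
        (fun M => ∃ σ : Equiv.Perm (Fin k'), ∀ e ∈ M.support, e.1 = σ e.2) := by
      intro M' hM'
      obtain ⟨M'', hM'', rfl⟩ := Finset.mem_image.1 hM'
      obtain ⟨hM''g, τ, hτ⟩ := Finset.mem_filter.1 hM''
      exact Finset.mem_filter.2 ⟨hslv M'' hM''g ⟨τ, hτ⟩, τ,
          Summit.ValiantsHypothesis.ValiantsHypothesis.Theorems.DivisionGap.PerMultiplesHard.DeepPureCount.pure_filter hτ _⟩
    -- compress to the `kv`-board
    have hmargv' : ∀ M ∈ gv.support,
        (∀ i, ∑ j, M (i, j) = if i ∈ (Finset.univ.filter fun i => r' i + 1 = v) then v else 0) ∧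
        (∀ j, ∑ i, M (i, j) = if j ∈ (Finset.univ.filter fun j => c' j + 1 = v) then v else 0) := by
      intro M hM
      refine ⟨fun i => ?_, fun j => ?_⟩
      · simpa only [Finset.mem_filter, Finset.mem_univ, true_and] using (hmargv M hM).1 i
      · simpa only [Finset.mem_filter, Finset.mem_univ, true_and] using (hmargv M hM).2 j
    obtain ⟨g', hmarg', hLg', hcard'⟩ := stub_boardCompressionGen k' kv v
      (Finset.univ.filter fun i => r' i + 1 = v) (Finset.univ.filter fun j => c' j + 1 = v) gv rfl
      (hcardv ▸ rfl) hv1 hmargv'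
    -- the deep pure count on the `kv`-board
    have hdpc := deepPureCount D kv hkv v hv1 g' hmarg'
    have hL' : complexity g' + 1 ≤ 2 ^ ((Nat.log 2 n + d') ^ d') + 1 := by
      have := hLg'.trans (hLgv.trans hstripG)
      omega
    have hfinal : Img.card * 3 ^ (D * kv) ≤ (2 ^ ((Nat.log 2 n + d') ^ d') + 1) ^ (3 ^ ((D + 1) ^ 2)) *
        (kv.factorial * ((kv + 1) ^ (3 ^ ((D + 1) ^ 2)) * 2 ^ (D * (kv - kv / 3) + 3 ^ ((D + 2) ^ 2)))) :=
      calc Img.card * 3 ^ (D * kv)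
          ≤ (gv.support.filter
              (fun M => ∃ σ : Equiv.Perm (Fin k'), ∀ e ∈ M.support, e.1 = σ e.2)).card * 3 ^ (D * kv) :=
            Nat.mul_le_mul_right _ (Finset.card_le_card hImgsub)
        _ ≤ (g'.support.filter
              (fun M => ∃ σ : Equiv.Perm (Fin kv), ∀ e ∈ M.support, e.1 = σ e.2)).card * 3 ^ (D * kv) :=
            Nat.mul_le_mul_right _ hcard'
        _ ≤ _ := hdpc
        _ ≤ _ := Nat.mul_le_mul_right _ (Nat.pow_le_pow_left hL' _)
    exact absurd hfinal (not_le.2 hrich)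
  -- NEW (c4): HOST PROBE ENGINES — no cheap triple `(G, u, q)` (on any `k'`-board, `k' ≤ n`) is spread-rich, column-spread-rich,
  -- `Z`-rich or column-`Z`-rich in ABSOLUTE count on its own board (JSS strip at board size `k'`, then the landed engines at `k'`).
  -- Consumer: padded complete classes with incommensurable margins (`h_pad'`), descended to a padded face of density `> 0.99`.
  have hstripT : ∀ (k' : ℕ) (gg : MvPolynomial (Fin k' × Fin k') ℝ≥0) (u : (Fin k' × Fin k') →₀ ℕ), k' ≤ n →
      complexity (monomial u (1 : ℝ≥0) * gg) ≤ 2 ^ ((Nat.log 2 n + d) ^ d) + 1 →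
      complexity gg ≤ 2 ^ ((Nat.log 2 n + d') ^ d') := by
    intro k' gg u hk'n hcheap
    have h1 := hcon k' gg u
    have h3 : complexity (monomial u (1 : ℝ≥0) * gg) + 2 ≤ 2 ^ ((Nat.log 2 n + d) ^ d) + 3 := by omega
    calc complexity gg ≤ ((k' + 2) * (complexity (monomial u (1 : ℝ≥0) * gg) + 2)) ^ κ := h1
      _ ≤ ((n + 2) * (2 ^ ((Nat.log 2 n + d) ^ d) + 3)) ^ κ :=
          Nat.pow_le_pow_left (Nat.mul_le_mul (by omega) h3) κ
      _ ≤ 2 ^ ((Nat.log 2 n + d') ^ d') := hd' n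
  by_cases hhsp : ∀ (k' : ℕ) (G : Finset (Fin k' × Fin k')) (u : (Fin k' × Fin k') →₀ ℕ)
      (q : MvPolynomial (Fin k' × Fin k') ℝ≥0) (r' c' : Fin k' → ℕ) (ζ : Equiv.Perm (Fin k')),
      5 ≤ k' → k' ≤ n →
      (∀ m ∈ q.support, (∀ i, ∑ j, m (i, j) = r' i) ∧ (∀ j, ∑ i, m (i, j) = c' j)) →
      complexity (monomial u (1 : ℝ≥0) * (facePer G * q)) ≤ 2 ^ ((Nat.log 2 n + d) ^ d) + 1 →
      spreadCount ζ (facePer G * q) * 5 ^ (k' / 10) ≤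
        2 ^ ((Nat.log 2 n + d') ^ d') * (4 ^ (k' / 10) * k'.factorial)
  swap
  · push Not at hhsp
    obtain ⟨k', G, u, q, r', c', ζ, hk5, hk'n, htq, hcheap, hζ⟩ := hhsp
    have hLg := hstripT k' (facePer G * q) u hk'n hcheap
    have heng := spreadPatterns k' hk5 ζ (facePer G * q) (fun i => r' i + 1) (fun j => c' j + 1)
      (margins_facePer_mul G htq) (fun i => Nat.succ_ne_zero _)
    exact absurd (heng.trans (Nat.mul_le_mul_right _ hLg)) (not_le.mpr hζ)
  by_cases hhspc : ∀ (k' : ℕ) (G : Finset (Fin k' × Fin k')) (u : (Fin k' × Fin k') →₀ ℕ)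
      (q : MvPolynomial (Fin k' × Fin k') ℝ≥0) (r' c' : Fin k' → ℕ) (ζ : Equiv.Perm (Fin k')),
      5 ≤ k' → k' ≤ n →
      (∀ m ∈ q.support, (∀ i, ∑ j, m (i, j) = r' i) ∧ (∀ j, ∑ i, m (i, j) = c' j)) →
      complexity (monomial u (1 : ℝ≥0) * (facePer G * q)) ≤ 2 ^ ((Nat.log 2 n + d) ^ d) + 1 →
      colSpreadCount ζ (facePer G * q) * 5 ^ (k' / 10) ≤
        2 ^ ((Nat.log 2 n + d') ^ d') * (4 ^ (k' / 10) * k'.factorial)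
  swap
  · push Not at hhspc
    obtain ⟨k', G, u, q, r', c', ζ, hk5, hk'n, htq, hcheap, hζ⟩ := hhspc
    have hLg := hstripT k' (facePer G * q) u hk'n hcheap
    have heng := spreadPatternsCol k' hk5 ζ (facePer G * q) (fun i => r' i + 1) (fun j => c' j + 1)
      (margins_facePer_mul G htq) (fun j => Nat.succ_ne_zero _)
    exact absurd (heng.trans (Nat.mul_le_mul_right _ hLg)) (not_le.mpr hζ)
  by_cases hhz : ∀ (k' : ℕ) (G : Finset (Fin k' × Fin k')) (u : (Fin k' × Fin k') →₀ ℕ)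
      (q : MvPolynomial (Fin k' × Fin k') ℝ≥0) (r' c' : Fin k' → ℕ) (Z : Finset (Equiv.Perm (Fin k'))),
      k' ≤ n → 1 ≤ Z.card → 3 * Z.card ≤ k' →
      (∀ m ∈ q.support, (∀ i, ∑ j, m (i, j) = r' i) ∧ (∀ j, ∑ i, m (i, j) = c' j)) →
      complexity (monomial u (1 : ℝ≥0) * (facePer G * q)) ≤ 2 ^ ((Nat.log 2 n + d) ^ d) + 1 →
      zCount Z (facePer G * q) * 3 ^ (k' / (3 * Z.card ^ 2)) ≤
        2 ^ ((Nat.log 2 n + d') ^ d') * (2 ^ (k' / (3 * Z.card ^ 2)) * k'.factorial)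
  swap
  · push Not at hhz
    obtain ⟨k', G, u, q, r', c', Z, hk'n, hZ1, hZk, htq, hcheap, hZ⟩ := hhz
    have hLg := hstripT k' (facePer G * q) u hk'n hcheap
    have heng := zSpreadPatterns k' Z.card Z rfl hZ1 hZk (facePer G * q) (fun i => r' i + 1) (fun j => c' j + 1)
      (margins_facePer_mul G htq) (fun i => Nat.succ_ne_zero _)
    exact absurd (heng.trans (Nat.mul_le_mul_right _ hLg)) (not_le.mpr hZ)
  by_cases hhzc : ∀ (k' : ℕ) (G : Finset (Fin k' × Fin k')) (u : (Fin k' × Fin k') →₀ ℕ)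
      (q : MvPolynomial (Fin k' × Fin k') ℝ≥0) (r' c' : Fin k' → ℕ) (Z : Finset (Equiv.Perm (Fin k'))),
      k' ≤ n → 1 ≤ Z.card → 3 * Z.card ≤ k' →
      (∀ m ∈ q.support, (∀ i, ∑ j, m (i, j) = r' i) ∧ (∀ j, ∑ i, m (i, j) = c' j)) →
      complexity (monomial u (1 : ℝ≥0) * (facePer G * q)) ≤ 2 ^ ((Nat.log 2 n + d) ^ d) + 1 →
      colZCount Z (facePer G * q) * 3 ^ (k' / (3 * Z.card ^ 2)) ≤
        2 ^ ((Nat.log 2 n + d') ^ d') * (2 ^ (k' / (3 * Z.card ^ 2)) * k'.factorial)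
  swap
  · push Not at hhzc
    obtain ⟨k', G, u, q, r', c', Z, hk'n, hZ1, hZk, htq, hcheap, hZ⟩ := hhzc
    have hLg := hstripT k' (facePer G * q) u hk'n hcheap
    have heng := zSpreadPatternsCol k' Z.card Z rfl hZ1 hZk (facePer G * q) (fun i => r' i + 1) (fun j => c' j + 1)
      (margins_facePer_mul G htq) (fun j => Nat.succ_ne_zero _)
    exact absurd (heng.trans (Nat.mul_le_mul_right _ hLg)) (not_le.mpr hZ)
  -- NEW (c5): the RELATIVE probe engines at every cheap triple — inside EVERY comparison set `P` of permutations of the `k'`-board,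
  -- the probed part of `P` is `2^{-B_{d'}}`-captured by ONE window rectangle (rows / columns / `Z` / column-`Z`).
  by_cases hRsp : ∀ (k' : ℕ) (G : Finset (Fin k' × Fin k')) (u : (Fin k' × Fin k') →₀ ℕ)
      (q : MvPolynomial (Fin k' × Fin k') ℝ≥0) (r' c' : Fin k' → ℕ) (ζ : Equiv.Perm (Fin k'))
      (P : Finset (Equiv.Perm (Fin k'))),
      5 ≤ k' → k' ≤ n →
      (∀ m ∈ q.support, (∀ i, ∑ j, m (i, j) = r' i) ∧ (∀ j, ∑ i, m (i, j) = c' j)) →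
      complexity (monomial u (1 : ℝ≥0) * (facePer G * q)) ≤ 2 ^ ((Nat.log 2 n + d) ^ d) + 1 →
      ∃ S T : Finset (Fin k'), k' < 5 * S.card ∧ 5 * S.card ≤ 2 * k' ∧
        (P.filter fun π => ∃ M ∈ (facePer G * q).support, ∀ e ∈ M.support, π e.2 = e.1 ∨ π e.2 = ζ e.1).card ≤
          2 ^ ((Nat.log 2 n + d') ^ d') *
            (P.filter fun π => (∀ i ∈ S, π.symm i ∈ T ∨ π.symm (ζ i) ∈ T) ∧
              (∀ j ∈ T, π j ∈ S ∨ ∃ i ∈ S, ζ i = π j)).card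
  swap
  · push Not at hRsp
    obtain ⟨k', G, u, q, r', c', ζ, P, hk5, hk'n, htq, hcheap, hno⟩ := hRsp
    have hLg := hstripT k' (facePer G * q) u hk'n hcheap
    obtain ⟨S, T, hlo, hhi, hle⟩ := stub_spreadPatternsRel k' hk5 ζ (facePer G * q) (fun i => r' i + 1) (fun j => c' j + 1)
      (margins_facePer_mul G htq) (fun i => Nat.succ_ne_zero _) P
    exact absurd (hle.trans (Nat.mul_le_mul_right _ hLg)) (not_le.mpr (hno S T hlo hhi))
  by_cases hRspc : ∀ (k' : ℕ) (G : Finset (Fin k' × Fin k')) (u : (Fin k' × Fin k') →₀ ℕ)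
      (q : MvPolynomial (Fin k' × Fin k') ℝ≥0) (r' c' : Fin k' → ℕ) (ζ : Equiv.Perm (Fin k'))
      (P : Finset (Equiv.Perm (Fin k'))),
      5 ≤ k' → k' ≤ n →
      (∀ m ∈ q.support, (∀ i, ∑ j, m (i, j) = r' i) ∧ (∀ j, ∑ i, m (i, j) = c' j)) →
      complexity (monomial u (1 : ℝ≥0) * (facePer G * q)) ≤ 2 ^ ((Nat.log 2 n + d) ^ d) + 1 →
      ∃ S T : Finset (Fin k'), k' < 5 * S.card ∧ 5 * S.card ≤ 2 * k' ∧
        (P.filter fun π => ∃ M ∈ (facePer G * q).support, ∀ e ∈ M.support, π e.1 = e.2 ∨ π e.1 = ζ e.2).card ≤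
          2 ^ ((Nat.log 2 n + d') ^ d') *
            (P.filter fun π => (∀ i ∈ S, π.symm i ∈ T ∨ π.symm (ζ i) ∈ T) ∧
              (∀ j ∈ T, π j ∈ S ∨ ∃ i ∈ S, ζ i = π j)).card
  swap
  · push Not at hRspc
    obtain ⟨k', G, u, q, r', c', ζ, P, hk5, hk'n, htq, hcheap, hno⟩ := hRspc
    have hLg := hstripT k' (facePer G * q) u hk'n hcheap
    obtain ⟨S, T, hlo, hhi, hle⟩ := stub_spreadPatternsColRel k' hk5 ζ (facePer G * q) (fun i => r' i + 1) (fun j => c' j + 1)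
      (margins_facePer_mul G htq) (fun j => Nat.succ_ne_zero _) P
    exact absurd (hle.trans (Nat.mul_le_mul_right _ hLg)) (not_le.mpr (hno S T hlo hhi))
  by_cases hRz : ∀ (k' : ℕ) (G : Finset (Fin k' × Fin k')) (u : (Fin k' × Fin k') →₀ ℕ)
      (q : MvPolynomial (Fin k' × Fin k') ℝ≥0) (r' c' : Fin k' → ℕ) (Z : Finset (Equiv.Perm (Fin k')))
      (P : Finset (Equiv.Perm (Fin k'))),
      k' ≤ n → 1 ≤ Z.card → 3 * Z.card ≤ k' →
      (∀ m ∈ q.support, (∀ i, ∑ j, m (i, j) = r' i) ∧ (∀ j, ∑ i, m (i, j) = c' j)) →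
      complexity (monomial u (1 : ℝ≥0) * (facePer G * q)) ≤ 2 ^ ((Nat.log 2 n + d) ^ d) + 1 →
      ∃ S T : Finset (Fin k'), k' < 3 * Z.card * S.card ∧ 3 * Z.card * S.card ≤ 2 * k' ∧
        (P.filter fun π => ∃ M ∈ (facePer G * q).support, ∀ e ∈ M.support, ∃ ζ ∈ Z, π e.2 = ζ e.1).card ≤
          2 ^ ((Nat.log 2 n + d') ^ d') *
            (P.filter fun π => (∀ i ∈ S, ∃ ζ ∈ Z, π.symm (ζ i) ∈ T) ∧
              (∀ j ∈ T, ∃ ζ ∈ Z, ∃ i ∈ S, ζ i = π j)).card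
  swap
  · push Not at hRz
    obtain ⟨k', G, u, q, r', c', Z, P, hk'n, hZ1, hZk, htq, hcheap, hno⟩ := hRz
    have hLg := hstripT k' (facePer G * q) u hk'n hcheap
    obtain ⟨S, T, hlo, hhi, hle⟩ := stub_zSpreadPatternsRel k' Z.card Z rfl hZ1 hZk (facePer G * q) (fun i => r' i + 1)
      (fun j => c' j + 1) (margins_facePer_mul G htq) (fun i => Nat.succ_ne_zero _) P
    exact absurd (hle.trans (Nat.mul_le_mul_right _ hLg)) (not_le.mpr (hno S T hlo hhi))
  by_cases hRzc : ∀ (k' : ℕ) (G : Finset (Fin k' × Fin k')) (u : (Fin k' × Fin k') →₀ ℕ)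
      (q : MvPolynomial (Fin k' × Fin k') ℝ≥0) (r' c' : Fin k' → ℕ) (Z : Finset (Equiv.Perm (Fin k')))
      (P : Finset (Equiv.Perm (Fin k'))),
      k' ≤ n → 1 ≤ Z.card → 3 * Z.card ≤ k' →
      (∀ m ∈ q.support, (∀ i, ∑ j, m (i, j) = r' i) ∧ (∀ j, ∑ i, m (i, j) = c' j)) →
      complexity (monomial u (1 : ℝ≥0) * (facePer G * q)) ≤ 2 ^ ((Nat.log 2 n + d) ^ d) + 1 →
      ∃ S T : Finset (Fin k'), k' < 3 * Z.card * S.card ∧ 3 * Z.card * S.card ≤ 2 * k' ∧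
        (P.filter fun π => ∃ M ∈ (facePer G * q).support, ∀ e ∈ M.support, ∃ ζ ∈ Z, π e.1 = ζ e.2).card ≤
          2 ^ ((Nat.log 2 n + d') ^ d') *
            (P.filter fun π => (∀ i ∈ S, ∃ ζ ∈ Z, π.symm (ζ i) ∈ T) ∧
              (∀ j ∈ T, ∃ ζ ∈ Z, ∃ i ∈ S, ζ i = π j)).card
  swap
  · push Not at hRzc
    obtain ⟨k', G, u, q, r', c', Z, P, hk'n, hZ1, hZk, htq, hcheap, hno⟩ := hRzc
    have hLg := hstripT k' (facePer G * q) u hk'n hcheap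
    obtain ⟨S, T, hlo, hhi, hle⟩ := stub_zSpreadPatternsColRel k' Z.card Z rfl hZ1 hZk (facePer G * q) (fun i => r' i + 1)
      (fun j => c' j + 1) (margins_facePer_mul G htq) (fun j => Nat.succ_ne_zero _) P
    exact absurd (hle.trans (Nat.mul_le_mul_right _ hLg)) (not_le.mpr (hno S T hlo hhi))
  -- NEW (c5): RELATIVE Jerrum–Snir at every cheap face permanent `x^u · per_G` (any `k'`-board): inside every `P`, the matchings of `G`
  -- are `2^{-B_{d'}}`-captured by ONE block-diagonal fibre of the degree window.
  by_cases hRjs : ∀ (k' : ℕ) (G : Finset (Fin k' × Fin k')) (u : (Fin k' × Fin k') →₀ ℕ) (P : Finset (Equiv.Perm (Fin k'))),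
      3 ≤ k' → k' ≤ n →
      complexity (monomial u (1 : ℝ≥0) * facePer G) ≤ 2 ^ ((Nat.log 2 n + d) ^ d) + 1 →
      ∃ S T : Finset (Fin k'), k' < 3 * T.card ∧ 3 * T.card ≤ 2 * k' ∧ S.card = T.card ∧
        (P.filter fun π => ∀ i, (π i, i) ∈ G).card ≤
          2 ^ ((Nat.log 2 n + d') ^ d') * (P.filter fun π : Equiv.Perm (Fin k') => T.image ⇑π = S).card
  swap
  · push Not at hRjs
    obtain ⟨k', G, u, P, hk3, hk'n, hcheap, hno⟩ := hRjs
    have hLg := hstripT k' (facePer G) u hk'n hcheap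
    have hsubp : (facePer G).support ⊆ (perPoly (Fin k') ℝ≥0).support := by
      intro m hm
      obtain ⟨σ, -, rfl⟩ :=
        (Summit.ValiantsHypothesis.ValiantsHypothesis.Theorems.DivisionGap.PerMultiplesHard.PushOff.mem_support_facePer).1 hm
      exact (Literature.Barriers.ValiantsHypothesis.JerrumSnir.mem_support_perPoly ℝ≥0).2 ⟨σ, rfl⟩
    obtain ⟨S, T, hlo, hhi, hST, hle⟩ := stub_subSupportCountRel k' hk3 (facePer G) hsubp P
    have hfilt : (P.filter fun π => ∀ i, (π i, i) ∈ G) ⊆ (P.filter fun π => permMonomial π ∈ (facePer G).support) := by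
      intro π hπ
      obtain ⟨hπP, hπG⟩ := Finset.mem_filter.1 hπ
      exact Finset.mem_filter.2 ⟨hπP,
        (Summit.ValiantsHypothesis.ValiantsHypothesis.Theorems.DivisionGap.PerMultiplesHard.PushOff.mem_support_facePer).2
          ⟨π, hπG, rfl⟩⟩
    exact absurd (((Finset.card_le_card hfilt).trans hle).trans (Nat.mul_le_mul_right _ hLg))
      (not_le.mpr (hno S T hlo hhi hST))
  by_cases hsp : ∀ ζ : Equiv.Perm (Fin n), spreadCount ζ (perPoly (Fin n) ℝ≥0 * h') * 5 ^ (n / 10) ≤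
      2 ^ ((Nat.log 2 n + d) ^ d) * (4 ^ (n / 10) * n.factorial)
  swap
  · push Not at hsp
    obtain ⟨ζ, hζ⟩ := hsp
    have heng := spreadPatterns n hn5 ζ (perPoly (Fin n) ℝ≥0 * h') (fun i => r i + 1) (fun j => cc j + 1)
      hmarg (fun i => Nat.succ_ne_zero _)
    exact absurd (heng.trans (Nat.mul_le_mul_right _ hstrip)) (not_le.mpr hζ)
  -- NEW (c1): COLUMN-SPREAD-POOR (the transposed engine)
  by_cases hspc : ∀ ζ : Equiv.Perm (Fin n), colSpreadCount ζ (perPoly (Fin n) ℝ≥0 * h') * 5 ^ (n / 10) ≤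
      2 ^ ((Nat.log 2 n + d) ^ d) * (4 ^ (n / 10) * n.factorial)
  swap
  · push Not at hspc
    obtain ⟨ζ, hζ⟩ := hspc
    have heng := spreadPatternsCol n hn5 ζ (perPoly (Fin n) ℝ≥0 * h') (fun i => r i + 1) (fun j => cc j + 1)
      hmarg (fun j => Nat.succ_ne_zero _)
    exact absurd (heng.trans (Nat.mul_le_mul_right _ hstrip)) (not_le.mpr hζ)
  -- NEW (c1, wave 3): Z-SPREAD-POOR for every shift set `Z` (k-cell engine, rows and columns)
  by_cases hz : ∀ Z : Finset (Equiv.Perm (Fin n)), 1 ≤ Z.card → 3 * Z.card ≤ n →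
      zCount Z (perPoly (Fin n) ℝ≥0 * h') * 3 ^ (n / (3 * Z.card ^ 2)) ≤
        2 ^ ((Nat.log 2 n + d) ^ d) * (2 ^ (n / (3 * Z.card ^ 2)) * n.factorial)
  swap
  · push Not at hz
    obtain ⟨Z, hZ1, hZn, hZ⟩ := hz
    have heng := zSpreadPatterns n Z.card Z rfl hZ1 hZn (perPoly (Fin n) ℝ≥0 * h') (fun i => r i + 1)
      (fun j => cc j + 1) hmarg (fun i => Nat.succ_ne_zero _)
    exact absurd (heng.trans (Nat.mul_le_mul_right _ hstrip)) (not_le.mpr hZ)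
  by_cases hzc : ∀ Z : Finset (Equiv.Perm (Fin n)), 1 ≤ Z.card → 3 * Z.card ≤ n →
      colZCount Z (perPoly (Fin n) ℝ≥0 * h') * 3 ^ (n / (3 * Z.card ^ 2)) ≤
        2 ^ ((Nat.log 2 n + d) ^ d) * (2 ^ (n / (3 * Z.card ^ 2)) * n.factorial)
  swap
  · push Not at hzc
    obtain ⟨Z, hZ1, hZn, hZ⟩ := hzc
    have heng := zSpreadPatternsCol n Z.card Z rfl hZ1 hZn (perPoly (Fin n) ℝ≥0 * h') (fun i => r i + 1)
      (fun j => cc j + 1) hmarg (fun j => Nat.succ_ne_zero _)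
    exact absurd (heng.trans (Nat.mul_le_mul_right _ hstrip)) (not_le.mpr hZ)
  -- NEW (c1): BLOCK PROJECTION — no large block on which the block-diagonal monomials of `h'` have a single part
  by_cases hblk : ∀ (A B : Finset (Fin n)) (u : (Fin n × Fin n) →₀ ℕ), A.card = B.card →
      HasSingleBlockPart A B h' u → A.card ≤ (Nat.log 2 n + d') ^ d' + 2
  swap
  · push Not at hblk
    obtain ⟨A, B, u, hAB, hsbp, hbig⟩ := hblk
    have han : A.card ≤ n := by
      calc A.card ≤ (Finset.univ : Finset (Fin n)).card := Finset.card_le_univ _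
        _ = n := by simp
    obtain ⟨u', hu'⟩ := stub_blockProjection n h' hh' _ hdeg A B u A.card rfl hAB.symm hsbp
    -- strip `x^{u'}` (JSS at board size `#A ≤ n`) and count (Jerrum–Snir on `per_{#A}`)
    have h1 := hcon A.card (perPoly (Fin A.card) ℝ≥0) u'
    have h3 : complexity (monomial u' (1 : ℝ≥0) * perPoly (Fin A.card) ℝ≥0) + 2 ≤
        2 ^ ((Nat.log 2 n + d) ^ d) + 3 := by
      omega
    have hpa : complexity (perPoly (Fin A.card) ℝ≥0) ≤ 2 ^ ((Nat.log 2 n + d') ^ d') :=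
      calc complexity (perPoly (Fin A.card) ℝ≥0)
          ≤ ((A.card + 2) * (complexity (monomial u' (1 : ℝ≥0) * perPoly (Fin A.card) ℝ≥0) + 2)) ^ κ := h1
        _ ≤ ((n + 2) * (2 ^ ((Nat.log 2 n + d) ^ d) + 3)) ^ κ :=
            Nat.pow_le_pow_left (Nat.mul_le_mul (by omega) h3) κ
        _ ≤ 2 ^ ((Nat.log 2 n + d') ^ d') := hd' n
    have ha1 : 1 ≤ A.card := by omega
    have hjs := Summit.ValiantsHypothesis.Theorems.PerDivisionHardNegative.js_le_two_mul_complexity_perPoly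
      (n := A.card) ha1
    exact conc_absurd (m := A.card) (B := (Nat.log 2 n + d') ^ d') (by omega) hpa (hjs.trans (by omega))
  -- NEW (c9): NO RICH COMPLETE-CLASS cheap triple (negation of `richHostCompleteClassHard`: JSS strip at board size `k'`, then the rung at `k'`;
  -- `k' ≥ (d₁ + n₁)·(B_{d'} + 2)` makes `2^{⌊k'/d₁⌋} > 2^{B_{d'}}`)
  by_cases hRCC : ∀ (k' : ℕ) (G : Finset (Fin k' × Fin k')) (u : (Fin k' × Fin k') →₀ ℕ)
      (t : MvPolynomial (Fin k' × Fin k') ℝ≥0) (R C : Fin k' → ℕ),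
      (d₁ + n₁) * ((Nat.log 2 n + d') ^ d' + 2) ≤ k' → k' ≤ n →
      k'.factorial ≤ (c + 1) ^ k' * pmCount G →
      (∀ m ∈ t.support, (∀ i, ∑ j, m (i, j) = R i) ∧ (∀ j, ∑ i, m (i, j) = C j)) →
      (∀ M : (Fin k' × Fin k') →₀ ℕ, M.support ⊆ G →
        (∀ i, ∑ j, M (i, j) = R i) → (∀ j, ∑ i, M (i, j) = C j) → M ∈ t.support) →
      (∃ M : (Fin k' × Fin k') →₀ ℕ, M.support ⊆ G ∧ (∀ i, ∑ j, M (i, j) = R i) ∧ (∀ j, ∑ i, M (i, j) = C j)) →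
      ∑ i, R i = ∑ j, C j → (∀ i j, R i ≤ C j + k' ∧ C j ≤ R i + k') → (∀ i, 3 * k' ^ 3 ≤ R i) →
      2 ^ ((Nat.log 2 n + d) ^ d) + 1 < complexity (monomial u (1 : ℝ≥0) * (facePer G * t))
  swap
  · push Not at hRCC
    obtain ⟨k', G, u, t, R, C, hk'lo, hk'n, hrichk, ht, hcomp, hex, hbal, hclose, hoff, hcheap⟩ := hRCC
    have hLg := hstripT k' (facePer G * t) u hk'n hcheap
    set B' := (Nat.log 2 n + d') ^ d' with hB'
    have hB2 : d₁ + n₁ ≤ (d₁ + n₁) * (B' + 2) := Nat.le_mul_of_pos_right _ (by omega)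
    have hk'n₁ : n₁ ≤ k' := by omega
    have hlow := hRH k' hk'n₁ G t R C hrichk ht hcomp hex hbal hclose hoff
    -- `⌊k'/d₁⌋ ≥ B' + 1`
    have hdiv : B' + 1 ≤ k' / d₁ := by
      apply (Nat.le_div_iff_mul_le (by omega)).mpr
      calc (B' + 1) * d₁ ≤ (B' + 2) * (d₁ + n₁) := Nat.mul_le_mul (by omega) (by omega)
        _ = (d₁ + n₁) * (B' + 2) := by ring
        _ ≤ k' := hk'lo
    have hpow : 2 ^ (B' + 1) ≤ 2 ^ (k' / d₁) := Nat.pow_le_pow_right (by norm_num) hdiv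
    have : 2 ^ (B' + 1) ≤ 2 ^ B' := le_trans (le_trans hpow hlow) hLg
    have h2 : 2 ^ B' < 2 ^ (B' + 1) := Nat.pow_lt_pow_right (by norm_num) (by omega)
    omega
  by_cases hal : ∀ (D : ℕ), 1 ≤ D → 3 ^ (D + 1) ≤ n →
      ∀ (G : Finset (Fin n × Fin n)) (w : Fin n × Fin n → ℕ) (u : (Fin n × Fin n) →₀ ℕ), CutsOut w G →
      n.factorial * ((n + 1) ^ (2 ^ D - 1) * 2 ^ (D * (n - n / 3) + 4 * D * 2 ^ D)) *
          (2 ^ ((Nat.log 2 n + d') ^ d') + 1) ^ (2 ^ D - 1) < pmCount G * 3 ^ (D * n) →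
      ¬ HasSingleGPart G w h' u
  · -- ALIGNED with every rich face
    by_cases hpoor : ∃ π : Equiv.Perm (Fin n),
        pureCount (perPoly (Fin n) ℝ≥0 * h') ≤
          2 ^ ((Nat.log 2 n + d) ^ d) * typeK n * pureCountAt (perPoly (Fin n) ℝ≥0 * h') π
    · -- aligned ∧ pure-poor ∧ concentration-poor ∧ spread-poor ∧ Z-spread-poor: the residual stub
      exact absurd (hres n hn0 h' hh' r cc hth hcf hrow hcol hsp hspc hz hzc hblk hal hrect hmrect htri hhsp hhspc hhz hhzc hRsp hRspc hRz hRzc hRjs hRCC hpoor)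
        (not_lt.mpr hstrip)
    · -- pure-rich: the typed vertex count
      push Not at hpoor
      have htyp := thinPatterns n hn3 (perPoly (Fin n) ℝ≥0 * h') (fun i => r i + 1)
        (fun j => cc j + 1)
        (Summit.ValiantsHypothesis.ValiantsHypothesis.Theorems.DivisionGap.PerMultiplesHard.ThinPatterns.margins_perPoly_mul hth)
        (fun i => Nat.succ_ne_zero _)
      obtain ⟨π, -, hπ⟩ := Finset.exists_mem_eq_sup (Finset.univ : Finset (Equiv.Perm (Fin n)))
        Finset.univ_nonempty (fun π : Equiv.Perm (Fin n) => pureCountAt (perPoly (Fin n) ℝ≥0 * h') π)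
      rw [hπ] at htyp
      have h1 := hpoor π
      have h2 : 2 ^ ((Nat.log 2 n + d) ^ d) * (typeK n * pureCountAt (perPoly (Fin n) ℝ≥0 * h') π) <
          complexity (perPoly (Fin n) ℝ≥0 * h') *
            (typeK n * pureCountAt (perPoly (Fin n) ℝ≥0 * h') π) := by
        rw [← mul_assoc, ← mul_assoc]
        exact lt_of_lt_of_le h1 htyp
      have h3 : 2 ^ ((Nat.log 2 n + d) ^ d) < complexity (perPoly (Fin n) ℝ≥0 * h') :=
        Nat.lt_of_mul_lt_mul_right h2
      exact absurd (lt_of_lt_of_le h3 hstrip) (lt_irrefl _)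
  · -- NOT aligned: a DEEP-rich face (depth `D`) with a single `G`-part — descend, strip, count at depth `D`
    push Not at hal
    obtain ⟨D, hD1, hDn, G, w, u, hcut, hrich, hsingle⟩ := hal
    have hdesc : complexity (monomial u (1 : ℝ≥0) * facePer G) ≤
        complexity (perPoly (Fin n) ℝ≥0 * h') + 1 := stub_faceDescent n G w h' u hcut hh' hsingle
    have hG : complexity (facePer G) ≤ 2 ^ ((Nat.log 2 n + d') ^ d') := by
      have h3 : complexity (monomial u (1 : ℝ≥0) * facePer G) + 2 ≤
          2 ^ ((Nat.log 2 n + d) ^ d) + 3 := by omega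
      calc complexity (facePer G)
          ≤ ((n + 2) * (complexity (monomial u (1 : ℝ≥0) * facePer G) + 2)) ^ κ := hcon n (facePer G) u
        _ ≤ ((n + 2) * (2 ^ ((Nat.log 2 n + d) ^ d) + 3)) ^ κ :=
            Nat.pow_le_pow_left (Nat.mul_le_mul_left _ h3) κ
        _ ≤ 2 ^ ((Nat.log 2 n + d') ^ d') := hd' n
    -- the DEEP count at depth `D` (`richFacesDeepD`, landed p112943):
    have hjs := stub_richFacesDeepD D hD1 n hDn G
    have hle2 : pmCount G * 3 ^ (D * n) ≤
        n.factorial * ((n + 1) ^ (2 ^ D - 1) * 2 ^ (D * (n - n / 3) + 4 * D * 2 ^ D)) *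
          (2 ^ ((Nat.log 2 n + d') ^ d') + 1) ^ (2 ^ D - 1) := by
      calc pmCount G * 3 ^ (D * n)
          ≤ (complexity (facePer G) + 1) ^ (2 ^ D - 1) *
              (n.factorial * ((n + 1) ^ (2 ^ D - 1) * 2 ^ (D * (n - n / 3) + 4 * D * 2 ^ D))) := hjs
        _ ≤ (2 ^ ((Nat.log 2 n + d') ^ d') + 1) ^ (2 ^ D - 1) *
              (n.factorial * ((n + 1) ^ (2 ^ D - 1) * 2 ^ (D * (n - n / 3) + 4 * D * 2 ^ D))) :=
            Nat.mul_le_mul_right _ (Nat.pow_le_pow_left (by omega) _)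
        _ = _ := mul_comm _ _
    exact absurd (lt_of_lt_of_le hrich hle2) (lt_irrefl _)

/-! ### The card's rung `offFace_rung` (`cutsOut_indicator`, `hasSingleGPart_zero`): REMOVED from the workfile by lead c7 for size; kept in every evidence copy of this skeleton ≤ 2026-08-16T23:10Z. -/

end Summit.ValiantsHypothesis.ValiantsHypothesis.Cruxes.PerMultiplesHard.UnchargedFaceWalk

end
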